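import Mathlib
import Literature.NumberTheory.LFunctions.Zhang2022.SkeletonPartThree
import Literature.NumberTheory.LFunctions.Zhang2022.Section14MeanSquareMajorant
import Literature.NumberTheory.LFunctions.Zhang2022.KappaLSeries
import Literature.NumberTheory.LFunctions.Zhang2022.Section14MeanSquareLowerBound
import Literature.NumberTheory.LFunctions.Zhang2022.Section4Lemma45
import Literature.NumberTheory.LFunctions.Zhang2022.Section5VerticalShift
import Literature.NumberTheory.LFunctions.Zhang2022.SkeletonWindowPowers
import HarnessLib

/-!
# Zhang (2022) §7a, typed statements: the §7 objects, Proposition 7.1 (banked) and the proof of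
# Proposition 7.1, «Initial steps», through the Cauchy chain of (7.5)

Cell `siegel-zhang`, D-0069 statement-typing campaign, layer L2, slice **L2-t2** of
`plan/L2/ASSIGNMENTS.md` v1: Y. Zhang, *Discrete mean estimates and the Landau–Siegel zero*,
arXiv:2211.02515v1 (2022) [Zhang2022LandauSiegel], **§7 «Mean-value formula I», tex L1786–L1911 of
the arXiv source `lsz3__2_.tex`, PDF pp. 32–35** — an UNREFEREED manuscript under adjudication.
**Every `def … : Prop` below is a CLAIM OF THE MANUSCRIPT, STATED NOT ASSERTED; typed ≠ discharged.
WHAT THIS IS NOT: any claim about Theorems 1–2 of the source or about Landau–Siegel zeros.**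

DAG nodes typed here (ids of `plan/DAG.tsv`; the first token of every docstring is the node id):

| node | tex | p. | decl here | kind |
|---|---|---|---|---|
| `Z22:§7.u001` `κ̃(d;m,s)` | L1790 | 32 | `kappaTilde_def` (object banked: `Skeleton.kappaTilde`) | object |
| `Z22:§7.u002` `λ(m,s)` | L1794 | 33 | `lam_def` (`Skeleton.lam`) | object |
| `Z22:§7.u003` `κ̃₀ⱼ, λ₀ⱼ` | L1798 | 33 | `kappaTildeZero_def`, `lamZero_def` (`Skeleton.kappaTildeZero/lamZero`) | object |
| `Z22:§7.u004` `ξ₀ⱼ(n;d,r)` | L1802 | 33 | `xiZero_def` (`Skeleton.xiZero`) | object |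
| `Z22:§7.u005` `λ̃₀ⱼ(n,dr)` | L1806 | 33 | `lamTildeZero_def` (`Skeleton.lamTildeZero`) | object |
| `Z22:(7.1)` `𝒞(s,ψ)` | L1810 | 33 | `frakcW_def` (`Skeleton.frakcW`) | object |
| `Z22:(7.2)` | L1814 | 33 | `adm72_iff` (`Skeleton.Adm72`, banked p403323) | claim-shape (hypothesis) |
| `Z22:§7.u006` `𝐚̄` | L1818 | 33 | `abar` | object |
| `Z22:§7.u007` `A(𝐚;s,ψ)`, `A(𝐚;1−s,ψ̄)` | L1821 | 33 | `Apoly_eq`, `ApolyBar_eq` (`Skeleton.Apoly/ApolyBar`) | object |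
| prose L1824 `𝔍(z)` | L1824 | 33 | `segJ`, `intJ`, `absIntJ` (via `Lemma81.segInt`) | object |
| `Z22:Prop7.1` | L1832 | 33 | banked `Skeleton.Prop71 c'`; proof node `Skeleton.Ded71 c'` | CLAIM (banked) |
| `Z22:§7.u008` `Θ₁(𝐚₁,𝐚₂) := …` | L1834 | 33 | `Theta1_def` (`Skeleton.Theta1`); the asserted `= …` IS `Skeleton.Prop71` | object |
| `Z22:§7.u009` `𝔓 = Σ_{p∼P} p` | L1842 | 33 | none new: `Skeleton.frakP_eq_sum_primeWindow` (banked theorem) | object |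
| `Z22:§7.u010` `S_j(𝐚₁,𝐚₂)` | L1845 | 34 | `Sj_def` (`Skeleton.Sj`) | object |
| `Z22:§7.u011` `E(𝐚₁,𝐚₂)` | L1849 | 34 | `Ecal_def` (`Skeleton.Ecal`) | object |
| `Z22:Prop7.1.pf.a-initial` | L1856 | 34 | `DedEq73` (this slice's part: the proof of (7.3)); the rest of part (a), (7.6)–(7.11), is slice L2-t3 | deduction |
| `Z22:(7.3)` | L1860 | 34 | `Eq73` | CLAIM |
| `Z22:§7.u012` `Σκ(n)n⁻ˢ = ζζζ/ζ` | L1866 | 34 | `Step7u012` (object banked: `Skeleton.kappaZ`; identity PROVED in tree: `MeanSquareMajorant.LSeries_kappa`) | CLAIM |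
| `Z22:§7.u013` | L1870 | 34 | `Step7u013` | CLAIM |
| `Z22:§7.u014` | L1874 | 34 | `Step7u014` | CLAIM |
| `Z22:§7.u015` | L1878 | 34 | `Step7u015` | CLAIM |
| `Z22:§7.u016` | L1882 | 34 | `Step7u016` | CLAIM |
| `Z22:(7.4)` | L1886 | 34 | `Eq74` | CLAIM |
| `Z22:§7.u017` | L1890 | 35 | `Step7u017` | CLAIM |
| `Z22:§7.u018` | L1894 | 35 | `Step7u018` (+ alternative reading `Step7u018b`; AMBIGUITY) | CLAIM |
| `Z22:(7.5)` | L1900 | 35 | `Eq75`; deduction `DedEq75` ("by Proposition 2.1 and (2.9)") | CLAIM |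
| prose L1903 `(κ∗a₁)(m) = O(τ₅(m))` | L1903 | 35 | `Step7u019kappa` | CLAIM |
| `Z22:§7.u019` Cauchy chain | L1904 | 35 | `Step7u019a` (Cauchy/Hölder), `Step7u019b` (the `≪`) | CLAIM |

Conventions (skel/INTERFACE.md §3, binding): `Skeleton.ForAllLarge` for "`D` sufficiently large";
"`X = o(𝔓)`" ↦ `∀ ε > 0, ForAllLarge (… ≤ ε * frakP D)`; "`X ≪ Y`" ↦ `∃ C, ForAllLarge (… ≤ C * Y)`;
Zhang's negligible `ε = exp{−c𝓛¹⁰}` (§4, tex L1062) ↦ `∃ c > 0, … Real.exp (-c * Skeleton.ell D ^ 10)`;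
"`a(n) ≪ 1`, `a(n) = 0` for `n ≥ PT⁻²`" (7.2) ↦ `Skeleton.Adm72 D B a` with the bound `B` explicit
and implied constants allowed to depend on `B`; the constant `c′` of (2.13) is the explicit parameter
`(c' : ℝ)` wherever `β₁, β₂, β₃` enter. Assumption (A) (`Skeleton.AssumptionA D χ`) is an antecedent of
the claims that involve the exceptional character `χ` (through `Ψ₁`, `Ψ₂`); the purely analytic
bounds of this slice ((7.4), the trivial bounds, the Stirling-type bound for `Z(s,ψ)⁻¹`) do not
mention `χ` and are typed without it, as the banked §5–§6 nodes are. Sums "`Σ_{ψ∈Ψ}`" run over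
`PsiAll D = Skeleton.finsetOf Set.univ` (`Skeleton.Chr D` is finite), "`Σ_{ψ∈Ψ₂}`" over
`Skeleton.finsetOf (Skeleton.PsiTwo χ)`. The segment `𝔍(z) = [s₀+z−i𝓛₁, s₀+z+i𝓛₁]` is used
with real `z` only (`z = 1, 0, 𝓛⁹` here; `±α` in §8); `∫_{𝔍(z)} F(s) ds = 2πi · Lemma81.segInt`
(parametrisation `s = z + s₀ + iv`, `ds = i dv`) and `∫_{𝔍(z)} |F(s)||ds| = ∫_{−𝓛₁}^{𝓛₁} |F(z+s₀+iv)| dv`.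
The symbol printed `𝔠`/`𝒞` in (7.1) is the TeX macro `\c = \mathcal{C}`; the banked object is
`Skeleton.frakcW`.

Statement-only file (no `sorry`, no `axiom`, no instances, no notation); the unfolding theorems of the
banked objects are proved by `rfl`. The final sections `Discharges` and `TrivialBounds` (theorem-only
appends) PROVE the inner steps `Z22:§7.u012` (`step7u012_holds`), `Z22:§7.u013` (`step7u013_holds`),
`Z22:§7.u014` (`step7u014_holds`), `Z22:(7.4)` (`eq74_holds`, from the tree's
`SmoothWeight.integral_norm_omega_segment_le_of_abs_le`) and `Z22:§7.u015` (`step7u015_holds`: the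
Rankin-trick tail bound via `|κ| ≤ τ₄`, `Σ τ₅(m)m^{−σ₀} = ζ(σ₀)⁵ ≤ (1+log P²)⁵`, and the short-sum
bound `norm_ApolyBar_le`); the sections `ZfacInverse`, `ContourShift` and `MoveToCriticalLine` PROVE
`Z22:§7.u016` (`step7u016_holds`, via `norm_Zfac_inv_le`: `|Z(s,ψ)⁻¹| ≤ e³(pt₀)^{σ−1/2}` from
`|Z(½+it)| = 1`, `Lemma45.eq_mul_exp_integral_logDeriv_segment` and the Stirling bound
`GammaFactor.norm_logDeriv_Zfac_add_log_le`), the rectangle form of "moving the segment"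
(`intJ_sub_intJ_eq`, Mathlib's `Complex.integral_boundary_rect_eq_zero_of_differentiableOn`) and
`Z22:§7.u018` in the reading `Step7u018b` (`step7u018b_holds`: Cauchy's theorem between `𝔍(0)` and
`𝔍(1)`, `|Z| = 1` on `𝔍(0)`, exponentially small `ω` on the horizontal sides); the sections
`MoveToFarLine`, `MoveToFarLineMain` and `MoveAssembled` PROVE `Z22:§7.u017` (`step7u017_holds`: the
tail `m ≥ P²` on `𝔍(1)` is `≪ e^{−𝓛¹⁰/8}`, by Cauchy's theorem between `𝔍(1)` and `𝔍(𝓛⁹)` — the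
tail is holomorphic on `σ > 5/4` (`differentiableOn_kconvTail`), and along the contour the trivial
bounds u015/u016 combine to `(pt₀)^{σ−½}P^{2(1−σ)}(PT⁻²)^σ ≤ e^{3𝓛⁹/2−(σ−½)𝓛}`
(`boundary_powers_le`)) and `Z22:§7.u018` in its principal reading (`step7u018_holds`: u014's
identity on `𝔍(1)`, the split `kconvSeries_eq_head_add_tail`, `|−i(pt₀)^{β₃}| = 1`, then u017 and
u018b); nothing else here is discharged, and nothing here bears on the cell's verdict of record
(`Skeleton.Margin232`, `Ineq824`).

## References

* Y. Zhang, arXiv:2211.02515v1 (2022), §7 pp. 32–35, (7.1)–(7.5); §2 (2.9) p. 6, Prop. 2.1 p. 6;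
  §4 p. 19 (tex L1062, `ε`); §5 (5.6)–(5.7). [cite: Zhang2022LandauSiegel, §7 pp. 32–35]
-/

noncomputable section

open Complex Real ComplexConjugate

namespace Literature.NumberTheory.LFunctions.Zhang2022.Section7aStatements

/-! ## The §7 objects (pp. 32–33): unfolding lemmas of the banked skeleton objects -/

section Objects

variable (c' : ℝ) (D : ℕ)

open scoped Classical in
/-- `Z22:§7.u001` OBJECT (banked as `Skeleton.kappaTilde`; `𝔫(d)` = `Skeleton.nset d`, "`h ∈ 𝔫(d)` iff
every prime factor of `h` divides `d`", p. 32 tex L1789):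
"`κ̃(d;m,s) = Σ_{h∈𝔫(d),(h,m)=1} κ(dh)h^{−s}`" (a series). [cite: Zhang2022LandauSiegel, §7 p.32, tex L1790] -/
theorem kappaTilde_def (d m : ℕ) (s : ℂ) :
    Skeleton.kappaTilde c' D d m s =
      ∑' h : ℕ, if h ∈ Skeleton.nset d ∧ Nat.Coprime h m then
        Skeleton.kappaZ c' D (d * h) / (h : ℂ) ^ s else 0 := rfl

/-- `Z22:§7.u002` OBJECT (banked as `Skeleton.lam`):
"`λ(m,s) = ∏_{q∣m} (1−q^{−s−β₁})(1−q^{−s−β₂})(1−q^{−s−β₃})/(1−q^{−s})`" (`q` prime).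
[cite: Zhang2022LandauSiegel, §7 p.33, tex L1794] -/
theorem lam_def (m : ℕ) (s : ℂ) :
    Skeleton.lam c' D m s =
      ∏ q ∈ m.primeFactors,
        (1 - (q : ℂ) ^ (-(s + Skeleton.beta1 c' D))) * (1 - (q : ℂ) ^ (-(s + Skeleton.beta2 c' D))) *
          (1 - (q : ℂ) ^ (-(s + Skeleton.beta3 c' D))) / (1 - (q : ℂ) ^ (-s)) := rfl

/-- `Z22:§7.u003` OBJECT (banked as `Skeleton.kappaTildeZero`): "`κ̃(d;m,1−β_j) = κ̃₀ⱼ(d;m)`"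
(`1 ≤ j ≤ 3`; `β_j` = `Skeleton.betaJ c' D j`). [cite: Zhang2022LandauSiegel, §7 p.33, tex L1798] -/
theorem kappaTildeZero_def (j d m : ℕ) :
    Skeleton.kappaTildeZero c' D j d m = Skeleton.kappaTilde c' D d m (1 - Skeleton.betaJ c' D j) :=
  rfl

/-- `Z22:§7.u003` OBJECT (banked as `Skeleton.lamZero`): "`λ(m,1−β_j) = λ₀ⱼ(m)`".
[cite: Zhang2022LandauSiegel, §7 p.33, tex L1798] -/
theorem lamZero_def (j m : ℕ) :
    Skeleton.lamZero c' D j m = Skeleton.lam c' D m (1 - Skeleton.betaJ c' D j) := rfl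

/-- `Z22:§7.u005` OBJECT (banked as `Skeleton.lamTildeZero`): "`λ̃₀ⱼ(n,dr) = ∏_{q∣n,(q,dr)=1} λ₀ⱼ(q)`".
[cite: Zhang2022LandauSiegel, §7 p.33, tex L1806] -/
theorem lamTildeZero_def (j n dr : ℕ) :
    Skeleton.lamTildeZero c' D j n dr =
      ∏ q ∈ n.primeFactors.filter (fun q => Nat.Coprime q dr), Skeleton.lamZero c' D j q := rfl

/-- `Z22:§7.u004` OBJECT (banked as `Skeleton.xiZero`):
"`ξ₀ⱼ(n;d,r) = λ̃₀ⱼ(n,dr) Σ_{n=d₁k,(k,r)=1} κ̃₀ⱼ(d₁;drk)μ(k)k^{1−β_j}/φ(k)`" (`d₁ = n/k`).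
[cite: Zhang2022LandauSiegel, §7 p.33, tex L1802] -/
theorem xiZero_def (j n d r : ℕ) :
    Skeleton.xiZero c' D j n d r =
      Skeleton.lamTildeZero c' D j n (d * r) *
        ∑ k ∈ n.divisors.filter (fun k => Nat.Coprime k r),
          Skeleton.kappaTildeZero c' D j (n / k) (d * r * k) * (ArithmeticFunction.moebius k : ℂ) *
            (k : ℂ) ^ (1 - Skeleton.betaJ c' D j) / (Nat.totient k : ℂ) := rfl

variable {D} (x : Skeleton.Chr D)

/-- `Z22:(7.1)` OBJECT (banked as `Skeleton.frakcW`; the printed letter is calligraphic `𝒞`):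
"`𝒞(s,ψ) = −i(pt₀)^{β₃}Z(s,ψ)⁻¹ L(s+β₁,ψ)L(s+β₂,ψ)L(s+β₃,ψ)/L(s,ψ)`" for `ψ (mod p) ∈ Ψ`
(`Z(s,ψ)` = `GammaFactor.Zfac`, (2.2)). [cite: Zhang2022LandauSiegel, §7 (7.1) p.33, tex L1810] -/
theorem frakcW_def (s : ℂ) :
    Skeleton.frakcW c' x s =
      -I * (((x.p : ℝ) * Skeleton.t0 D : ℝ) : ℂ) ^ Skeleton.beta3 c' D * (GammaFactor.Zfac x.ψ s)⁻¹ *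
        (x.ψ.LFunction (s + Skeleton.beta1 c' D) * x.ψ.LFunction (s + Skeleton.beta2 c' D) *
          x.ψ.LFunction (s + Skeleton.beta3 c' D)) / x.ψ.LFunction s := rfl

omit c' x in
/-- `Z22:(7.2)` (banked as `Skeleton.Adm72 D B a`, p403323): "`a(n) ≪ 1`, `a(n) = 0` if `n ≥ PT⁻²`",
with the implied bound `B` explicit. This is the standing HYPOTHESIS on the sequences `𝐚₁, 𝐚₂` of
Prop. 7.1, not a claim. [cite: Zhang2022LandauSiegel, §7 (7.2) p.33, tex L1814] -/
theorem adm72_iff (D : ℕ) (B : ℝ) (a : ℕ → ℂ) :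
    Skeleton.Adm72 D B a ↔
      (∀ n, ‖a n‖ ≤ B) ∧ ∀ n : ℕ, Skeleton.bigP D / Skeleton.bigT D ^ 2 ≤ n → a n = 0 := Iff.rfl

omit c' x in
/-- `Z22:§7.u006` OBJECT: "`𝐚̄ = {ā(n)}`, `ā(n) = conj a(n)`" (the conjugate sequence; used in
Lemma 8.1 as `Θ₁(𝐚̄₂,𝐚̄₁)`, where the skeleton writes `fun n => conj (a n)` inline).
[cite: Zhang2022LandauSiegel, §7 p.33, tex L1818] -/
def abar (a : ℕ → ℂ) : ℕ → ℂ := fun n => conj (a n)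

omit c' in
/-- `Z22:§7.u007` OBJECT (banked as `Skeleton.Apoly` = `Lemma81.dirPoly (Nsupp D) a ψ`):
"`A(𝐚;s,ψ) = Σ_n a(n)ψ(n)n^{−s}`" — a finite sum over `n < ⌈PT⁻²⌉` by (7.2).
[cite: Zhang2022LandauSiegel, §7 p.33, tex L1821] -/
theorem Apoly_eq (a : ℕ → ℂ) (s : ℂ) :
    Skeleton.Apoly x a s =
      ∑ n ∈ Finset.range (Skeleton.Nsupp D), a n * x.ψ n * (n : ℂ) ^ (-s) := rfl

omit c' in
/-- `Z22:§7.u007` OBJECT (banked as `Skeleton.ApolyBar` = `Lemma81.dirPoly (Nsupp D) a ψ⁻¹`):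
"`A(𝐚;1−s,ψ̄) = Σ_n a(n)ψ̄(n)n^{−(1−s)}`" (`ψ̄ = ψ⁻¹`; the banked object takes the argument `w`,
used at `w = 1 − s`). [cite: Zhang2022LandauSiegel, §7 p.33, tex L1821] -/
theorem ApolyBar_eq (a : ℕ → ℂ) (w : ℂ) :
    Skeleton.ApolyBar x a w =
      ∑ n ∈ Finset.range (Skeleton.Nsupp D), a n * x.ψ⁻¹ n * (n : ℂ) ^ (-w) := rfl

omit c' x in
/-- OBJECT (prose, p. 33 tex L1824): "Let `𝔍(z)` denote the segment `[s₀+z−i𝓛₁, s₀+z+i𝓛₁]`"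
(`s₀ = 1/2 + 2πit₀`, `𝓛₁ = 𝓛⁴⁰⁵`), for real `z`, as a set. [cite: Zhang2022LandauSiegel, §7 p.33, tex L1824] -/
def segJ (D : ℕ) (z : ℝ) : Set ℂ :=
  {s | s.re = 1 / 2 + z ∧ |s.im - 2 * π * Skeleton.t0 D| ≤ Skeleton.ell1 D}

omit c' x in
/-- OBJECT: the segment integral "`∫_{𝔍(z)} F(s) ds`" (p. 33 tex L1824; p. 34), i.e.
`2πi · (1/2πi)∫_{𝔍(z)} F(s) ds = 2πi · Lemma81.segInt t₀ 𝓛₁ z F` (parametrisation `s = z+s₀+iv`,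
`−𝓛₁ ≤ v ≤ 𝓛₁`, `ds = i dv`). [cite: Zhang2022LandauSiegel, §7 p.33, tex L1824] -/
def intJ (D : ℕ) (z : ℝ) (F : ℂ → ℂ) : ℂ :=
  2 * π * I * Lemma81.segInt (Skeleton.t0 D) (Skeleton.ell1 D) z F

omit c' x in
/-- OBJECT: "`∫_{𝔍(z)} |F(s) ds|`" (as in (7.4), p. 34), the integral of `|F|` against arc length
on `𝔍(z)`: `∫_{−𝓛₁}^{𝓛₁} |F(z + s₀ + iv)| dv`. [cite: Zhang2022LandauSiegel, §7 (7.4) p.34, tex L1886] -/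
def absIntJ (D : ℕ) (z : ℝ) (F : ℂ → ℂ) : ℝ :=
  ∫ v in (-Skeleton.ell1 D)..Skeleton.ell1 D, ‖F ((z : ℂ) + Skeleton.s0 D + v * I)‖

omit c' x in
/-- OBJECT: "`Σ_{ψ∈Ψ}`" — the whole family `Ψ` (all primitive `ψ (mod p)`, `p ∼ P`) as a `Finset`
(`Skeleton.Chr D` is a finite type; `Skeleton.finsetOf` of the universal set).
[cite: Zhang2022LandauSiegel, §2 p.5, tex L367; §7 p.35, tex L1905] -/
def PsiAll (D : ℕ) : Finset (Skeleton.Chr D) := Skeleton.finsetOf (Set.univ : Set (Skeleton.Chr D))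

end Objects

/-! ## Proposition 7.1 (p. 33, banked) and its displayed objects -/

section Prop71

variable (c' : ℝ) {D : ℕ} (χ : DirichletCharacter ℂ D)

/-- `Z22:§7.u008` OBJECT (banked as `Skeleton.Theta1`; the ASSERTION of this display, "`= α⁻¹(½S₁ +
2S₂ + 3/2S₃)𝔓 + O(E(𝐚₁,𝐚₂)) + o(𝔓)`", is Proposition 7.1 = the banked CLAIM `Skeleton.Prop71 c'`,
proof node `Skeleton.Ded71 c'`): "`Θ₁(𝐚₁,𝐚₂) := Σ_{ψ∈Ψ₁} (1/2πi)∫_{𝔍(1)} 𝒞(s,ψ)A(𝐚₁;s,ψ)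
A(𝐚₂;1−s,ψ̄)ω(s) ds`". [cite: Zhang2022LandauSiegel, §7 Prop. 7.1 p.33, tex L1834] -/
theorem Theta1_def (a₁ a₂ : ℕ → ℂ) :
    Skeleton.Theta1 c' χ a₁ a₂ =
      ∑ x ∈ Skeleton.finsetOf (Skeleton.PsiOne χ),
        Lemma81.segInt (Skeleton.t0 D) (Skeleton.ell1 D) 1 fun s =>
          Skeleton.frakcW c' x s * Skeleton.Apoly x a₁ s * Skeleton.ApolyBar x a₂ (1 - s) *
            Skeleton.omegaW D s := rfl

omit χ in
/-- `Z22:§7.u010` OBJECT (banked as `Skeleton.Sj`; all four sums finite by (7.2), truncated at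
`⌈PT⁻²⌉ = Skeleton.Nsupp D`): "`S_j(𝐚₁,𝐚₂) = Σ_d Σ_r |μ(r)|λ₀ⱼ(dr)/(drφ(r)) (Σ_m a₁(drm)m^{−(1−β_j)})
(Σ_n a₂(drn)ξ₀ⱼ(n;d,r)/n)`". (`Z22:§7.u009`, "`𝔓 = Σ_{p∼P} p`", is the banked theorem
`Skeleton.frakP_eq_sum_primeWindow`.) [cite: Zhang2022LandauSiegel, §7 Prop. 7.1 p.34, tex L1845] -/
theorem Sj_def (D : ℕ) (j : ℕ) (a₁ a₂ : ℕ → ℂ) :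
    Skeleton.Sj c' D j a₁ a₂ =
      ∑ d ∈ Finset.Ico 1 (Skeleton.Nsupp D), ∑ r ∈ Finset.Ico 1 (Skeleton.Nsupp D),
        ((ArithmeticFunction.moebius r).natAbs : ℂ) * Skeleton.lamZero c' D j (d * r) /
            ((d * r : ℕ) * (Nat.totient r : ℂ)) *
          (∑ m ∈ Finset.Ico 1 (Skeleton.Nsupp D),
              a₁ (d * r * m) / (m : ℂ) ^ (1 - Skeleton.betaJ c' D j)) *
          (∑ n ∈ Finset.Ico 1 (Skeleton.Nsupp D),
              a₂ (d * r * n) * Skeleton.xiZero c' D j n d r / (n : ℂ)) := rfl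

omit χ in
/-- `Z22:§7.u011` OBJECT (banked as `Skeleton.Ecal`): "`E(𝐚₁,𝐚₂) = 𝔓𝓛² Σ_{1≤j≤3} |S_j(𝐚₁,𝐚₂)|`".
[cite: Zhang2022LandauSiegel, §7 Prop. 7.1 p.34, tex L1849] -/
theorem Ecal_def (D : ℕ) (a₁ a₂ : ℕ → ℂ) :
    Skeleton.Ecal c' D a₁ a₂ =
      frakP D * Skeleton.ell D ^ 2 *
        (‖Skeleton.Sj c' D 1 a₁ a₂‖ + ‖Skeleton.Sj c' D 2 a₁ a₂‖ + ‖Skeleton.Sj c' D 3 a₁ a₂‖) := rfl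

end Prop71

/-! ## Proof of Proposition 7.1, «Initial steps» (pp. 34–35): the objects -/

section InitialObjects

variable (c' : ℝ) {D : ℕ} (x : Skeleton.Chr D)

omit x in
/-- OBJECT: "`(κ∗a₁)(m)`" (p. 34, tex L1869 "regard `a₁` as an arithmetic function"): the Dirichlet
convolution of Zhang's `κ` (`Skeleton.kappaZ c' D` = `MeanSquareMajorant.kappa b₁ b₂ b₃`) with the
sequence `a₁`, the tree's `MeanSquareMajorant.conv`. [cite: Zhang2022LandauSiegel, §7 p.34, tex L1870] -/
def kconv (D : ℕ) (a₁ : ℕ → ℂ) : ℕ → ℂ := MeanSquareMajorant.conv (Skeleton.kappaZ c' D) a₁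

/-- OBJECT: "`Σ_m (κ∗a₁)(m)ψ(m)m^{−s}`" (p. 34, tex L1870–1875), as an `LSeries` (absolutely
convergent for `σ > 1`). [cite: Zhang2022LandauSiegel, §7 p.34, tex L1874] -/
def kconvSeries (a₁ : ℕ → ℂ) (s : ℂ) : ℂ := LSeries (fun m => kconv c' D a₁ m * x.ψ m) s

open scoped Classical in
/-- OBJECT: the tail "`Σ_{m≥P²} (κ∗a₁)(m)ψ(m)m^{−s}`" of the split "according to `m < P²` and
`m ≥ P²`" (p. 34, tex L1877), as a series. [cite: Zhang2022LandauSiegel, §7 p.34, tex L1878] -/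
def kconvTail (a₁ : ℕ → ℂ) (s : ℂ) : ℂ :=
  ∑' m : ℕ, if Skeleton.bigP D ^ 2 ≤ (m : ℝ) then kconv c' D a₁ m * x.ψ m / (m : ℂ) ^ s else 0

/-- OBJECT: the head "`Σ_{m<P²} (κ∗a₁)(m)ψ(m)m^{−s}`" (p. 34, tex L1877; (7.5)), a finite sum
(`m < P²` iff `m < ⌈P²⌉`). [cite: Zhang2022LandauSiegel, §7 (7.5) p.35, tex L1900] -/
def kconvHead (a₁ : ℕ → ℂ) (s : ℂ) : ℂ :=
  ∑ m ∈ Finset.Ico 1 ⌈Skeleton.bigP D ^ 2⌉₊, kconv c' D a₁ m * x.ψ m / (m : ℂ) ^ s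

/-- OBJECT: the integrand of `Θ₁` and of (7.3), "`𝒞(s,ψ)A(𝐚₁;s,ψ)A(𝐚₂;1−s,ψ̄)ω(s)`" (p. 33–34).
[cite: Zhang2022LandauSiegel, §7 (7.3) p.34, tex L1860] -/
def mvIntegrand (a₁ a₂ : ℕ → ℂ) (s : ℂ) : ℂ :=
  Skeleton.frakcW c' x s * Skeleton.Apoly x a₁ s * Skeleton.ApolyBar x a₂ (1 - s) * Skeleton.omegaW D s

end InitialObjects

/-! ## Proof of Proposition 7.1, «Initial steps» (pp. 34–35): the claims (7.3)–(7.5) -/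

section InitialClaims

variable (c' : ℝ)

/-- `Z22:(7.3)` CLAIM (p. 34: "the sum over `Ψ₁` in the expression for `Θ₁` can be extend[ed] to the
sum over `Ψ` with an acceptable error. Namely we prove"; "Here Proposition 2.1 is crucial"): for
`𝐚₁, 𝐚₂` satisfying (7.2), "`Σ_{ψ∈Ψ₂} ∫_{𝔍(1)} 𝒞(s,ψ)A(𝐚₁;s,ψ)A(𝐚₂;1−s,ψ̄)ω(s) ds = o(𝔓)`"
(`Ψ₂ = Ψ ∖ Ψ₁`, under (A)). [cite: Zhang2022LandauSiegel, §7 (7.3) p.34, tex L1860] -/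
def Eq73 : Prop :=
  ∀ B : ℝ, ∀ ε : ℝ, 0 < ε → Skeleton.ForAllLarge fun D _ χ => Skeleton.AssumptionA D χ →
    ∀ a₁ a₂ : ℕ → ℂ, Skeleton.Adm72 D B a₁ → Skeleton.Adm72 D B a₂ →
      ‖∑ x ∈ Skeleton.finsetOf (Skeleton.PsiTwo χ), intJ D 1 (mvIntegrand c' x a₁ a₂)‖ ≤ ε * frakP D

/-- `Z22:§7.u012` CLAIM (the defining property of `κ`, p. 34: "Let `κ(n)` be given by"):
"`Σ_n κ(n)n^{−s} = ζ(s+β₁)ζ(s+β₂)ζ(s+β₃)/ζ(s)`" (`σ > 1`), for the banked object `Skeleton.kappaZ c' D`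
(= `MeanSquareMajorant.kappa b₁ b₂ b₃`, `β_j = ib_j`). PROVED in the tree up to the bookkeeping
`β_j = b_j·i`: `MeanSquareMajorant.LSeries_kappa`. [cite: Zhang2022LandauSiegel, §7 p.34, tex L1866] -/
def Step7u012 : Prop :=
  ∀ (D : ℕ) (s : ℂ), 1 < s.re →
    LSeries (fun n => Skeleton.kappaZ c' D n) s =
      riemannZeta (s + Skeleton.beta1 c' D) * riemannZeta (s + Skeleton.beta2 c' D) *
        riemannZeta (s + Skeleton.beta3 c' D) / riemannZeta s

/-- `Z22:§7.u013` CLAIM (p. 34, "regard `a₁` as an arithmetic function. For `σ > 1`"):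
"`(L(s+β₁,ψ)L(s+β₂,ψ)L(s+β₃,ψ)/L(s,ψ)) A(𝐚₁;s,ψ) = Σ_m (κ∗a₁)(m)ψ(m)m^{−s}`", for `ψ ∈ Ψ` and
`𝐚₁` satisfying (7.2). [cite: Zhang2022LandauSiegel, §7 p.34, tex L1870] -/
def Step7u013 : Prop :=
  ∀ (D : ℕ) (x : Skeleton.Chr D) (B : ℝ) (a₁ : ℕ → ℂ), Skeleton.Adm72 D B a₁ →
    ∀ s : ℂ, 1 < s.re →
      x.ψ.LFunction (s + Skeleton.beta1 c' D) * x.ψ.LFunction (s + Skeleton.beta2 c' D) *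
            x.ψ.LFunction (s + Skeleton.beta3 c' D) / x.ψ.LFunction s *
          Skeleton.Apoly x a₁ s =
        kconvSeries c' x a₁ s

/-- `Z22:§7.u014` CLAIM (p. 34, "Thus, for `ψ (mod p) ∈ Ψ` and `s ∈ 𝔍(1)`"):
"`𝒞(s,ψ)A(𝐚₁;s,ψ) = −i(pt₀)^{β₃}Z(s,ψ)⁻¹ Σ_m (κ∗a₁)(m)ψ(m)m^{−s}`".
[cite: Zhang2022LandauSiegel, §7 p.34, tex L1874] -/
def Step7u014 : Prop :=
  ∀ (D : ℕ) (x : Skeleton.Chr D) (B : ℝ) (a₁ : ℕ → ℂ), Skeleton.Adm72 D B a₁ →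
    ∀ s ∈ segJ D 1,
      Skeleton.frakcW c' x s * Skeleton.Apoly x a₁ s =
        -I * (((x.p : ℝ) * Skeleton.t0 D : ℝ) : ℂ) ^ Skeleton.beta3 c' D *
          (GammaFactor.Zfac x.ψ s)⁻¹ * kconvSeries c' x a₁ s

/-- `Z22:§7.u015` CLAIM (p. 34, "To handle the second one we appeal to the trivial bounds … for
`σ ≥ 3/2`"): "`Σ_{m≥P²} (κ∗a₁)(m)ψ(m)m^{−s} ≪ P^{2(1−σ)}𝓛ᶜ`" and "`A(𝐚₂;1−s,ψ̄) ≪ (PT⁻²)^σ`",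
for `ψ ∈ Ψ`, `𝐚₁, 𝐚₂` satisfying (7.2) (some exponent `c`; implied constants depending on the
bound in (7.2)). [cite: Zhang2022LandauSiegel, §7 p.34, tex L1878] -/
def Step7u015 : Prop :=
  ∀ B : ℝ, ∃ c C : ℝ, Skeleton.ForAllLarge fun D _ _ =>
    ∀ (x : Skeleton.Chr D) (a₁ a₂ : ℕ → ℂ), Skeleton.Adm72 D B a₁ → Skeleton.Adm72 D B a₂ →
      ∀ s : ℂ, 3 / 2 ≤ s.re →
        ‖kconvTail c' x a₁ s‖ ≤ C * Skeleton.bigP D ^ (2 * (1 - s.re)) * Skeleton.ell D ^ c ∧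
        ‖Skeleton.ApolyBar x a₂ (1 - s)‖ ≤ C * (Skeleton.bigP D / Skeleton.bigT D ^ 2) ^ s.re

omit c' in
/-- `Z22:§7.u016` CLAIM (p. 34): "`Z(s,ψ)⁻¹ ≪ (pt₀)^{σ−1/2}` for `3/2 ≤ σ ≤ 𝓛⁹`, `|t − 2πt₀| ≤ 𝓛₁`",
for `ψ (mod p) ∈ Ψ`. [cite: Zhang2022LandauSiegel, §7 p.34, tex L1882] -/
def Step7u016 : Prop :=
  ∃ C : ℝ, Skeleton.ForAllLarge fun D _ _ => ∀ (x : Skeleton.Chr D) (s : ℂ),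
    3 / 2 ≤ s.re → s.re ≤ Skeleton.ell D ^ 9 → |s.im - 2 * π * Skeleton.t0 D| ≤ Skeleton.ell1 D →
      ‖(GammaFactor.Zfac x.ψ s)⁻¹‖ ≤ C * ((x.p : ℝ) * Skeleton.t0 D) ^ (s.re - 1 / 2)

omit c' in
/-- `Z22:(7.4)` CLAIM (p. 34, "the simple estimate"): "`∫_{𝔍(z)} |ω(s) ds| ≪ 1`, `|z| ≤ 𝓛⁹`"
(`ω` of (2.15) = `Skeleton.omegaW`; `z` real). [cite: Zhang2022LandauSiegel, §7 (7.4) p.34, tex L1886] -/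
def Eq74 : Prop :=
  ∃ C : ℝ, Skeleton.ForAllLarge fun D _ _ => ∀ z : ℝ, |z| ≤ Skeleton.ell D ^ 9 →
    absIntJ D z (Skeleton.omegaW D) ≤ C

/-- `Z22:§7.u017` CLAIM (p. 35, "Thus, moving the segment to `𝔍(𝓛⁹)` and applying … (7.4) we obtain"):
"`∫_{𝔍(1)} Z(s,ψ)⁻¹ (Σ_{m≥P²} (κ∗a₁)(m)ψ(m)m^{−s}) A(𝐚₂;1−s,ψ̄)ω(s) ds ≪ ε`", `ε = exp{−c𝓛¹⁰}`
(tex L1062), for `ψ ∈ Ψ`, `𝐚₁, 𝐚₂` satisfying (7.2). [cite: Zhang2022LandauSiegel, §7 p.35, tex L1890] -/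
def Step7u017 : Prop :=
  ∀ B : ℝ, ∃ c : ℝ, 0 < c ∧ ∃ C : ℝ, Skeleton.ForAllLarge fun D _ _ =>
    ∀ (x : Skeleton.Chr D) (a₁ a₂ : ℕ → ℂ), Skeleton.Adm72 D B a₁ → Skeleton.Adm72 D B a₂ →
      ‖intJ D 1 fun s => (GammaFactor.Zfac x.ψ s)⁻¹ * kconvTail c' x a₁ s *
          Skeleton.ApolyBar x a₂ (1 - s) * Skeleton.omegaW D s‖ ≤
        C * Real.exp (-c * Skeleton.ell D ^ 10)

/-- `Z22:§7.u018` CLAIM (p. 35, "To handle the sum over `m < P²` we move the path of integration to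
`𝔍(0)`. Hence"): "`|∫_{𝔍(1)} 𝒞̃(s,ψ)A(𝐚₁;s,ψ)A(𝐚₂;1−s,ψ̄)(s,ψ)ω(s) ds| ≤ ∫_{𝔍(0)} |Σ_{m<P²}
(κ∗a₁)(m)ψ(m)m^{−s}| |A(𝐚₂;1−s,ψ̄)ω(s) ds| + O(ε)`", typed in the READING: left integrand =
`𝒞(s,ψ)A(𝐚₁;s,ψ)A(𝐚₂;1−s,ψ̄)ω(s)` (the integrand of `Θ₁`/(7.3)). AMBIGUITY: (i) the source prints
`\tilde{𝒞}(s,ψ)`, a symbol defined only in §8 (tex L2195, `𝒞̃ = −iM(s+β₁,ψ)M(s+β₂,ψ)M(s+β₃,ψ)/M(s,ψ)`)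
— read here as the `𝒞(s,ψ)` of (7.1), the only reading under which "By (7.4), the proof of (7.3) is
reduced to showing (7.5)" (tex L1899) follows; (ii) the stray "`(s,ψ)`" after `A(𝐚₂;1−s,ψ̄)` (the
macro `\sp`) is read as a typo and dropped. Alternative reading (left integrand = the `m < P²` piece
`Z(s,ψ)⁻¹(Σ_{m<P²}…)A(𝐚₂;1−s,ψ̄)ω(s)` only): `Step7u018b`.
[cite: Zhang2022LandauSiegel, §7 p.35, tex L1894] -/
def Step7u018 : Prop :=
  ∀ B : ℝ, ∃ c : ℝ, 0 < c ∧ ∃ C : ℝ, Skeleton.ForAllLarge fun D _ _ =>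
    ∀ (x : Skeleton.Chr D) (a₁ a₂ : ℕ → ℂ), Skeleton.Adm72 D B a₁ → Skeleton.Adm72 D B a₂ →
      ‖intJ D 1 (mvIntegrand c' x a₁ a₂)‖ ≤
        absIntJ D 0 (fun s => kconvHead c' x a₁ s * (Skeleton.ApolyBar x a₂ (1 - s) *
          Skeleton.omegaW D s)) + C * Real.exp (-c * Skeleton.ell D ^ 10)

/-- `Z22:§7.u018` CLAIM, ALTERNATIVE READING (see `Step7u018`): "`|∫_{𝔍(1)} Z(s,ψ)⁻¹(Σ_{m<P²}
(κ∗a₁)(m)ψ(m)m^{−s})A(𝐚₂;1−s,ψ̄)ω(s) ds| ≤ ∫_{𝔍(0)} |Σ_{m<P²} (κ∗a₁)(m)ψ(m)m^{−s}|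
|A(𝐚₂;1−s,ψ̄)ω(s) ds| + O(ε)`" (the contour move for the `m < P²` piece alone; `|Z(s,ψ)| = 1` on
`σ = 1/2`). [cite: Zhang2022LandauSiegel, §7 p.35, tex L1894] -/
def Step7u018b : Prop :=
  ∀ B : ℝ, ∃ c : ℝ, 0 < c ∧ ∃ C : ℝ, Skeleton.ForAllLarge fun D _ _ =>
    ∀ (x : Skeleton.Chr D) (a₁ a₂ : ℕ → ℂ), Skeleton.Adm72 D B a₁ → Skeleton.Adm72 D B a₂ →
      ‖intJ D 1 fun s => (GammaFactor.Zfac x.ψ s)⁻¹ * kconvHead c' x a₁ s *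
          Skeleton.ApolyBar x a₂ (1 - s) * Skeleton.omegaW D s‖ ≤
        absIntJ D 0 (fun s => kconvHead c' x a₁ s * (Skeleton.ApolyBar x a₂ (1 - s) *
          Skeleton.omegaW D s)) + C * Real.exp (-c * Skeleton.ell D ^ 10)

/-- `Z22:(7.5)` CLAIM (p. 35, "By (7.4), the proof of (7.3) is reduced to showing that"):
"`Σ_{ψ∈Ψ₂} |Σ_{m<P²} (κ∗a₁)(m)ψ(m)m^{−s}| |A(𝐚₂;1−s,ψ̄)| = o(𝔓)`, `σ = 1/2`", for `𝐚₁, 𝐚₂`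
satisfying (7.2), under (A) (uniformly in `t`, as printed: only `σ = 1/2` is imposed).
[cite: Zhang2022LandauSiegel, §7 (7.5) p.35, tex L1900] -/
def Eq75 : Prop :=
  ∀ B : ℝ, ∀ ε : ℝ, 0 < ε → Skeleton.ForAllLarge fun D _ χ => Skeleton.AssumptionA D χ →
    ∀ a₁ a₂ : ℕ → ℂ, Skeleton.Adm72 D B a₁ → Skeleton.Adm72 D B a₂ →
      ∀ s : ℂ, s.re = 1 / 2 →
        ∑ x ∈ Skeleton.finsetOf (Skeleton.PsiTwo χ),
            ‖kconvHead c' x a₁ s‖ * ‖Skeleton.ApolyBar x a₂ (1 - s)‖ ≤ ε * frakP D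

/-- CLAIM (prose, p. 35 tex L1903): "Note that `(κ∗a₁)(m) = O(τ₅(m))`" for `𝐚₁` satisfying (7.2)
(`τ₅` = `MeanSquareMajorant.tau 5`, the number of ordered factorisations into five factors).
[cite: Zhang2022LandauSiegel, §7 p.35, tex L1903] -/
def Step7u019kappa : Prop :=
  ∀ B : ℝ, ∃ C : ℝ, ∀ (D : ℕ) (a₁ : ℕ → ℂ), Skeleton.Adm72 D B a₁ →
    ∀ m : ℕ, 1 ≤ m → ‖kconv c' D a₁ m‖ ≤ C * MeanSquareMajorant.tau 5 m

/-- `Z22:§7.u019` CLAIM, first line (p. 35, "The left side above is, by Cauchy's inequality,"):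
"`Σ_{ψ∈Ψ₂} |Σ_{m<P²}…| |A(𝐚₂;1−s,ψ̄)| ≤ (Σ_{ψ∈Ψ} |Σ_{m<P²} (κ∗a₁)(m)ψ(m)m^{−s}|²)^{1/2}
(Σ_{ψ∈Ψ} |A(𝐚₂;1−s,ψ̄)|⁴)^{1/4} (Σ_{ψ∈Ψ₂} 1)^{1/4}`" (`σ = 1/2`, the left side of (7.5)).
[cite: Zhang2022LandauSiegel, §7 p.35, tex L1904] -/
def Step7u019a : Prop :=
  ∀ (D : ℕ) [NeZero D] (χ : DirichletCharacter ℂ D) (a₁ a₂ : ℕ → ℂ) (s : ℂ), s.re = 1 / 2 →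
    ∑ x ∈ Skeleton.finsetOf (Skeleton.PsiTwo χ),
        ‖kconvHead c' x a₁ s‖ * ‖Skeleton.ApolyBar x a₂ (1 - s)‖ ≤
      (∑ x ∈ PsiAll D, ‖kconvHead c' x a₁ s‖ ^ 2) ^ (1 / 2 : ℝ) *
        (∑ x ∈ PsiAll D, ‖Skeleton.ApolyBar x a₂ (1 - s)‖ ^ 4) ^ (1 / 4 : ℝ) *
        ((Skeleton.PsiTwo χ).ncard : ℝ) ^ (1 / 4 : ℝ)

/-- `Z22:§7.u019` CLAIM, second line (p. 35, the large-sieve-type bound "`≪`" of the Cauchy chain):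
"`(Σ_{ψ∈Ψ} |Σ_{m<P²}…|²)^{1/2} (Σ_{ψ∈Ψ} |A(𝐚₂;1−s,ψ̄)|⁴)^{1/4} (Σ_{ψ∈Ψ₂} 1)^{1/4}
≪ (P² Σ_{m<P²} τ₅(m)²/m)^{1/2} (P² Σ_{m<P²} τ₂(m)²/m)^{1/4} (Σ_{ψ∈Ψ₂} 1)^{1/4}`" (`σ = 1/2`; for
`𝐚₁, 𝐚₂` satisfying (7.2); `τ_k` = `MeanSquareMajorant.tau k`). The mean-square majorant with the
smaller exponent `9` of `log P²` for the first factor is PROVED in the tree: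
`MeanSquareMajorant.sum_norm_kappa_conv_sq_div_le`, `…_of_mul_log_le` (not used here).
[cite: Zhang2022LandauSiegel, §7 p.35, tex L1904] -/
def Step7u019b : Prop :=
  ∀ B : ℝ, ∃ C : ℝ, Skeleton.ForAllLarge fun D _ χ =>
    ∀ a₁ a₂ : ℕ → ℂ, Skeleton.Adm72 D B a₁ → Skeleton.Adm72 D B a₂ → ∀ s : ℂ, s.re = 1 / 2 →
      (∑ x ∈ PsiAll D, ‖kconvHead c' x a₁ s‖ ^ 2) ^ (1 / 2 : ℝ) *
          (∑ x ∈ PsiAll D, ‖Skeleton.ApolyBar x a₂ (1 - s)‖ ^ 4) ^ (1 / 4 : ℝ) *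
          ((Skeleton.PsiTwo χ).ncard : ℝ) ^ (1 / 4 : ℝ) ≤
        C * (Skeleton.bigP D ^ 2 * ∑ m ∈ Finset.Ico 1 ⌈Skeleton.bigP D ^ 2⌉₊,
              MeanSquareMajorant.tau 5 m ^ 2 / (m : ℝ)) ^ (1 / 2 : ℝ) *
          (Skeleton.bigP D ^ 2 * ∑ m ∈ Finset.Ico 1 ⌈Skeleton.bigP D ^ 2⌉₊,
              MeanSquareMajorant.tau 2 m ^ 2 / (m : ℝ)) ^ (1 / 4 : ℝ) *
          ((Skeleton.PsiTwo χ).ncard : ℝ) ^ (1 / 4 : ℝ)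

/-- DEDUCTION (p. 35, tex L1910: "This yields (7.5) by Proposition 2.1 and (2.9)"): the manuscript's
proof of (7.5) from the Cauchy chain `Z22:§7.u019`, Proposition 2.1 (banked `Skeleton.Prop21`:
`#Ψ₂ ≪ 𝔓𝓛⁻⁷³⁹` under (A)) and (2.9) (`𝔓 = (1+o(1))P²𝓛⁻⁷⁷`, a THEOREM of the tree:
`frakP_bounds`, hence not an antecedent), as ONE implication. Refines the clause "(7.4)–(7.5): Cauchy
and the large sieve" of `Skeleton.Ded71 c'`. CLAIM. [cite: Zhang2022LandauSiegel, §7 (7.5) p.35, tex L1903–L1910] -/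
def DedEq75 : Prop :=
  Step7u019kappa c' → Step7u019a c' → Step7u019b c' → Skeleton.Prop21 → Eq75 c'

/-- `Z22:Prop7.1.pf.a-initial` DEDUCTION — the part of «Proof of Proposition 7.1: Initial steps» in
this slice (pp. 34–35, tex L1856–L1910): the manuscript's proof of (7.3) from the `𝒞A`-expansion
(`Z22:§7.u013`, `u014`), the split `m < P²`/`m ≥ P²` with the trivial bounds (`u015`, `u016`), the
estimate (7.4), the tail bound (`u017`), the move to `𝔍(0)` (`u018`) and (7.5), as ONE implication.
Refines the first clause of the banked proof node `Skeleton.Ded71 c'` ("(7.3): By Proposition 2.1 …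
the sum over `ψ ∈ Ψ₁` can be extended to `Ψ`"); the remainder of part (a) — (7.6)–(7.11), the
reduction of Prop. 7.1 to (7.10) ∧ (7.11) — is slice L2-t3 (`Section7bStatements`). CLAIM.
[cite: Zhang2022LandauSiegel, §7 pp.34–35, tex L1856–L1910] -/
def DedEq73 : Prop :=
  Step7u013 c' → Step7u014 c' → Step7u015 c' → Step7u016 → Eq74 → Step7u017 c' → Step7u018 c' →
    Eq75 c' → Eq73 c'

end InitialClaims

/-! ## Discharges of two inner steps (kernel-checked; 0 new facts): `Z22:§7.u012`, `Z22:§7.u013` -/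

section Discharges

variable (c' : ℝ)

/-- Bookkeeping: `β₁ = b₁·i` (`Skeleton.beta1` vs the real size `Skeleton.b1`). [cite: Zhang2022LandauSiegel, §2 (2.13) p.7, tex L469] -/
private theorem beta1_eq (D : ℕ) : Skeleton.beta1 c' D = (Skeleton.b1 c' D : ℂ) * I := by
  simp only [Skeleton.beta1, Skeleton.b1]; push_cast; ring

/-- Bookkeeping: `β₂ = b₂·i`. [cite: Zhang2022LandauSiegel, §2 (2.13) p.7, tex L469] -/
private theorem beta2_eq (D : ℕ) : Skeleton.beta2 c' D = (Skeleton.b2 c' D : ℂ) * I := by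
  simp only [Skeleton.beta2, Skeleton.b2]; push_cast; ring

/-- Bookkeeping: `β₃ = b₃·i`. [cite: Zhang2022LandauSiegel, §2 (2.13) p.7, tex L469] -/
private theorem beta3_eq (D : ℕ) : Skeleton.beta3 c' D = (Skeleton.b3 c' D : ℂ) * I := by
  simp only [Skeleton.beta3, Skeleton.b3]; push_cast; ring

/-- `Z22:§7.u012` HOLDS: the defining identity "`Σ_n κ(n)n^{−s} = ζ(s+β₁)ζ(s+β₂)ζ(s+β₃)/ζ(s)`"
(`σ > 1`) for the banked `Skeleton.kappaZ`, by the tree's `MeanSquareMajorant.LSeries_kappa`.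
[cite: Zhang2022LandauSiegel, §7 p.34, tex L1866] -/
theorem step7u012_holds : Step7u012 c' := by
  intro D s hs
  rw [beta1_eq, beta2_eq, beta3_eq]
  exact MeanSquareMajorant.LSeries_kappa (Skeleton.b1 c' D) (Skeleton.b2 c' D) (Skeleton.b3 c' D) hs

/-- `Step7u012` — `_holds` alias of `step7u012_holds` above under the fact's exact name (appended
2026-08-28, D-0026 bookkeeping: the proof term is the existing theorem of this file; no statement,
definition or attribute is edited; no new named fact; the ledger's debt table listed the fact
unproved). [cite: Zhang2022LandauSiegel, §7 p.34, tex L1866] -/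
theorem _root_.Literature.NumberTheory.LFunctions.Zhang2022.Section7aStatements.Step7u012_holds :
    Step7u012 c' :=
  _root_.Literature.NumberTheory.LFunctions.Zhang2022.Section7aStatements.step7u012_holds (c' := c')

/-- Under (7.2), `A(𝐚;s,ψ)` (the finite sum `Skeleton.Apoly`) is the `L`-series `Σ_n a(n)ψ(n)n^{−s}`.
[cite: Zhang2022LandauSiegel, §7 p.33, tex L1821] -/
theorem Apoly_eq_LSeries {D : ℕ} (x : Skeleton.Chr D) {B : ℝ} {a : ℕ → ℂ}
    (ha : Skeleton.Adm72 D B a) (s : ℂ) :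
    Skeleton.Apoly x a s = LSeries ((fun n : ℕ => x.ψ (n : ZMod x.p)) * a) s := by
  rw [Apoly_eq, LSeries]
  symm
  rw [tsum_eq_sum (s := Finset.range (Skeleton.Nsupp D))]
  · refine Finset.sum_congr rfl fun n _ => ?_
    rcases Nat.eq_zero_or_pos n with rfl | hn
    · simp [MulChar.map_zero]
    · rw [LSeries.term_of_ne_zero hn.ne', Pi.mul_apply, div_eq_mul_inv, ← cpow_neg]
      ring
  · intro n hn
    rw [Finset.mem_range, not_lt] at hn
    have hz : a n = 0 := ha.2 n (le_trans (Nat.le_ceil _) (by exact_mod_cast hn))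
    rcases Nat.eq_zero_or_pos n with rfl | hn'
    · simp
    · rw [LSeries.term_of_ne_zero hn'.ne', Pi.mul_apply, hz, mul_zero, zero_div]

/-- `Z22:§7.u013` HOLDS: for `σ > 1`, `ψ ∈ Ψ` and `𝐚₁` satisfying (7.2),
"`(L(s+β₁,ψ)L(s+β₂,ψ)L(s+β₃,ψ)/L(s,ψ)) A(𝐚₁;s,ψ) = Σ_m (κ∗a₁)(m)ψ(m)m^{−s}`", by the tree's
`MeanSquareMajorant.LSeries_twist_conv_kappa` and Mathlib's `DirichletCharacter.LFunction_eq_LSeries`.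
[cite: Zhang2022LandauSiegel, §7 p.34, tex L1870] -/
theorem step7u013_holds : Step7u013 c' := by
  intro D x B a₁ ha s hs
  have hre : ∀ b : ℝ, 1 < (s + (b : ℂ) * I).re := fun b => by simpa using hs
  have hψa : LSeriesSummable ((fun n : ℕ => x.ψ (n : ZMod x.p)) * a₁) s := by
    refine LSeriesSummable_of_bounded_of_one_lt_re (m := B) (fun n _ => ?_) hs
    rw [Pi.mul_apply, norm_mul]
    calc ‖x.ψ (n : ZMod x.p)‖ * ‖a₁ n‖ ≤ 1 * B :=
          mul_le_mul (x.ψ.norm_le_one _) (ha.1 n) (norm_nonneg _) zero_le_one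
      _ = B := one_mul B
  have key := MeanSquareMajorant.LSeries_twist_conv_kappa (Skeleton.b1 c' D) (Skeleton.b2 c' D)
    (Skeleton.b3 c' D) x.ψ hs hψa
  have hk : kconvSeries c' x a₁ s =
      LSeries ((fun n : ℕ => x.ψ (n : ZMod x.p)) *
        MeanSquareMajorant.conv (MeanSquareMajorant.kappa (Skeleton.b1 c' D) (Skeleton.b2 c' D)
          (Skeleton.b3 c' D)) a₁) s := by
    rw [kconvSeries]
    congr 1
    funext m
    rw [Pi.mul_apply, mul_comm]
    rfl
  rw [beta1_eq, beta2_eq, beta3_eq, DirichletCharacter.LFunction_eq_LSeries _ (hre _),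
    DirichletCharacter.LFunction_eq_LSeries _ (hre _), DirichletCharacter.LFunction_eq_LSeries _ (hre _),
    DirichletCharacter.LFunction_eq_LSeries _ hs, Apoly_eq_LSeries x ha, hk, key]

/-- `Step7u013` — `_holds` alias of `step7u013_holds` above under the fact's exact name (appended
2026-08-28, D-0026 bookkeeping: the proof term is the existing theorem of this file; no statement,
definition or attribute is edited; no new named fact; the ledger's debt table listed the fact
unproved). [cite: Zhang2022LandauSiegel, §7 p.34, tex L1870] -/
theorem _root_.Literature.NumberTheory.LFunctions.Zhang2022.Section7aStatements.Step7u013_holds :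
    Step7u013 c' :=
  _root_.Literature.NumberTheory.LFunctions.Zhang2022.Section7aStatements.step7u013_holds (c' := c')

/-- `Z22:§7.u014` HOLDS: on `𝔍(1)` (`σ = 3/2 > 1`), "`𝒞(s,ψ)A(𝐚₁;s,ψ) = −i(pt₀)^{β₃}Z(s,ψ)⁻¹
Σ_m (κ∗a₁)(m)ψ(m)m^{−s}`" — from the definition (7.1) of `𝒞` and `Z22:§7.u013` (kernel-checked;
0 new facts). [cite: Zhang2022LandauSiegel, §7 p.34, tex L1874] -/
theorem step7u014_holds : Step7u014 c' := by
  intro D x B a₁ ha s hs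
  simp only [segJ, Set.mem_setOf_eq] at hs
  have hσ : 1 < s.re := by rw [hs.1]; norm_num
  rw [frakcW_def, ← step7u013_holds c' D x B a₁ ha s hσ]
  ring

/-- `Step7u014` — `_holds` alias of `step7u014_holds` above under the fact's exact name (appended
2026-08-28, D-0026 bookkeeping: the proof term is the existing theorem of this file; no statement,
definition or attribute is edited; no new named fact; the ledger's debt table listed the fact
unproved). [cite: Zhang2022LandauSiegel, §7 p.34, tex L1874] -/
theorem _root_.Literature.NumberTheory.LFunctions.Zhang2022.Section7aStatements.Step7u014_holds :
    Step7u014 c' :=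
  _root_.Literature.NumberTheory.LFunctions.Zhang2022.Section7aStatements.step7u014_holds (c' := c')

/-- `log D ≥ 1` once `D ≥ 3`. [folklore] -/
private theorem one_le_ell {D : ℕ} (hD : 3 ≤ D) : 1 ≤ Skeleton.ell D := by
  rw [Skeleton.ell, Real.le_log_iff_exp_le (by exact_mod_cast (by omega : 0 < D))]
  have h3 : (3 : ℝ) ≤ D := by exact_mod_cast hD
  have he := Real.exp_one_lt_d9
  linarith

/-- `Z22:(7.4)` HOLDS: "`∫_{𝔍(z)} |ω(s) ds| ≪ 1`, `|z| ≤ 𝓛⁹`" with the absolute constant `2πe^{1/4}`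
for `D ≥ 3`, by the tree's `SmoothWeight.integral_norm_omega_segment_le_of_abs_le` (the range
`|z| ≤ 𝓛⁹` lies inside `|z| ≤ 𝓛₂ = 𝓛⁴⁰⁰` once `𝓛 ≥ 1`). Kernel-checked; 0 new facts.
[cite: Zhang2022LandauSiegel, §7 (7.4) p.34, tex L1886] -/
theorem eq74_holds : Eq74 := by
  refine ⟨2 * π * Real.exp (1 / 4), 3, fun D _ χ hD _ _ z hz => ?_⟩
  have hℓ : 1 ≤ Skeleton.ell D := one_le_ell hD
  have hz' : |z| ≤ Skeleton.ell2 D :=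
    hz.trans (by rw [Skeleton.ell2]; exact pow_le_pow_right₀ hℓ (by norm_num))
  have hL2 : 0 < Skeleton.ell2 D := by rw [Skeleton.ell2]; positivity
  have hL1 : 0 ≤ Skeleton.ell1 D := by rw [Skeleton.ell1]; positivity
  unfold absIntJ Skeleton.omegaW Skeleton.s0
  exact SmoothWeight.integral_norm_omega_segment_le_of_abs_le hL2 (Skeleton.t0 D) hz' hL1

/-- The second "trivial bound" of `Z22:§7.u015`, PROVED: for `σ ≥ 1` and `𝐚` satisfying (7.2) with
bound `B`, `|A(𝐚;1−s,ψ̄)| ≤ B·(PT⁻²)^σ` (each of the fewer than `PT⁻²` terms has modulus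
`≤ B n^{σ−1} ≤ B (PT⁻²)^{σ−1}`). Auxiliary toward `Step7u015` (whose first bound is not proved here).
[cite: Zhang2022LandauSiegel, §7 p.34, tex L1878] -/
theorem norm_ApolyBar_le {D : ℕ} (x : Skeleton.Chr D) {B : ℝ} {a : ℕ → ℂ}
    (ha : Skeleton.Adm72 D B a) {s : ℂ} (hs : 1 ≤ s.re) :
    ‖Skeleton.ApolyBar x a (1 - s)‖ ≤ B * (Skeleton.bigP D / Skeleton.bigT D ^ 2) ^ s.re := by
  set xr : ℝ := Skeleton.bigP D / Skeleton.bigT D ^ 2 with hxr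
  have hxr0 : 0 < xr := by
    rw [hxr, Skeleton.bigP, Skeleton.bigT]; positivity
  have hB : 0 ≤ B := le_trans (norm_nonneg _) (ha.1 0)
  have hK : 0 ≤ B * xr ^ (s.re - 1) := mul_nonneg hB (Real.rpow_nonneg hxr0.le _)
  -- termwise bound
  have hterm : ∀ n ∈ Finset.Ico 1 (Skeleton.Nsupp D),
      ‖a n * x.ψ⁻¹ n * (n : ℂ) ^ (-(1 - s))‖ ≤ B * xr ^ (s.re - 1) := by
    intro n hn
    rw [Finset.mem_Ico] at hn
    have hn0 : 0 < n := hn.1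
    have hnx : (n : ℝ) < xr := by
      have := hn.2; rw [Skeleton.Nsupp] at this; exact Nat.lt_ceil.mp this
    rw [norm_mul, norm_mul, Complex.norm_natCast_cpow_of_pos hn0,
      show (-(1 - s)).re = s.re - 1 by simp]
    calc ‖a n‖ * ‖x.ψ⁻¹ (n : ZMod x.p)‖ * (n : ℝ) ^ (s.re - 1)
        ≤ B * 1 * xr ^ (s.re - 1) := by
          gcongr
          · exact ha.1 n
          · exact (x.ψ⁻¹).norm_le_one _
      _ = B * xr ^ (s.re - 1) := by rw [mul_one]
  -- the `n = 0` term vanishes (`ψ̄(0) = 0`)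
  have h0 : a 0 * x.ψ⁻¹ ((0 : ℕ) : ZMod x.p) * ((0 : ℕ) : ℂ) ^ (-(1 - s)) = 0 := by
    simp [MulChar.map_zero]
  rw [ApolyBar_eq, Finset.range_eq_Ico]
  rcases Nat.eq_zero_or_pos (Skeleton.Nsupp D) with hN | hN
  · rw [hN]; simp; positivity
  rw [Finset.sum_eq_sum_Ico_succ_bot hN, h0, zero_add]
  calc ‖∑ n ∈ Finset.Ico (0 + 1) (Skeleton.Nsupp D), a n * x.ψ⁻¹ n * (n : ℂ) ^ (-(1 - s))‖
      ≤ ∑ n ∈ Finset.Ico (0 + 1) (Skeleton.Nsupp D), ‖a n * x.ψ⁻¹ n * (n : ℂ) ^ (-(1 - s))‖ :=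
        norm_sum_le _ _
    _ ≤ ∑ n ∈ Finset.Ico (0 + 1) (Skeleton.Nsupp D), B * xr ^ (s.re - 1) :=
        Finset.sum_le_sum fun n hn => hterm n (by simpa using hn)
    _ = ((Skeleton.Nsupp D : ℝ) - 1) * (B * xr ^ (s.re - 1)) := by
        rw [Finset.sum_const, Nat.card_Ico, nsmul_eq_mul, Nat.cast_sub hN]; simp
    _ ≤ xr * (B * xr ^ (s.re - 1)) := by
        gcongr
        have := Nat.ceil_lt_add_one hxr0.le
        rw [Skeleton.Nsupp]; linarith
    _ = B * xr ^ s.re := by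
        rw [show xr * (B * xr ^ (s.re - 1)) = B * (xr ^ (s.re - 1) * xr) by ring,
          ← Real.rpow_add_one hxr0.ne', sub_add_cancel]

end Discharges

/-! ## Toward `Z22:§7.u015` (the trivial bounds): divisor-function majorants of `κ` -/

section TrivialBounds

open ArithmeticFunction

/-- Pointwise: `|(f ∗ g)(n)| ≤ (F ∗ G)(n)` when `|f| ≤ F`, `|g| ≤ G`. [folklore] -/
private theorem norm_mul_apply_le {f g : ArithmeticFunction ℂ} {F G : ArithmeticFunction ℝ}
    (hf : ∀ n, ‖f n‖ ≤ F n) (hg : ∀ n, ‖g n‖ ≤ G n) (n : ℕ) : ‖(f * g) n‖ ≤ (F * G) n := by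
  rw [mul_apply, mul_apply]
  refine (norm_sum_le _ _).trans (Finset.sum_le_sum fun x _ => ?_)
  rw [norm_mul]
  exact mul_le_mul (hf _) (hg _) (norm_nonneg _) ((norm_nonneg _).trans (hf _))

/-- `|n^{−ib}| ≤ 𝟙(n)` (`= 1` for `n ≥ 1`, `0` at `0`). [folklore] -/
private theorem norm_powI_le_zeta (b : ℝ) (n : ℕ) :
    ‖MeanSquareMajorant.powI b n‖ ≤ (ArithmeticFunction.zeta : ArithmeticFunction ℝ) n := by
  rw [natCoe_apply, zeta_apply]
  rcases Nat.eq_zero_or_pos n with rfl | hn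
  · simp
  · rw [MeanSquareMajorant.norm_powI_of_pos b hn, if_neg hn.ne']; simp

/-- `|μ(n)| ≤ 𝟙(n)`. [folklore] -/
private theorem norm_moebius_le_zeta (n : ℕ) :
    ‖(ArithmeticFunction.moebius : ArithmeticFunction ℂ) n‖ ≤
      (ArithmeticFunction.zeta : ArithmeticFunction ℝ) n := by
  rw [natCoe_apply, zeta_apply, intCoe_apply]
  rcases Nat.eq_zero_or_pos n with rfl | hn
  · simp
  · rw [if_neg hn.ne', Complex.norm_intCast, Nat.cast_one]
    exact_mod_cast ArithmeticFunction.abs_moebius_le_one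

/-- **`|κ(n)| ≤ τ₄(n)`** (`κ = n^{−ib₁} ∗ n^{−ib₂} ∗ n^{−ib₃} ∗ μ`, each factor of modulus `≤ 𝟙`).
[folklore] -/
private theorem norm_kappa_le_tau_four (b₁ b₂ b₃ : ℝ) (n : ℕ) :
    ‖MeanSquareMajorant.kappa b₁ b₂ b₃ n‖ ≤ MeanSquareMajorant.tau 4 n := by
  have h12 : ∀ n, ‖(MeanSquareMajorant.powI b₁ * MeanSquareMajorant.powI b₂) n‖ ≤
      ((ArithmeticFunction.zeta : ArithmeticFunction ℝ) * ArithmeticFunction.zeta) n :=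
    fun n => norm_mul_apply_le (norm_powI_le_zeta b₁) (norm_powI_le_zeta b₂) n
  have h123 : ∀ n, ‖(MeanSquareMajorant.powI b₁ * MeanSquareMajorant.powI b₂ *
      MeanSquareMajorant.powI b₃) n‖ ≤
      ((ArithmeticFunction.zeta : ArithmeticFunction ℝ) * ArithmeticFunction.zeta *
        ArithmeticFunction.zeta) n :=
    fun n => norm_mul_apply_le h12 (norm_powI_le_zeta b₃) n
  have h := norm_mul_apply_le h123 norm_moebius_le_zeta n
  have htau : MeanSquareMajorant.tau 4 =
      (ArithmeticFunction.zeta : ArithmeticFunction ℝ) * ArithmeticFunction.zeta *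
        ArithmeticFunction.zeta * ArithmeticFunction.zeta := by
    rw [MeanSquareMajorant.tau, show (4 : ℕ) = 1 + 1 + 1 + 1 from rfl, pow_succ, pow_succ, pow_succ,
      pow_one]
  rw [htau, MeanSquareMajorant.kappa]
  exact h

/-- **`Σ_{d∣m} |κ(d)| ≤ τ₅(m)`** (the multiplicative majorant `absDivSum κ = |κ| ∗ 𝟙` of the tree).
[folklore] -/
private theorem absDivSum_kappa_le_tau_five (b₁ b₂ b₃ : ℝ) (m : ℕ) :
    MeanSquareMajorant.absDivSum (MeanSquareMajorant.kappa b₁ b₂ b₃) m ≤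
      MeanSquareMajorant.tau 5 m := by
  calc MeanSquareMajorant.absDivSum (MeanSquareMajorant.kappa b₁ b₂ b₃) m
      = ∑ d ∈ m.divisors, ‖MeanSquareMajorant.kappa b₁ b₂ b₃ d‖ :=
        MeanSquareMajorant.absDivSum_apply _ m
    _ ≤ ∑ d ∈ m.divisors, MeanSquareMajorant.tau 4 d :=
        Finset.sum_le_sum fun d _ => norm_kappa_le_tau_four b₁ b₂ b₃ d
    _ = MeanSquareMajorant.tau (4 + 1) m := (MeanSquareMajorant.tau_succ_apply 4 m).symm
    _ = MeanSquareMajorant.tau 5 m := rfl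

/-- **`|(κ∗a)(m)| ≤ B·τ₅(m)`** for `|a| ≤ B` (the tree's `norm_conv_le` and the majorant above).
[cite: Zhang2022LandauSiegel, §7 p.35, tex L1903] -/
theorem norm_kconv_le_tau_five (c' : ℝ) {D : ℕ} {B : ℝ} {a : ℕ → ℂ}
    (ha : ∀ n, ‖a n‖ ≤ B) (m : ℕ) :
    ‖kconv c' D a m‖ ≤ B * MeanSquareMajorant.tau 5 m := by
  have hB : 0 ≤ B := (norm_nonneg _).trans (ha 0)
  refine (MeanSquareMajorant.norm_conv_le ha m).trans ?_
  exact mul_le_mul_of_nonneg_left (absDivSum_kappa_le_tau_five _ _ _ m) hB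

/-- `Σ_{n<N} n^{−a} ≤ 1 + 1/(a−1)` for `a > 1` (integral comparison). [folklore] -/
private theorem sum_range_rpow_neg_le {a : ℝ} (ha : 1 < a) (N : ℕ) :
    ∑ n ∈ Finset.range N, (n : ℝ) ^ (-a) ≤ 1 + 1 / (a - 1) := by
  have ha0 : 0 < a := by linarith
  have ha' : 0 < a - 1 := by linarith
  have hRHS : (1 : ℝ) ≤ 1 + 1 / (a - 1) := le_add_of_nonneg_right (by positivity)
  -- split off `n = 0, 1`
  rcases Nat.lt_or_ge N 2 with hN | hN
  · interval_cases N
    · simp; positivity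
    · simp [Real.zero_rpow (neg_ne_zero.mpr ha0.ne')]; positivity
  have hsplit : ∑ n ∈ Finset.range N, (n : ℝ) ^ (-a) =
      1 + ∑ i ∈ Finset.Ico 1 (N - 1), (((i + 1 : ℕ) : ℝ)) ^ (-a) := by
    rw [Finset.range_eq_Ico, Finset.sum_eq_sum_Ico_succ_bot (by omega : 0 < N),
      Finset.sum_eq_sum_Ico_succ_bot (by omega : 0 + 1 < N), Nat.cast_zero,
      Real.zero_rpow (neg_ne_zero.mpr ha0.ne'), zero_add]
    simp only [zero_add, Nat.cast_one, Real.one_rpow]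
    congr 1
    have : Finset.Ico 2 N = (Finset.Ico 1 (N - 1)).image (· + 1) := by
      rw [Finset.image_add_right_Ico]  -- Ico (1+1) (N-1+1)
      congr 1; omega
    rw [this, Finset.sum_image (fun x _ y _ h => by simpa using h)]
  rw [hsplit]
  gcongr
  have hanti : AntitoneOn (fun x : ℝ => x ^ (-a)) (Set.Icc ((1 : ℕ) : ℝ) ((N - 1 : ℕ) : ℝ)) := by
    intro x hx y hy hxy
    have hx1 : (1 : ℝ) ≤ x := by simpa using hx.1
    exact Real.rpow_le_rpow_of_nonpos (by linarith) hxy (by linarith)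
  have hcmp := AntitoneOn.sum_le_integral_Ico (f := fun x : ℝ => x ^ (-a)) (a := 1) (b := N - 1)
    (by omega) hanti
  refine hcmp.trans ?_
  have hN1 : (1 : ℝ) ≤ ((N - 1 : ℕ) : ℝ) := by exact_mod_cast (show 1 ≤ N - 1 by omega)
  rw [integral_rpow (Or.inr ⟨by linarith, ?_⟩)]
  · have h1 : 0 ≤ ((N - 1 : ℕ) : ℝ) ^ (-(a - 1)) := by positivity
    rw [Nat.cast_one, Real.one_rpow, show -a + 1 = -(a - 1) by ring, div_neg, ← neg_div, neg_sub]
    exact div_le_div_of_nonneg_right (by linarith) ha'.le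
  · intro h
    rw [Set.mem_uIcc] at h
    rcases h with ⟨h0, _⟩ | ⟨h0, _⟩
    · norm_num at h0
    · linarith

/-- `Σ_n n^{−a} ≤ 1 + 1/(a−1)` for `a > 1`. [folklore] -/
private theorem tsum_rpow_neg_le {a : ℝ} (ha : 1 < a) :
    ∑' n : ℕ, (n : ℝ) ^ (-a) ≤ 1 + 1 / (a - 1) :=
  Real.tsum_le_of_sum_range_le (fun n => by positivity) fun N => sum_range_rpow_neg_le ha N

/-- `|ζ(σ₀)| ≤ 1 + 1/(σ₀ − 1)` for real `σ₀ > 1`. [folklore] -/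
private theorem norm_riemannZeta_real_le {σ₀ : ℝ} (h : 1 < σ₀) :
    ‖riemannZeta (σ₀ : ℂ)‖ ≤ 1 + 1 / (σ₀ - 1) := by
  have hs : 1 < (σ₀ : ℂ).re := by simpa using h
  have hsum : Summable fun n : ℕ => ‖1 / (n : ℂ) ^ (σ₀ : ℂ)‖ :=
    (Complex.summable_one_div_nat_cpow.mpr hs).norm
  rw [zeta_eq_tsum_one_div_nat_cpow hs]
  refine (norm_tsum_le_tsum_norm hsum).trans ?_
  have hterm : ∀ n : ℕ, ‖1 / (n : ℂ) ^ (σ₀ : ℂ)‖ = (n : ℝ) ^ (-σ₀) := by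
    intro n
    rcases Nat.eq_zero_or_pos n with rfl | hn
    · rw [Nat.cast_zero, Nat.cast_zero, Complex.zero_cpow (by exact_mod_cast (by linarith : σ₀ ≠ 0)),
        Real.zero_rpow (by linarith), div_zero, norm_zero]
    · rw [norm_div, norm_one, Complex.norm_natCast_cpow_of_pos hn, Complex.ofReal_re,
        Real.rpow_neg (Nat.cast_nonneg n), one_div]
  simp_rw [hterm]
  exact tsum_rpow_neg_le h

/-- The complex sequence `n ↦ (ζ n : ℂ)` of the coerced arithmetic function is Mathlib's `↗ζ`. [folklore] -/
private theorem zetaC_apply (n : ℕ) :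
    (ArithmeticFunction.zeta : ArithmeticFunction ℂ) n = ((ArithmeticFunction.zeta n : ℕ) : ℂ) :=
  natCoe_apply

/-- `Σ ζ^{∗k}(n) n^{−s}` is summable with value `ζ(s)^k` for `Re s > 1` (`k ≥ 1`). [folklore] -/
private theorem LSeries_zeta_pow {s : ℂ} (hs : 1 < s.re) (k : ℕ) :
    LSeriesSummable (fun n => ((ArithmeticFunction.zeta : ArithmeticFunction ℂ) ^ (k + 1)) n) s ∧
      LSeries (fun n => ((ArithmeticFunction.zeta : ArithmeticFunction ℂ) ^ (k + 1)) n) s =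
        riemannZeta s ^ (k + 1) := by
  have hζ : LSeriesSummable (fun n => (ArithmeticFunction.zeta : ArithmeticFunction ℂ) n) s := by
    simp_rw [zetaC_apply]; exact LSeriesSummable_zeta_iff.mpr hs
  have hζL : LSeries (fun n => (ArithmeticFunction.zeta : ArithmeticFunction ℂ) n) s = riemannZeta s := by
    simp_rw [zetaC_apply]; exact LSeries_zeta_eq_riemannZeta hs
  induction k with
  | zero => simpa [pow_one] using And.intro hζ hζL
  | succ k ih =>
    obtain ⟨ihS, ihL⟩ := ih
    rw [pow_succ]
    exact ⟨LSeriesSummable_mul ihS hζ, by rw [LSeries_mul' ihS hζ, ihL, hζL, ← pow_succ]⟩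

/-- **`Σ_m τ₅(m) m^{−σ₀} ≤ (1 + 1/(σ₀−1))⁵`** for real `σ₀ > 1` (the series is `ζ(σ₀)⁵`), with
summability. [folklore] -/
private theorem tsum_tau_five_rpow_le {σ₀ : ℝ} (h : 1 < σ₀) :
    Summable (fun m : ℕ => MeanSquareMajorant.tau 5 m * (m : ℝ) ^ (-σ₀)) ∧
      ∑' m : ℕ, MeanSquareMajorant.tau 5 m * (m : ℝ) ^ (-σ₀) ≤ (1 + 1 / (σ₀ - 1)) ^ 5 := by
  have hs : 1 < (σ₀ : ℂ).re := by simpa using h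
  obtain ⟨hS, hL⟩ := LSeries_zeta_pow hs 4
  -- the real terms are the complex `LSeries` terms
  have hterm : ∀ m : ℕ, ((MeanSquareMajorant.tau 5 m * (m : ℝ) ^ (-σ₀) : ℝ) : ℂ) =
      LSeries.term (fun n => ((ArithmeticFunction.zeta : ArithmeticFunction ℂ) ^ (4 + 1)) n) (σ₀ : ℂ) m := by
    intro m
    rcases Nat.eq_zero_or_pos m with rfl | hm
    · simp
    · rw [LSeries.term_of_ne_zero hm.ne', ← MeanSquareMajorant.tau_ofReal_eq_pow_apply,
        Complex.ofReal_mul, Complex.ofReal_cpow (Nat.cast_nonneg m), Complex.ofReal_natCast,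
        Complex.ofReal_neg, Complex.cpow_neg, div_eq_mul_inv]
  have hsumC : Summable fun m : ℕ => ((MeanSquareMajorant.tau 5 m * (m : ℝ) ^ (-σ₀) : ℝ) : ℂ) := by
    simp_rw [hterm]; exact hS
  have hsumR : Summable fun m : ℕ => MeanSquareMajorant.tau 5 m * (m : ℝ) ^ (-σ₀) :=
    Complex.summable_ofReal.mp hsumC
  refine ⟨hsumR, ?_⟩
  have hnn : 0 ≤ ∑' m : ℕ, MeanSquareMajorant.tau 5 m * (m : ℝ) ^ (-σ₀) :=
    tsum_nonneg fun m => mul_nonneg (MeanSquareMajorant.tau_nonneg 5 m) (Real.rpow_nonneg (Nat.cast_nonneg m) _)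
  have hval : ((∑' m : ℕ, MeanSquareMajorant.tau 5 m * (m : ℝ) ^ (-σ₀) : ℝ) : ℂ) =
      riemannZeta (σ₀ : ℂ) ^ 5 := by
    rw [Complex.ofReal_tsum]; simp_rw [hterm]; exact hL
  calc ∑' m : ℕ, MeanSquareMajorant.tau 5 m * (m : ℝ) ^ (-σ₀)
      = ‖((∑' m : ℕ, MeanSquareMajorant.tau 5 m * (m : ℝ) ^ (-σ₀) : ℝ) : ℂ)‖ := by
        rw [Complex.norm_real, Real.norm_of_nonneg hnn]
    _ = ‖riemannZeta (σ₀ : ℂ)‖ ^ 5 := by rw [hval, norm_pow]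
    _ ≤ (1 + 1 / (σ₀ - 1)) ^ 5 := by
        gcongr
        exact norm_riemannZeta_real_le h

/-- `Z22:§7.u015` HOLDS — the two "trivial bounds" for `σ ≥ 3/2`: `Σ_{m≥P²}(κ∗a₁)(m)ψ(m)m^{−s}
≪ P^{2(1−σ)}𝓛⁴⁵` (Rankin: `m^{−σ} ≤ X^{σ₀−σ}m^{−σ₀}` for `m ≥ X = P²`, `σ₀ = 1 + 1/log X`, and
`Σ τ₅(m)m^{−σ₀} = ζ(σ₀)⁵ ≤ (1 + log X)⁵`) and `A(𝐚₂;1−s,ψ̄) ≪ (PT⁻²)^σ` (`norm_ApolyBar_le`);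
constants `c = 45`, `C = 243·e·B`, valid for `D ≥ 3`. Kernel-checked; 0 new facts.
[cite: Zhang2022LandauSiegel, §7 p.34, tex L1878] -/
theorem step7u015_holds (c' : ℝ) : Step7u015 c' := by
  intro B
  refine ⟨45, 243 * Real.exp 1 * B, 3, fun D _ χ hD _ _ x a₁ a₂ ha₁ ha₂ s hs => ?_⟩
  have hB : 0 ≤ B := (norm_nonneg _).trans (ha₁.1 0)
  have hℓ : 1 ≤ Skeleton.ell D := one_le_ell hD
  have hP0 : 0 < Skeleton.bigP D := Real.exp_pos _
  have he1 : 1 ≤ Real.exp 1 := Real.one_le_exp (by norm_num)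
  constructor
  · -- (i) the tail `m ≥ P²`
    set σ := s.re with hσdef
    set X : ℝ := Skeleton.bigP D ^ 2 with hXdef
    set L : ℝ := 2 * Skeleton.ell D ^ 9 with hLdef
    have hXexp : X = Real.exp L := by
      rw [hXdef, hLdef, Skeleton.bigP, ← Real.exp_nat_mul]; norm_num
    have h9 : 1 ≤ Skeleton.ell D ^ 9 := one_le_pow₀ hℓ
    have hL2 : 2 ≤ L := by rw [hLdef]; linarith
    have hX0 : 0 < X := by rw [hXexp]; exact Real.exp_pos _
    set δ : ℝ := 1 / L with hδdef
    have hδ0 : 0 < δ := by positivity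
    have hδle : δ ≤ 1 / 2 := by rw [hδdef]; exact one_div_le_one_div_of_le (by norm_num) hL2
    set σ₀ : ℝ := 1 + δ with hσ₀def
    have hσ₀1 : 1 < σ₀ := by linarith
    have hσ₀σ : σ₀ ≤ σ := by linarith
    obtain ⟨hsumT, hT⟩ := tsum_tau_five_rpow_le hσ₀1
    set g : ℕ → ℝ := fun m =>
      B * X ^ (σ₀ - σ) * (MeanSquareMajorant.tau 5 m * (m : ℝ) ^ (-σ₀)) with hgdef
    have hg_summ : Summable g := hsumT.mul_left _
    have hK0 : 0 ≤ B * X ^ (σ₀ - σ) := mul_nonneg hB (Real.rpow_nonneg hX0.le _)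
    have hg_nonneg : ∀ m, 0 ≤ g m := fun m =>
      mul_nonneg hK0 (mul_nonneg (MeanSquareMajorant.tau_nonneg 5 m)
        (Real.rpow_nonneg (Nat.cast_nonneg m) _))
    have hf : ∀ m : ℕ,
        ‖(if X ≤ (m : ℝ) then kconv c' D a₁ m * x.ψ m / (m : ℂ) ^ s else 0)‖ ≤ g m := by
      intro m
      split_ifs with hm
      · have hm0 : 0 < (m : ℝ) := lt_of_lt_of_le hX0 hm
        have hm0' : 0 < m := by exact_mod_cast hm0
        rw [norm_div, norm_mul, Complex.norm_natCast_cpow_of_pos hm0', ← hσdef]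
        have h1 : ‖kconv c' D a₁ m‖ * ‖x.ψ (m : ZMod x.p)‖ ≤ B * MeanSquareMajorant.tau 5 m := by
          calc ‖kconv c' D a₁ m‖ * ‖x.ψ (m : ZMod x.p)‖
              ≤ B * MeanSquareMajorant.tau 5 m * 1 :=
                mul_le_mul (norm_kconv_le_tau_five c' ha₁.1 m) (x.ψ.norm_le_one _) (norm_nonneg _)
                  (mul_nonneg hB (MeanSquareMajorant.tau_nonneg 5 m))
            _ = B * MeanSquareMajorant.tau 5 m := mul_one _
        have h2 : ((m : ℝ) ^ σ)⁻¹ ≤ X ^ (σ₀ - σ) * (m : ℝ) ^ (-σ₀) := by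
          rw [← Real.rpow_neg hm0.le, show -σ = -(σ - σ₀) + -σ₀ by ring, Real.rpow_add hm0,
            show σ₀ - σ = -(σ - σ₀) by ring]
          exact mul_le_mul_of_nonneg_right
            (Real.rpow_le_rpow_of_nonpos hX0 hm (by linarith)) (Real.rpow_nonneg hm0.le _)
        rw [div_eq_mul_inv]
        calc ‖kconv c' D a₁ m‖ * ‖x.ψ (m : ZMod x.p)‖ * ((m : ℝ) ^ σ)⁻¹
            ≤ B * MeanSquareMajorant.tau 5 m * (X ^ (σ₀ - σ) * (m : ℝ) ^ (-σ₀)) :=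
              mul_le_mul h1 h2 (by positivity) (mul_nonneg hB (MeanSquareMajorant.tau_nonneg 5 m))
          _ = g m := by rw [hgdef]; ring
      · rw [norm_zero]; exact hg_nonneg m
    have hsumm : Summable fun m : ℕ =>
        ‖(if X ≤ (m : ℝ) then kconv c' D a₁ m * x.ψ m / (m : ℂ) ^ s else 0)‖ :=
      Summable.of_nonneg_of_le (fun _ => norm_nonneg _) hf hg_summ
    have htail : ‖kconvTail c' x a₁ s‖ ≤ B * X ^ (σ₀ - σ) * (1 + 1 / (σ₀ - 1)) ^ 5 := by
      unfold kconvTail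
      calc ‖∑' m : ℕ, (if X ≤ (m : ℝ) then kconv c' D a₁ m * x.ψ m / (m : ℂ) ^ s else 0)‖
          ≤ ∑' m : ℕ, ‖(if X ≤ (m : ℝ) then kconv c' D a₁ m * x.ψ m / (m : ℂ) ^ s else 0)‖ :=
            norm_tsum_le_tsum_norm hsumm
        _ ≤ ∑' m : ℕ, g m := Summable.tsum_le_tsum hf hsumm hg_summ
        _ = B * X ^ (σ₀ - σ) * ∑' m : ℕ, (MeanSquareMajorant.tau 5 m * (m : ℝ) ^ (-σ₀)) :=
            tsum_mul_left
        _ ≤ B * X ^ (σ₀ - σ) * (1 + 1 / (σ₀ - 1)) ^ 5 := by gcongr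
    have hXpow : X ^ (σ₀ - σ) = Real.exp 1 * Skeleton.bigP D ^ (2 * (1 - σ)) := by
      rw [show σ₀ - σ = δ + (1 - σ) by rw [hσ₀def]; ring, Real.rpow_add hX0]
      congr 1
      · rw [hXexp, ← Real.exp_mul]
        congr 1
        rw [hδdef]; field_simp
      · rw [hXdef, ← Real.rpow_natCast, ← Real.rpow_mul hP0.le]; norm_num
    have hδinv : 1 + 1 / (σ₀ - 1) = 1 + L := by
      rw [hσ₀def, hδdef]; field_simp; ring
    have hLpow : (1 + L) ^ 5 ≤ 243 * Skeleton.ell D ^ (45 : ℝ) := by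
      have h3 : 1 + L ≤ 3 * Skeleton.ell D ^ 9 := by rw [hLdef]; linarith
      calc (1 + L) ^ 5 ≤ (3 * Skeleton.ell D ^ 9) ^ 5 := pow_le_pow_left₀ (by positivity) h3 5
        _ = 243 * Skeleton.ell D ^ (45 : ℕ) := by ring
        _ = 243 * Skeleton.ell D ^ (45 : ℝ) := by norm_cast
    calc ‖kconvTail c' x a₁ s‖ ≤ B * X ^ (σ₀ - σ) * (1 + 1 / (σ₀ - 1)) ^ 5 := htail
      _ = B * (Real.exp 1 * Skeleton.bigP D ^ (2 * (1 - σ))) * (1 + L) ^ 5 := by rw [hXpow, hδinv]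
      _ ≤ B * (Real.exp 1 * Skeleton.bigP D ^ (2 * (1 - σ))) * (243 * Skeleton.ell D ^ (45 : ℝ)) := by
          gcongr
      _ = 243 * Real.exp 1 * B * Skeleton.bigP D ^ (2 * (1 - σ)) * Skeleton.ell D ^ (45 : ℝ) := by
          ring
  · -- (ii) the short Dirichlet polynomial
    calc ‖Skeleton.ApolyBar x a₂ (1 - s)‖
        ≤ B * (Skeleton.bigP D / Skeleton.bigT D ^ 2) ^ s.re := norm_ApolyBar_le x ha₂ (by linarith)
      _ ≤ 243 * Real.exp 1 * B * (Skeleton.bigP D / Skeleton.bigT D ^ 2) ^ s.re := by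
          gcongr
          nlinarith

variable (c' : ℝ) in
/-- `Step7u015` — `_holds` alias of `step7u015_holds` above under the fact's exact name, stated under the
prover's own binders as section variables (appended 2026-08-28, D-0026 bookkeeping: the proof term is the
existing theorem of this file; no statement, definition or attribute is edited; no new named fact; the
ledger's debt table listed the fact unproved). [cite: Zhang2022LandauSiegel, §7 p.34, tex L1878] -/
theorem _root_.Literature.NumberTheory.LFunctions.Zhang2022.Section7aStatements.Step7u015_holds :
    _root_.Literature.NumberTheory.LFunctions.Zhang2022.Section7aStatements.Step7u015 c' :=
  _root_.Literature.NumberTheory.LFunctions.Zhang2022.Section7aStatements.step7u015_holds (c' := c')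

end TrivialBounds

/-! ## `Z22:§7.u016`: the size of `Z(s,ψ)⁻¹` to the right of the critical line -/

section ZfacInverse

open Set MeasureTheory intervalIntegral

/-- The size of `Z(s,ψ)⁻¹` on `1/2 ≤ σ ≤ 𝓛⁹ + 1/2`, `|t − 2πt₀| ≤ 𝓛₁` (`D ≥ 3`):
`|Z(s,ψ)⁻¹| ≤ e³ (pt₀)^{σ−1/2}`. Proof: `|Z(½+it,ψ)| = 1` and
`Z(σ+it) = Z(½+it)·exp((σ−½)∫₀¹ (Z′/Z)(½+x(σ−½)+it) dx)` (the tree's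
`Lemma45.eq_mul_exp_integral_logDeriv_segment`), with the Stirling bound
`|(Z′/Z)(u+it,ψ) + log(pt₀)| ≤ (2|t−2πt₀| + 4(𝓛⁹+½) + 10)/(2πt₀)` for `0 < u ≤ 𝓛⁹ + ½`
(`GammaFactor.norm_logDeriv_Zfac_add_log_le` at the base height `2πt₀`); the error exponent is
`≤ 18𝓛⁴¹⁴/(2π𝓛⁵¹⁹) ≤ 3`. This is the estimate `Z22:§7.u016` on the slightly larger range that the
contour shifts of `Z22:§7.u017`/`u018` actually use. [cite: Zhang2022LandauSiegel, §7 p.34, tex L1882] -/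
theorem norm_Zfac_inv_le {D : ℕ} (hD : 3 ≤ D) (x : Skeleton.Chr D) {s : ℂ}
    (hσ1 : 1 / 2 ≤ s.re) (hσ2 : s.re ≤ Skeleton.ell D ^ 9 + 1 / 2)
    (ht : |s.im - 2 * π * Skeleton.t0 D| ≤ Skeleton.ell1 D) :
    ‖(GammaFactor.Zfac x.ψ s)⁻¹‖ ≤ Real.exp 3 * ((x.p : ℝ) * Skeleton.t0 D) ^ (s.re - 1 / 2) := by
  have hℓ : 1 ≤ Skeleton.ell D := one_le_ell hD
  set ℓ := Skeleton.ell D with hℓdef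
  set A : ℝ := ℓ ^ 9 + 1 / 2 with hAdef
  have hℓ9 : 1 ≤ ℓ ^ 9 := one_le_pow₀ hℓ
  have hA1 : 1 ≤ A := by rw [hAdef]; linarith
  set T : ℝ := 2 * π * Skeleton.t0 D with hTdef
  have ht0def : Skeleton.t0 D = ℓ ^ 519 := rfl
  have hℓ519 : 1 ≤ ℓ ^ 519 := one_le_pow₀ hℓ
  have hπ3 : 3 < π := Real.pi_gt_three
  have hT0 : 0 < T := by rw [hTdef, ht0def]; positivity
  -- comparison of powers of `ℓ ≥ 1`
  have hpow1 : ℓ ^ 9 ≤ ℓ ^ 519 := pow_le_pow_right₀ hℓ (by norm_num)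
  have hpow2 : ℓ ^ 405 ≤ ℓ ^ 519 := pow_le_pow_right₀ hℓ (by norm_num)
  have hpow3 : ℓ ^ 414 ≤ ℓ ^ 519 := pow_le_pow_right₀ hℓ (by norm_num)
  have h4A : 4 * A ≤ T := by
    rw [hAdef, hTdef, ht0def]
    nlinarith [mul_nonneg (sub_nonneg.mpr hπ3.le) (zero_le_one.trans hℓ519)]
  set y : ℝ := s.im - T with hydef
  have hy : |y| ≤ Skeleton.ell1 D := by rw [hydef, hTdef]; exact ht
  have hell1 : Skeleton.ell1 D = ℓ ^ 405 := rfl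
  have hyT : |y| ≤ T / 2 := by
    rw [hell1] at hy; rw [hTdef, ht0def]; nlinarith
  -- the segment from `a = ½ + i·Im s` to `s`, `w = σ − ½`
  set σ := s.re with hσdef
  have hw0 : 0 ≤ σ - 1 / 2 := by linarith
  have hw9 : σ - 1 / 2 ≤ ℓ ^ 9 := by rw [hℓdef]; linarith
  set w : ℂ := ((σ - 1 / 2 : ℝ) : ℂ) with hw
  set a : ℂ := (1 / 2 : ℂ) + s.im * I with ha
  have him_s : 0 < s.im := by
    have h1 : -|y| ≤ y := neg_abs_le y
    have h2 : y = s.im - T := hydef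
    linarith
  have hpt : ∀ r : ℝ, a + (r : ℂ) * w = ((1 / 2 + r * (σ - 1 / 2) : ℝ) : ℂ) + s.im * I := by
    intro r; rw [ha, hw]; push_cast; ring
  have him : ∀ r : ℝ, 0 < (a + (r : ℂ) * w).im := by
    intro r; rw [hpt]; simpa using him_s
  have hg : ∀ r ∈ Icc (0 : ℝ) 1, AnalyticAt ℂ (GammaFactor.Zfac x.ψ) (a + r * w) :=
    fun r _ => GammaFactor.analyticAt_Zfac x.ψ (him r)
  have h0 : ∀ r ∈ Icc (0 : ℝ) 1, GammaFactor.Zfac x.ψ (a + r * w) ≠ 0 :=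
    fun r _ => GammaFactor.Zfac_ne_zero x.prim (him r)
  have key := Lemma45.eq_mul_exp_integral_logDeriv_segment hg h0
  have haw : a + w = s := by
    rw [ha, hw]; apply Complex.ext <;> simp [hσdef]
  have ha1 : ‖GammaFactor.Zfac x.ψ a‖ = 1 := by
    rw [ha]; exact GammaFactor.norm_Zfac_half_eq_one x.prim him_s
  -- the Stirling bound along the segment, base height `T = 2πt₀`
  set L : ℝ := Real.log ((x.p : ℝ) * Skeleton.t0 D) with hL
  set δ : ℝ := (2 * |y| + 4 * A + 10) / T with hδ
  have hLT : Real.log ((x.p : ℝ) * T / (2 * π)) = L := by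
    rw [hL, hTdef]; congr 1; field_simp
  have hp2 : (2 : ℝ) ≤ x.p := by exact_mod_cast x.prime.two_le
  have hL0 : 0 ≤ L := by
    rw [hL]; apply Real.log_nonneg; rw [ht0def]; nlinarith
  have hpw : ∀ r ∈ Set.uIoc (0 : ℝ) 1,
      ‖deriv (GammaFactor.Zfac x.ψ) (a + r * w) / GammaFactor.Zfac x.ψ (a + r * w)‖ ≤ L + δ := by
    intro r hr
    have hr' : 0 ≤ r ∧ r ≤ 1 := by
      rw [Set.uIoc_of_le zero_le_one] at hr; exact ⟨hr.1.le, hr.2⟩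
    have hrw : 0 ≤ r * (σ - 1 / 2) := mul_nonneg hr'.1 hw0
    have hrw' : r * (σ - 1 / 2) ≤ 1 * ℓ ^ 9 := mul_le_mul hr'.2 hw9 hw0 zero_le_one
    have hu0 : 0 < 1 / 2 + r * (σ - 1 / 2) := by linarith
    have hu1 : 1 / 2 + r * (σ - 1 / 2) ≤ A := by rw [hAdef]; linarith
    have hlog := GammaFactor.norm_logDeriv_Zfac_add_log_le x.prim (A := A)
      (σ := 1 / 2 + r * (σ - 1 / 2)) (t := T) (y := y) hA1 hu0 hu1 h4A hyT
    have hpt' : ((1 / 2 + r * (σ - 1 / 2) : ℝ) : ℂ) + T * I + (y : ℂ) * I = a + r * w := by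
      rw [hpt, hydef]; push_cast; ring
    rw [hpt', logDeriv_apply, hLT] at hlog
    calc ‖deriv (GammaFactor.Zfac x.ψ) (a + r * w) / GammaFactor.Zfac x.ψ (a + r * w)‖
        = ‖(deriv (GammaFactor.Zfac x.ψ) (a + r * w) / GammaFactor.Zfac x.ψ (a + r * w) + (L : ℂ))
            - (L : ℂ)‖ := by rw [add_sub_cancel_right]
      _ ≤ ‖deriv (GammaFactor.Zfac x.ψ) (a + r * w) / GammaFactor.Zfac x.ψ (a + r * w) + (L : ℂ)‖
            + ‖(L : ℂ)‖ := norm_sub_le _ _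
      _ ≤ δ + L := by
          rw [Complex.norm_real, Real.norm_of_nonneg hL0]; exact add_le_add hlog le_rfl
      _ = L + δ := add_comm _ _
  have hint := intervalIntegral.norm_integral_le_of_norm_le_const hpw
  rw [sub_zero, abs_one, mul_one] at hint
  -- the error exponent `(σ − ½)δ ≤ 3`
  have hδ3 : (σ - 1 / 2) * δ ≤ 3 := by
    have hnum : 2 * |y| + 4 * A + 10 ≤ 18 * ℓ ^ 405 := by
      rw [hell1] at hy; rw [hAdef]
      have : ℓ ^ 9 ≤ ℓ ^ 405 := pow_le_pow_right₀ hℓ (by norm_num)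
      have h405 : 1 ≤ ℓ ^ 405 := one_le_pow₀ hℓ
      linarith
    have hδ' : δ ≤ 18 * ℓ ^ 405 / T := by
      rw [hδ]; exact div_le_div_of_nonneg_right hnum hT0.le
    calc (σ - 1 / 2) * δ ≤ ℓ ^ 9 * (18 * ℓ ^ 405 / T) :=
          mul_le_mul hw9 hδ' (by rw [hδ]; positivity) (by positivity)
      _ = 18 * ℓ ^ 414 / (2 * π * ℓ ^ 519) := by rw [hTdef, ht0def]; ring
      _ ≤ 18 * ℓ ^ 519 / (6 * ℓ ^ 519) := by
          gcongr
          · linarith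
      _ = 18 / 6 := by field_simp
      _ ≤ 3 := by norm_num
  -- assemble
  have hZinv : (GammaFactor.Zfac x.ψ s)⁻¹ =
      (GammaFactor.Zfac x.ψ a)⁻¹ * Complex.exp (-(w * ∫ r in (0 : ℝ)..1,
        deriv (GammaFactor.Zfac x.ψ) (a + r * w) / GammaFactor.Zfac x.ψ (a + r * w))) := by
    rw [← haw, key, mul_inv, Complex.exp_neg]
  rw [hZinv, norm_mul, norm_inv, ha1, inv_one, one_mul, Complex.norm_exp]
  have hre : (-(w * ∫ r in (0 : ℝ)..1, deriv (GammaFactor.Zfac x.ψ) (a + r * w) /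
        GammaFactor.Zfac x.ψ (a + r * w))).re ≤ (σ - 1 / 2) * (L + δ) := by
    calc (-(w * ∫ r in (0 : ℝ)..1, deriv (GammaFactor.Zfac x.ψ) (a + r * w) /
            GammaFactor.Zfac x.ψ (a + r * w))).re
        ≤ ‖-(w * ∫ r in (0 : ℝ)..1, deriv (GammaFactor.Zfac x.ψ) (a + r * w) /
            GammaFactor.Zfac x.ψ (a + r * w))‖ := Complex.re_le_norm _
      _ = (σ - 1 / 2) * ‖∫ r in (0 : ℝ)..1, deriv (GammaFactor.Zfac x.ψ) (a + r * w) /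
            GammaFactor.Zfac x.ψ (a + r * w)‖ := by
          rw [norm_neg, norm_mul, hw, Complex.norm_real, Real.norm_of_nonneg hw0]
      _ ≤ (σ - 1 / 2) * (L + δ) := by gcongr
  have hpt0 : 0 < (x.p : ℝ) * Skeleton.t0 D := by rw [ht0def]; positivity
  calc Real.exp (-(w * ∫ r in (0 : ℝ)..1, deriv (GammaFactor.Zfac x.ψ) (a + r * w) /
          GammaFactor.Zfac x.ψ (a + r * w))).re
      ≤ Real.exp ((σ - 1 / 2) * (L + δ)) := Real.exp_le_exp.mpr hre
    _ = Real.exp ((σ - 1 / 2) * δ) * ((x.p : ℝ) * Skeleton.t0 D) ^ (σ - 1 / 2) := by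
        rw [Real.rpow_def_of_pos hpt0, ← hL, ← Real.exp_add]; congr 1; ring
    _ ≤ Real.exp 3 * ((x.p : ℝ) * Skeleton.t0 D) ^ (σ - 1 / 2) := by
        gcongr

/-- **`Z22:§7.u016` HOLDS**: "`Z(s,ψ)⁻¹ ≪ (pt₀)^{σ−1/2}` for `3/2 ≤ σ ≤ 𝓛⁹`, `|t − 2πt₀| ≤ 𝓛₁`" with
the absolute constant `e³`, for `D ≥ 3` (a special case of `norm_Zfac_inv_le`). Kernel-checked;
0 new facts. [cite: Zhang2022LandauSiegel, §7 p.34, tex L1882] -/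
theorem step7u016_holds : Step7u016 :=
  ⟨Real.exp 3, 3, fun _ _ _ hD _ _ x _ hσ1 hσ2 ht =>
    norm_Zfac_inv_le hD x (by linarith) (by linarith) ht⟩

end ZfacInverse

/-! ## Moving the segment `𝔍(z)` (Cauchy's theorem on a rectangle): the tools for `Z22:§7.u017`–`u018` -/

section ContourShift

open Set MeasureTheory intervalIntegral

/-- `∫_{𝔍(z)} F(s) ds = i∫_{2πt₀−𝓛₁}^{2πt₀+𝓛₁} F(½ + z + iy) dy` (the parametrisation `s = ½+z+iy`).
[cite: Zhang2022LandauSiegel, §7 p.33, tex L1824] -/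
private theorem intJ_eq_I_mul (D : ℕ) (z : ℝ) (F : ℂ → ℂ) :
    intJ D z F = I * ∫ y in (2 * π * Skeleton.t0 D - Skeleton.ell1 D)..
      (2 * π * Skeleton.t0 D + Skeleton.ell1 D), F (((1 / 2 + z : ℝ) : ℂ) + y * I) := by
  rw [intJ, Lemma81.segInt_def]
  have hsub : (∫ v in (-Skeleton.ell1 D)..Skeleton.ell1 D,
      F ((z : ℂ) + SmoothWeight.s0 (Skeleton.t0 D) + v * I)) =
      ∫ y in (2 * π * Skeleton.t0 D - Skeleton.ell1 D)..(2 * π * Skeleton.t0 D + Skeleton.ell1 D),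
        F (((1 / 2 + z : ℝ) : ℂ) + y * I) := by
    have h := intervalIntegral.integral_comp_add_right
      (fun y : ℝ => F (((1 / 2 + z : ℝ) : ℂ) + y * I)) (2 * π * Skeleton.t0 D)
      (a := -Skeleton.ell1 D) (b := Skeleton.ell1 D)
    rw [show 2 * π * Skeleton.t0 D - Skeleton.ell1 D = -Skeleton.ell1 D + 2 * π * Skeleton.t0 D by
      ring, show 2 * π * Skeleton.t0 D + Skeleton.ell1 D = Skeleton.ell1 D + 2 * π * Skeleton.t0 D
      by ring, ← h]
    refine intervalIntegral.integral_congr fun v _ => ?_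
    show F _ = F _
    congr 1
    rw [SmoothWeight.s0_def]; push_cast; ring
  rw [hsub, ← mul_assoc]
  congr 1
  have hπ : (π : ℂ) ≠ 0 := by exact_mod_cast Real.pi_ne_zero
  field_simp

/-- **Cauchy's theorem on the rectangle with vertical sides `𝔍(z₁)`, `𝔍(z₂)`**: for `F` holomorphic
on the closed rectangle, `∫_{𝔍(z₂)} F − ∫_{𝔍(z₁)} F = ∫_{top} F − ∫_{bottom} F` (the horizontal sides
at heights `2πt₀ ± 𝓛₁`). This is the "moving the segment" / "move the path of integration" of
§7 p. 35 (Mathlib's `Complex.integral_boundary_rect_eq_zero_of_differentiableOn`).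
[cite: Zhang2022LandauSiegel, §7 p.35, tex L1890–1911] -/
theorem intJ_sub_intJ_eq (D : ℕ) (z₁ z₂ : ℝ) {F : ℂ → ℂ}
    (hF : DifferentiableOn ℂ F (Set.uIcc (1 / 2 + z₁) (1 / 2 + z₂) ×ℂ
      Set.uIcc (2 * π * Skeleton.t0 D - Skeleton.ell1 D) (2 * π * Skeleton.t0 D + Skeleton.ell1 D))) :
    intJ D z₂ F - intJ D z₁ F =
      (∫ u in (1 / 2 + z₁)..(1 / 2 + z₂),
          F ((u : ℂ) + ((2 * π * Skeleton.t0 D + Skeleton.ell1 D : ℝ) : ℂ) * I)) -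
        ∫ u in (1 / 2 + z₁)..(1 / 2 + z₂),
          F ((u : ℂ) + ((2 * π * Skeleton.t0 D - Skeleton.ell1 D : ℝ) : ℂ) * I) := by
  have h := Complex.integral_boundary_rect_eq_zero_of_differentiableOn F
    (((1 / 2 + z₁ : ℝ) : ℂ) + ((2 * π * Skeleton.t0 D - Skeleton.ell1 D : ℝ) : ℂ) * I)
    (((1 / 2 + z₂ : ℝ) : ℂ) + ((2 * π * Skeleton.t0 D + Skeleton.ell1 D : ℝ) : ℂ) * I)
    (by simpa only [Complex.add_re, Complex.add_im, Complex.ofReal_re, Complex.ofReal_im,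
      Complex.mul_re, Complex.mul_im, Complex.I_re, Complex.I_im, mul_zero, mul_one, sub_zero,
      zero_add, add_zero, zero_mul] using hF)
  simp only [Complex.add_re, Complex.add_im, Complex.ofReal_re, Complex.ofReal_im,
    Complex.mul_re, Complex.mul_im, Complex.I_re, Complex.I_im, mul_zero, mul_one, sub_zero,
    zero_add, add_zero, smul_eq_mul] at h
  rw [intJ_eq_I_mul, intJ_eq_I_mul]
  linear_combination h

/-- The resulting bound: `|∫_{𝔍(z₂)} F − ∫_{𝔍(z₁)} F| ≤ (z₂ − z₁)(M₁ + M₂)` when `|F| ≤ M₁` on the top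
side and `|F| ≤ M₂` on the bottom side of the rectangle. [cite: Zhang2022LandauSiegel, §7 p.35, tex L1890–1911] -/
theorem norm_intJ_sub_intJ_le (D : ℕ) {z₁ z₂ M₁ M₂ : ℝ} (hz : z₁ ≤ z₂) {F : ℂ → ℂ}
    (hF : DifferentiableOn ℂ F (Set.uIcc (1 / 2 + z₁) (1 / 2 + z₂) ×ℂ
      Set.uIcc (2 * π * Skeleton.t0 D - Skeleton.ell1 D) (2 * π * Skeleton.t0 D + Skeleton.ell1 D)))
    (htop : ∀ u ∈ Set.Icc (1 / 2 + z₁) (1 / 2 + z₂),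
      ‖F ((u : ℂ) + ((2 * π * Skeleton.t0 D + Skeleton.ell1 D : ℝ) : ℂ) * I)‖ ≤ M₁)
    (hbot : ∀ u ∈ Set.Icc (1 / 2 + z₁) (1 / 2 + z₂),
      ‖F ((u : ℂ) + ((2 * π * Skeleton.t0 D - Skeleton.ell1 D : ℝ) : ℂ) * I)‖ ≤ M₂) :
    ‖intJ D z₂ F - intJ D z₁ F‖ ≤ (z₂ - z₁) * (M₁ + M₂) := by
  rw [intJ_sub_intJ_eq D z₁ z₂ hF]
  have hle : 1 / 2 + z₁ ≤ 1 / 2 + z₂ := by linarith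
  have hmem : ∀ u ∈ Set.uIoc (1 / 2 + z₁) (1 / 2 + z₂), u ∈ Set.Icc (1 / 2 + z₁) (1 / 2 + z₂) := by
    intro u hu
    rw [Set.uIoc_of_le hle] at hu
    exact ⟨hu.1.le, hu.2⟩
  have h1 := intervalIntegral.norm_integral_le_of_norm_le_const (a := 1 / 2 + z₁) (b := 1 / 2 + z₂)
    (C := M₁) (f := fun u : ℝ => F ((u : ℂ) + ((2 * π * Skeleton.t0 D + Skeleton.ell1 D : ℝ) : ℂ) * I))
    (fun u hu => htop u (hmem u hu))
  have h2 := intervalIntegral.norm_integral_le_of_norm_le_const (a := 1 / 2 + z₁) (b := 1 / 2 + z₂)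
    (C := M₂) (f := fun u : ℝ => F ((u : ℂ) + ((2 * π * Skeleton.t0 D - Skeleton.ell1 D : ℝ) : ℂ) * I))
    (fun u hu => hbot u (hmem u hu))
  have habs : |1 / 2 + z₂ - (1 / 2 + z₁)| = z₂ - z₁ := by
    rw [abs_of_nonneg (by linarith)]; ring
  rw [habs] at h1 h2
  calc ‖(∫ u in (1 / 2 + z₁)..(1 / 2 + z₂),
          F ((u : ℂ) + ((2 * π * Skeleton.t0 D + Skeleton.ell1 D : ℝ) : ℂ) * I)) -
        ∫ u in (1 / 2 + z₁)..(1 / 2 + z₂),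
          F ((u : ℂ) + ((2 * π * Skeleton.t0 D - Skeleton.ell1 D : ℝ) : ℂ) * I)‖
      ≤ ‖∫ u in (1 / 2 + z₁)..(1 / 2 + z₂),
          F ((u : ℂ) + ((2 * π * Skeleton.t0 D + Skeleton.ell1 D : ℝ) : ℂ) * I)‖ +
        ‖∫ u in (1 / 2 + z₁)..(1 / 2 + z₂),
          F ((u : ℂ) + ((2 * π * Skeleton.t0 D - Skeleton.ell1 D : ℝ) : ℂ) * I)‖ := norm_sub_le _ _
    _ ≤ M₁ * (z₂ - z₁) + M₂ * (z₂ - z₁) := add_le_add h1 h2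
    _ = (z₂ - z₁) * (M₁ + M₂) := by ring

/-- `|∫_{𝔍(z)} F(s) ds| ≤ ∫_{𝔍(z)} |F(s) ds|`. [cite: Zhang2022LandauSiegel, §7 p.35, tex L1893] -/
theorem norm_intJ_le_absIntJ (D : ℕ) (hL : 0 ≤ Skeleton.ell1 D) (z : ℝ) (F : ℂ → ℂ) :
    ‖intJ D z F‖ ≤ absIntJ D z F := by
  rw [intJ, Lemma81.segInt_def, absIntJ, ← mul_assoc]
  have hπ : (π : ℂ) ≠ 0 := by exact_mod_cast Real.pi_ne_zero
  have hc : 2 * (π : ℂ) * I * (1 / (2 * π)) = I := by field_simp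
  rw [hc, norm_mul, Complex.norm_I, one_mul]
  exact intervalIntegral.norm_integral_le_integral_norm (by linarith)

/-! ### Holomorphy of the factors -/

/-- The weight `ω` ((2.15)) is entire. [cite: Zhang2022LandauSiegel, §2 (2.15)] -/
theorem differentiable_omegaW (D : ℕ) : Differentiable ℂ (Skeleton.omegaW D) := by
  have h : Skeleton.omegaW D = fun s => ((Real.sqrt π / Skeleton.ell2 D : ℝ) : ℂ) *
      cexp ((s - SmoothWeight.s0 (Skeleton.t0 D)) ^ 2 / (4 * (Skeleton.ell2 D : ℂ) ^ 2)) := by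
    funext s; rfl
  rw [h]
  fun_prop

/-- A Dirichlet character to a modulus `k ≠ 1` vanishes at `0`. [folklore] -/
private theorem dirichletCharacter_apply_zero' {k : ℕ} [NeZero k] (θ : DirichletCharacter ℂ k)
    (hk : k ≠ 1) : θ (0 : ZMod k) = 0 := by
  haveI : Nontrivial (ZMod k) := ZMod.nontrivial_iff.mpr hk
  exact MulChar.map_nonunit θ not_isUnit_zero

/-- The Dirichlet polynomial `A(a;s,θ)` ((7.2): a finite sum of `a(n)θ(n)n^{−s}`, `n ≥ 1`) is entire.
[cite: Zhang2022LandauSiegel, §7 p.32 (after (7.2))] -/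
theorem differentiable_dirPoly {k : ℕ} [NeZero k] (N : ℕ) (a : ℕ → ℂ)
    (θ : DirichletCharacter ℂ k) (hk : k ≠ 1) : Differentiable ℂ (Lemma81.dirPoly N a θ) := by
  have h : Lemma81.dirPoly N a θ = fun s => ∑ n ∈ Finset.range N, a n * θ n * (n : ℂ) ^ (-s) := by
    funext s; rw [Lemma81.dirPoly_def]
  rw [h]
  refine Differentiable.fun_sum fun n _ => ?_
  rcases Nat.eq_zero_or_pos n with rfl | hn
  · have h0 : (θ ((0 : ℕ) : ZMod k)) = 0 := by
      rw [Nat.cast_zero]; exact dirichletCharacter_apply_zero' θ hk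
    simp only [h0, mul_zero, zero_mul]
    exact differentiable_const 0
  · exact (differentiable_const _).mul
      (differentiable_id.neg.const_cpow (Or.inl (Nat.cast_ne_zero.mpr hn.ne')))

/-- `A(𝐚;s,ψ)` is entire. [cite: Zhang2022LandauSiegel, §7 p.32 (after (7.2))] -/
theorem differentiable_Apoly {D : ℕ} (x : Skeleton.Chr D) (a : ℕ → ℂ) :
    Differentiable ℂ (Skeleton.Apoly x a) :=
  differentiable_dirPoly _ a x.ψ x.p_ne_one

/-- `s ↦ A(𝐚;1−s,ψ̄)` is entire. [cite: Zhang2022LandauSiegel, §7 p.32 (after (7.2))] -/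
theorem differentiable_ApolyBar_one_sub {D : ℕ} (x : Skeleton.Chr D) (a : ℕ → ℂ) :
    Differentiable ℂ fun s => Skeleton.ApolyBar x a (1 - s) :=
  (differentiable_dirPoly _ a x.ψ⁻¹ x.p_ne_one).comp ((differentiable_const _).sub differentiable_id)

/-- The head `Σ_{m<P²} (κ∗a₁)(m)ψ(m)m^{−s}` is entire (a finite sum over `m ≥ 1`).
[cite: Zhang2022LandauSiegel, §7 p.34, tex L1877] -/
theorem differentiable_kconvHead (c' : ℝ) {D : ℕ} (x : Skeleton.Chr D) (a : ℕ → ℂ) :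
    Differentiable ℂ (kconvHead c' x a) := by
  have h : kconvHead c' x a = fun s =>
      ∑ m ∈ Finset.Ico 1 ⌈Skeleton.bigP D ^ 2⌉₊, kconv c' D a m * x.ψ m / (m : ℂ) ^ s := by
    funext s; rfl
  rw [h]
  refine Differentiable.fun_sum fun m hm => ?_
  have hm1 : (m : ℂ) ≠ 0 := Nat.cast_ne_zero.mpr (by have := (Finset.mem_Ico.mp hm).1; omega)
  exact (differentiable_const _).div (differentiable_id.const_cpow (Or.inl hm1))
    fun s h0 => hm1 ((Complex.cpow_eq_zero_iff _ _).mp h0).1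

/-- `Z(s,ψ)⁻¹` is holomorphic in the upper half-plane (`Z(s,ψ) ≠ 0` there, `ψ` primitive).
[cite: Zhang2022LandauSiegel, §2 p.7, tex L400] -/
theorem differentiableAt_Zfac_inv {D : ℕ} (x : Skeleton.Chr D) {s : ℂ} (hs : 0 < s.im) :
    DifferentiableAt ℂ (fun s => (GammaFactor.Zfac x.ψ s)⁻¹) s :=
  (GammaFactor.differentiableAt_Zfac x.ψ hs).inv (GammaFactor.Zfac_ne_zero x.prim hs)

end ContourShift

/-! ## `Z22:§7.u018` (alternative reading): moving the path of integration from `𝔍(1)` to `𝔍(0)` -/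

section MoveToCriticalLine

open Set MeasureTheory intervalIntegral

/-- `2πt₀ − 𝓛₁ > 0` (`D ≥ 3`): the rectangles between the segments `𝔍(z)` lie in the upper
half-plane. [cite: Zhang2022LandauSiegel, §2 p.5, tex L300] -/
private theorem twoPiT0_sub_ell1_pos {D : ℕ} (hD : 3 ≤ D) :
    0 < 2 * π * Skeleton.t0 D - Skeleton.ell1 D := by
  have hℓ := one_le_ell hD
  have h1 : Skeleton.ell D ^ 405 ≤ Skeleton.ell D ^ 519 := pow_le_pow_right₀ hℓ (by norm_num)
  have h2 : 1 ≤ Skeleton.ell D ^ 519 := one_le_pow₀ hℓ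
  rw [Skeleton.t0, Skeleton.ell1]; nlinarith [Real.pi_gt_three]

/-- On the horizontal sides `t = 2πt₀ ± 𝓛₁` (`v² = 𝓛₁²`), `½ ≤ σ ≤ 𝓛⁹ + ½`, the weight is
exponentially small: `|ω(σ+it)| = (√π/𝓛₂)exp{((σ−½)² − 𝓛₁²)/(4𝓛₂²)} ≤ 2e^{1/4}·exp(−𝓛¹⁰/4)`
(`𝓛₁ = 𝓛⁴⁰⁵`, `𝓛₂ = 𝓛⁴⁰⁰`, `D ≥ 3`). [cite: Zhang2022LandauSiegel, §7 (7.4) p.34; §2 (2.15)] -/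
theorem norm_omegaW_side_le {D : ℕ} (hD : 3 ≤ D) {u v : ℝ} (hu0 : 1 / 2 ≤ u)
    (hu1 : u ≤ Skeleton.ell D ^ 9 + 1 / 2) (hv : v ^ 2 = Skeleton.ell1 D ^ 2) :
    ‖Skeleton.omegaW D ((u : ℂ) + ((2 * π * Skeleton.t0 D + v : ℝ) : ℂ) * I)‖ ≤
      2 * Real.exp (1 / 4) * Real.exp (-(Skeleton.ell D ^ 10 / 4)) := by
  have hℓ : 1 ≤ Skeleton.ell D := one_le_ell hD
  have hL2 : 0 < Skeleton.ell2 D := by rw [Skeleton.ell2]; positivity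
  have hL2' : Skeleton.ell2 D = Skeleton.ell D ^ 400 := rfl
  have hL1' : Skeleton.ell1 D = Skeleton.ell D ^ 405 := rfl
  have hpt : (u : ℂ) + ((2 * π * Skeleton.t0 D + v : ℝ) : ℂ) * I =
      ((u - 1 / 2 : ℝ) : ℂ) + SmoothWeight.s0 (Skeleton.t0 D) + v * I := by
    rw [SmoothWeight.s0_def]; push_cast; ring
  rw [Skeleton.omegaW, hpt, SmoothWeight.norm_omega_segment_eq hL2]
  have h1 : Real.sqrt π / Skeleton.ell2 D ≤ 2 := by
    rw [div_le_iff₀ hL2]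
    have hs : Real.sqrt π ≤ 2 := by
      rw [Real.sqrt_le_left (by norm_num)]; linarith [Real.pi_le_four]
    have h400 : 1 ≤ Skeleton.ell2 D := by rw [hL2']; exact one_le_pow₀ hℓ
    nlinarith
  have h2 : ((u - 1 / 2) ^ 2 - v ^ 2) / (4 * Skeleton.ell2 D ^ 2) ≤
      1 / 4 + -(Skeleton.ell D ^ 10 / 4) := by
    rw [hv, hL1', hL2', div_le_iff₀ (by positivity)]
    have hsq : (u - 1 / 2) ^ 2 ≤ (Skeleton.ell D ^ 9) ^ 2 :=
      pow_le_pow_left₀ (by linarith) (by linarith) 2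
    have h18 : (Skeleton.ell D ^ 9) ^ 2 ≤ Skeleton.ell D ^ 800 := by
      rw [← pow_mul]; exact pow_le_pow_right₀ hℓ (by norm_num)
    have e1 : (Skeleton.ell D ^ 405) ^ 2 = Skeleton.ell D ^ 10 * Skeleton.ell D ^ 800 := by ring
    have e2 : (Skeleton.ell D ^ 400) ^ 2 = Skeleton.ell D ^ 800 := by ring
    rw [e1, e2]
    nlinarith [pow_nonneg (zero_le_one.trans hℓ) 800, pow_nonneg (zero_le_one.trans hℓ) 10]
  calc Real.sqrt π / Skeleton.ell2 D *
        Real.exp (((u - 1 / 2) ^ 2 - v ^ 2) / (4 * Skeleton.ell2 D ^ 2))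
      ≤ 2 * Real.exp (1 / 4 + -(Skeleton.ell D ^ 10 / 4)) :=
        mul_le_mul h1 (Real.exp_le_exp.mpr h2) (Real.exp_pos _).le (by norm_num)
    _ = 2 * Real.exp (1 / 4) * Real.exp (-(Skeleton.ell D ^ 10 / 4)) := by rw [Real.exp_add]; ring

/-- `τ_{j+1}(n) ≤ n^j` for `n ≥ 1` (crude: `#{d ∣ n} ≤ n`). [folklore] -/
private theorem tau_succ_le_pow (j : ℕ) {n : ℕ} (hn : n ≠ 0) :
    MeanSquareMajorant.tau (j + 1) n ≤ (n : ℝ) ^ j := by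
  induction j generalizing n with
  | zero => rw [MeanSquareMajorant.tau_one_apply hn, pow_zero]
  | succ j ih =>
    rw [MeanSquareMajorant.tau_succ_apply]
    calc ∑ d ∈ n.divisors, MeanSquareMajorant.tau (j + 1) d
        ≤ ∑ d ∈ n.divisors, (n : ℝ) ^ j := by
          refine Finset.sum_le_sum fun d hd => (ih (Nat.pos_of_mem_divisors hd).ne').trans ?_
          exact pow_le_pow_left₀ (Nat.cast_nonneg _) (Nat.cast_le.mpr (Nat.divisor_le hd)) j
      _ = (n.divisors.card : ℝ) * (n : ℝ) ^ j := by rw [Finset.sum_const, nsmul_eq_mul]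
      _ ≤ (n : ℝ) * (n : ℝ) ^ j := by
          gcongr; exact_mod_cast Nat.card_divisors_le_self n
      _ = (n : ℝ) ^ (j + 1) := by ring

/-- A crude bound for the head on `σ ≥ 0`: `|Σ_{m<P²} (κ∗a)(m)ψ(m)m^{−s}| ≤ B(P²+1)⁵`
(`|(κ∗a)(m)| ≤ Bτ₅(m) ≤ Bm⁴`, `|m^{−s}| ≤ 1`). [cite: Zhang2022LandauSiegel, §7 p.35, tex L1893] -/
theorem norm_kconvHead_le_crude (c' : ℝ) {D : ℕ} (x : Skeleton.Chr D) {B : ℝ} {a : ℕ → ℂ}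
    (ha : ∀ n, ‖a n‖ ≤ B) {s : ℂ} (hs : 0 ≤ s.re) :
    ‖kconvHead c' x a s‖ ≤ B * (Skeleton.bigP D ^ 2 + 1) ^ 5 := by
  have hB : 0 ≤ B := (norm_nonneg _).trans (ha 0)
  have hX : (⌈Skeleton.bigP D ^ 2⌉₊ : ℝ) ≤ Skeleton.bigP D ^ 2 + 1 :=
    (Nat.ceil_lt_add_one (by positivity)).le
  rw [kconvHead]
  calc ‖∑ m ∈ Finset.Ico 1 ⌈Skeleton.bigP D ^ 2⌉₊, kconv c' D a m * x.ψ m / (m : ℂ) ^ s‖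
      ≤ ∑ m ∈ Finset.Ico 1 ⌈Skeleton.bigP D ^ 2⌉₊, ‖kconv c' D a m * x.ψ m / (m : ℂ) ^ s‖ :=
        norm_sum_le _ _
    _ ≤ ∑ m ∈ Finset.Ico 1 ⌈Skeleton.bigP D ^ 2⌉₊, B * (⌈Skeleton.bigP D ^ 2⌉₊ : ℝ) ^ 4 := by
        refine Finset.sum_le_sum fun m hm => ?_
        have hm1 : 1 ≤ m := (Finset.mem_Ico.mp hm).1
        have hmX : m < ⌈Skeleton.bigP D ^ 2⌉₊ := (Finset.mem_Ico.mp hm).2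
        rw [norm_div, norm_mul]
        have h1 : ‖kconv c' D a m‖ ≤ B * MeanSquareMajorant.tau 5 m := norm_kconv_le_tau_five c' ha m
        have h2 : ‖x.ψ m‖ ≤ 1 := DirichletCharacter.norm_le_one _ _
        have h3 : 1 ≤ ‖(m : ℂ) ^ s‖ := by
          rw [Complex.norm_natCast_cpow_of_pos hm1]
          exact Real.one_le_rpow (by exact_mod_cast hm1) hs
        have h4 : MeanSquareMajorant.tau 5 m ≤ (⌈Skeleton.bigP D ^ 2⌉₊ : ℝ) ^ 4 :=
          (tau_succ_le_pow 4 (by omega)).trans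
            (pow_le_pow_left₀ (Nat.cast_nonneg _) (by exact_mod_cast hmX.le) 4)
        have h5 : 0 ≤ MeanSquareMajorant.tau 5 m := MeanSquareMajorant.tau_nonneg _ _
        calc ‖kconv c' D a m‖ * ‖x.ψ m‖ / ‖(m : ℂ) ^ s‖
            ≤ ‖kconv c' D a m‖ * ‖x.ψ m‖ := div_le_self (by positivity) h3
          _ ≤ B * MeanSquareMajorant.tau 5 m * 1 :=
              mul_le_mul h1 h2 (norm_nonneg _) (by positivity)
          _ ≤ B * (⌈Skeleton.bigP D ^ 2⌉₊ : ℝ) ^ 4 := by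
              rw [mul_one]; exact mul_le_mul_of_nonneg_left h4 hB
    _ = ((⌈Skeleton.bigP D ^ 2⌉₊ - 1 : ℕ) : ℝ) * (B * (⌈Skeleton.bigP D ^ 2⌉₊ : ℝ) ^ 4) := by
        rw [Finset.sum_const, Nat.card_Ico, nsmul_eq_mul]
    _ ≤ (⌈Skeleton.bigP D ^ 2⌉₊ : ℝ) * (B * (⌈Skeleton.bigP D ^ 2⌉₊ : ℝ) ^ 4) := by
        gcongr
        exact_mod_cast Nat.sub_le _ 1
    _ = B * (⌈Skeleton.bigP D ^ 2⌉₊ : ℝ) ^ 5 := by ring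
    _ ≤ B * (Skeleton.bigP D ^ 2 + 1) ^ 5 := by gcongr

/-- A crude bound for `A(𝐚;w,ψ̄)` on `Re w ≥ −1`: `|A(𝐚;w,ψ̄)| ≤ B·N²`, `N = ⌈PT⁻²⌉` the length in
(7.2) (`|a(n)| ≤ B`, `|n^{−w}| ≤ n ≤ N`). [cite: Zhang2022LandauSiegel, §7 (7.2) p.32] -/
theorem norm_ApolyBar_le_crude {D : ℕ} (x : Skeleton.Chr D) {B : ℝ} {a : ℕ → ℂ}
    (ha : ∀ n, ‖a n‖ ≤ B) {w : ℂ} (hw : -1 ≤ w.re) :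
    ‖Skeleton.ApolyBar x a w‖ ≤ B * (Skeleton.Nsupp D : ℝ) ^ 2 := by
  have hB : 0 ≤ B := (norm_nonneg _).trans (ha 0)
  rw [ApolyBar_eq]
  calc ‖∑ n ∈ Finset.range (Skeleton.Nsupp D), a n * x.ψ⁻¹ n * (n : ℂ) ^ (-w)‖
      ≤ ∑ n ∈ Finset.range (Skeleton.Nsupp D), ‖a n * x.ψ⁻¹ n * (n : ℂ) ^ (-w)‖ := norm_sum_le _ _
    _ ≤ ∑ n ∈ Finset.range (Skeleton.Nsupp D), B * (Skeleton.Nsupp D : ℝ) := by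
        refine Finset.sum_le_sum fun n hn => ?_
        have hnN : n < Skeleton.Nsupp D := Finset.mem_range.mp hn
        rcases Nat.eq_zero_or_pos n with rfl | hn0
        · have h0 : x.ψ⁻¹ ((0 : ℕ) : ZMod x.p) = 0 := by
            rw [Nat.cast_zero]; exact dirichletCharacter_apply_zero' _ x.p_ne_one
          rw [h0, mul_zero, zero_mul, norm_zero]; positivity
        · rw [norm_mul, norm_mul, Complex.norm_natCast_cpow_of_pos hn0, Complex.neg_re]
          have h1 : (n : ℝ) ^ (-w.re) ≤ (n : ℝ) ^ (1 : ℝ) :=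
            Real.rpow_le_rpow_of_exponent_le (by exact_mod_cast hn0) (by linarith)
          rw [Real.rpow_one] at h1
          have h2 : (n : ℝ) ≤ Skeleton.Nsupp D := by exact_mod_cast hnN.le
          calc ‖a n‖ * ‖x.ψ⁻¹ n‖ * (n : ℝ) ^ (-w.re) ≤ B * 1 * (Skeleton.Nsupp D : ℝ) :=
                mul_le_mul (mul_le_mul (ha n) (DirichletCharacter.norm_le_one _ _) (norm_nonneg _) hB)
                  (h1.trans h2) (Real.rpow_nonneg (Nat.cast_nonneg _) _) (by positivity)
            _ = B * Skeleton.Nsupp D := by ring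
    _ = (Skeleton.Nsupp D : ℝ) * (B * Skeleton.Nsupp D) := by
        rw [Finset.sum_const, Finset.card_range, nsmul_eq_mul]
    _ = B * (Skeleton.Nsupp D : ℝ) ^ 2 := by ring

/-- The size budget of the horizontal sides: for `𝓛 ≥ 4264`,
`P·t₀·(P²+1)⁵·(P+1)² ≤ exp(𝓛¹⁰/8)` (`P = e^{𝓛⁹}`, `t₀ = 𝓛⁵¹⁹`). [cite: Zhang2022LandauSiegel, §2 p.4–5] -/
private theorem side_budget {D : ℕ} (hℓ : 4264 ≤ Skeleton.ell D) :
    Skeleton.bigP D * Skeleton.t0 D * (Skeleton.bigP D ^ 2 + 1) ^ 5 * (Skeleton.bigP D + 1) ^ 2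
      ≤ Real.exp (Skeleton.ell D ^ 10 / 8) := by
  have hℓ1 : 1 ≤ Skeleton.ell D := by linarith
  have hP : Skeleton.bigP D = Real.exp (Skeleton.ell D ^ 9) := rfl
  have ht0 : Skeleton.t0 D = Skeleton.ell D ^ 519 := rfl
  have hP1 : 1 ≤ Skeleton.bigP D := by rw [hP]; exact Real.one_le_exp (by positivity)
  have h1 : Skeleton.bigP D ^ 2 + 1 ≤ 2 * Skeleton.bigP D ^ 2 := by nlinarith
  have h2 : Skeleton.bigP D + 1 ≤ 2 * Skeleton.bigP D := by linarith
  have hℓexp : Skeleton.ell D ≤ Real.exp (Skeleton.ell D) := by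
    linarith [Real.add_one_le_exp (Skeleton.ell D)]
  have hℓ9 : Skeleton.ell D ≤ Skeleton.ell D ^ 9 := le_self_pow₀ hℓ1 (by norm_num)
  have h3 : Skeleton.ell D ^ 519 ≤ Real.exp (519 * Skeleton.ell D ^ 9) := by
    calc Skeleton.ell D ^ 519 ≤ Real.exp (Skeleton.ell D) ^ 519 :=
          pow_le_pow_left₀ (by linarith) hℓexp 519
      _ = Real.exp (519 * Skeleton.ell D) := by rw [← Real.exp_nat_mul]; norm_num
      _ ≤ Real.exp (519 * Skeleton.ell D ^ 9) := Real.exp_le_exp.mpr (by linarith)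
  have h13 : Skeleton.bigP D ^ 13 = Real.exp (13 * Skeleton.ell D ^ 9) := by
    rw [hP, ← Real.exp_nat_mul]; norm_num
  have h128 : (128 : ℝ) ≤ Real.exp 5 := by
    have he : (2.7 : ℝ) ≤ Real.exp 1 := by linarith [Real.exp_one_gt_d9]
    have h5 : (2.7 : ℝ) ^ 5 ≤ Real.exp 1 ^ 5 := pow_le_pow_left₀ (by norm_num) he 5
    rw [← Real.exp_nat_mul] at h5
    norm_num at h5
    linarith
  have h10 : 4264 * Skeleton.ell D ^ 9 ≤ Skeleton.ell D ^ 10 := by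
    have := mul_le_mul_of_nonneg_right hℓ (by positivity : (0 : ℝ) ≤ Skeleton.ell D ^ 9)
    calc 4264 * Skeleton.ell D ^ 9 ≤ Skeleton.ell D * Skeleton.ell D ^ 9 := this
      _ = Skeleton.ell D ^ 10 := by ring
  calc Skeleton.bigP D * Skeleton.t0 D * (Skeleton.bigP D ^ 2 + 1) ^ 5 * (Skeleton.bigP D + 1) ^ 2
      ≤ Skeleton.bigP D * Real.exp (519 * Skeleton.ell D ^ 9) * (2 * Skeleton.bigP D ^ 2) ^ 5 *
          (2 * Skeleton.bigP D) ^ 2 := by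
        rw [ht0]; gcongr
    _ = 128 * (Real.exp (519 * Skeleton.ell D ^ 9) * Skeleton.bigP D ^ 13) := by ring
    _ = 128 * Real.exp (532 * Skeleton.ell D ^ 9) := by
        rw [h13, ← Real.exp_add]; ring_nf
    _ ≤ Real.exp 5 * Real.exp (532 * Skeleton.ell D ^ 9) := by gcongr
    _ = Real.exp (5 + 532 * Skeleton.ell D ^ 9) := by rw [Real.exp_add]
    _ ≤ Real.exp (Skeleton.ell D ^ 10 / 8) := Real.exp_le_exp.mpr (by nlinarith)

/-- **`Z22:§7.u018` HOLDS in the alternative reading `Step7u018b`** (p. 35, "To handle the sum over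
`m < P²` we move the path of integration to `𝔍(0)`. Hence …"): for every `B`, with `c = 1/8` and
`C = 8e^{13/4}B²`, for all large `D`, every `ψ ∈ Ψ` and all `𝐚₁, 𝐚₂` obeying (7.2),
`|∫_{𝔍(1)} Z(s,ψ)⁻¹(Σ_{m<P²}(κ∗a₁)(m)ψ(m)m^{−s})A(𝐚₂;1−s,ψ̄)ω(s) ds|
  ≤ ∫_{𝔍(0)} |Σ_{m<P²}(κ∗a₁)(m)ψ(m)m^{−s}|·|A(𝐚₂;1−s,ψ̄)ω(s) ds| + C·exp(−c𝓛¹⁰)`.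
Proof: Cauchy's theorem on the rectangle `½ ≤ σ ≤ 3/2`, `|t − 2πt₀| ≤ 𝓛₁` (the integrand is
holomorphic there: `Z(s,ψ) ≠ 0` for `t > 0`), `|Z(½+it,ψ)| = 1` on `𝔍(0)`, and on the horizontal
sides `|Z⁻¹| ≤ e³pt₀`, `|head| ≤ B(P²+1)⁵`, `|A| ≤ B(P+1)²`, `|ω| ≤ 2e^{1/4}e^{−𝓛¹⁰/4}`, while
`P·t₀·(P²+1)⁵(P+1)² ≤ e^{𝓛¹⁰/8}` for `𝓛 ≥ 4264`. Kernel-checked; 0 new facts.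
[cite: Zhang2022LandauSiegel, §7 p.35, tex L1893–1899] -/
theorem step7u018b_holds (c' : ℝ) : Step7u018b c' := by
  intro B
  obtain ⟨D₁, hD₁⟩ := Skeleton.exists_nat_forall_le_ell 4264
  refine ⟨1 / 8, by norm_num, 8 * Real.exp 3 * Real.exp (1 / 4) * B ^ 2, max 3 D₁,
    fun D _ χ hD _ _ x a₁ a₂ ha₁ ha₂ => ?_⟩
  have hD3 : 3 ≤ D := le_trans (le_max_left _ _) hD
  have hℓbig : 4264 ≤ Skeleton.ell D := hD₁ D (le_trans (le_max_right _ _) hD)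
  have hℓ : 1 ≤ Skeleton.ell D := one_le_ell hD3
  have hℓ9 : 1 ≤ Skeleton.ell D ^ 9 := one_le_pow₀ hℓ
  have hL0 : 0 ≤ Skeleton.ell1 D := by rw [Skeleton.ell1]; positivity
  have hside : 0 < 2 * π * Skeleton.t0 D - Skeleton.ell1 D := twoPiT0_sub_ell1_pos hD3
  have hP0 : 0 < Skeleton.bigP D := Skeleton.bigP_pos D
  have hB : 0 ≤ B := (norm_nonneg _).trans (ha₁.1 0)
  have ht01 : 1 ≤ Skeleton.t0 D := by rw [Skeleton.t0]; exact one_le_pow₀ hℓ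
  have hT1 : 1 ≤ Skeleton.bigT D := by rw [Skeleton.bigT]; exact Real.one_le_exp (by positivity)
  have hN : (Skeleton.Nsupp D : ℝ) ≤ Skeleton.bigP D + 1 := by
    rw [Skeleton.Nsupp]
    have h1 : (⌈Skeleton.bigP D / Skeleton.bigT D ^ 2⌉₊ : ℝ) ≤
        Skeleton.bigP D / Skeleton.bigT D ^ 2 + 1 := (Nat.ceil_lt_add_one (by positivity)).le
    have h2 : Skeleton.bigP D / Skeleton.bigT D ^ 2 ≤ Skeleton.bigP D :=
      div_le_self hP0.le (one_le_pow₀ hT1)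
    linarith
  have hp2P : (x.p : ℝ) ≤ 2 * Skeleton.bigP D := Skeleton.le_two_mul_bigP_of_mem_primeWindow hℓ x.mem
  have hpt1 : 1 ≤ (x.p : ℝ) * Skeleton.t0 D := by
    have hp2 : (2 : ℝ) ≤ x.p := by exact_mod_cast x.prime.two_le
    nlinarith
  -- the integrand and its holomorphy on the closed rectangle `½ ≤ σ ≤ 3/2`, `|t − 2πt₀| ≤ 𝓛₁`
  set F : ℂ → ℂ := fun s => (GammaFactor.Zfac x.ψ s)⁻¹ * kconvHead c' x a₁ s *
    Skeleton.ApolyBar x a₂ (1 - s) * Skeleton.omegaW D s with hF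
  have hdiff : DifferentiableOn ℂ F (Set.uIcc (1 / 2 + (0 : ℝ)) (1 / 2 + 1) ×ℂ
      Set.uIcc (2 * π * Skeleton.t0 D - Skeleton.ell1 D) (2 * π * Skeleton.t0 D + Skeleton.ell1 D)) := by
    intro s hs
    have him : 0 < s.im := by
      have h := (Complex.mem_reProdIm.mp hs).2
      rw [Set.uIcc_of_le (by linarith)] at h
      linarith [h.1]
    exact ((((differentiableAt_Zfac_inv x him).mul ((differentiable_kconvHead c' x a₁) s)).mul
      ((differentiable_ApolyBar_one_sub x a₂) s)).mul
        ((differentiable_omegaW D) s)).differentiableWithinAt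
  -- Step 1: on `𝔍(0)`, `|Z(s,ψ)⁻¹| = 1`
  have h0 : ‖intJ D 0 F‖ ≤ absIntJ D 0 (fun s => kconvHead c' x a₁ s *
      (Skeleton.ApolyBar x a₂ (1 - s) * Skeleton.omegaW D s)) := by
    refine (norm_intJ_le_absIntJ D hL0 0 F).trans (le_of_eq ?_)
    rw [absIntJ, absIntJ]
    refine intervalIntegral.integral_congr fun v hv => ?_
    have hv' : -Skeleton.ell1 D ≤ v := by
      rw [Set.uIcc_of_le (by linarith)] at hv; exact hv.1
    have hpt : ((0 : ℝ) : ℂ) + Skeleton.s0 D + v * I =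
        1 / 2 + ((2 * π * Skeleton.t0 D + v : ℝ) : ℂ) * I := by
      rw [Skeleton.s0, SmoothWeight.s0_def]; push_cast; ring
    have hZ : ‖(GammaFactor.Zfac x.ψ (((0 : ℝ) : ℂ) + Skeleton.s0 D + v * I))⁻¹‖ = 1 := by
      rw [hpt, norm_inv, GammaFactor.norm_Zfac_half_eq_one x.prim (by linarith), inv_one]
    show ‖F _‖ = _
    simp only [hF, norm_mul, hZ, one_mul, mul_assoc]
  -- Step 2: the horizontal sides `t = 2πt₀ + v`, `v = ±𝓛₁`, `½ ≤ σ ≤ 3/2`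
  set M : ℝ := Real.exp 3 * (2 * Skeleton.bigP D * Skeleton.t0 D) *
    (B * (Skeleton.bigP D ^ 2 + 1) ^ 5) * (B * (Skeleton.bigP D + 1) ^ 2) *
    (2 * Real.exp (1 / 4) * Real.exp (-(Skeleton.ell D ^ 10 / 4))) with hMdef
  have hM : ∀ u ∈ Set.Icc (1 / 2 + (0 : ℝ)) (1 / 2 + 1), ∀ v : ℝ, v ^ 2 = Skeleton.ell1 D ^ 2 →
      ‖F ((u : ℂ) + ((2 * π * Skeleton.t0 D + v : ℝ) : ℂ) * I)‖ ≤ M := by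
    intro u hu v hv
    have hu0 : 1 / 2 ≤ u := by linarith [hu.1]
    have hu1 : u ≤ 3 / 2 := by linarith [hu.2]
    have habs : |v| = Skeleton.ell1 D := by
      have h := (sq_eq_sq_iff_abs_eq_abs v (Skeleton.ell1 D)).mp hv
      rwa [abs_of_nonneg hL0] at h
    have hsre : ((u : ℂ) + ((2 * π * Skeleton.t0 D + v : ℝ) : ℂ) * I).re = u := by simp
    have hsim : ((u : ℂ) + ((2 * π * Skeleton.t0 D + v : ℝ) : ℂ) * I).im =
        2 * π * Skeleton.t0 D + v := by simp
    -- `|Z⁻¹| ≤ e³·pt₀ ≤ e³·2Pt₀`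
    have hZ : ‖(GammaFactor.Zfac x.ψ ((u : ℂ) + ((2 * π * Skeleton.t0 D + v : ℝ) : ℂ) * I))⁻¹‖ ≤
        Real.exp 3 * (2 * Skeleton.bigP D * Skeleton.t0 D) := by
      have h := norm_Zfac_inv_le hD3 x (s := (u : ℂ) + ((2 * π * Skeleton.t0 D + v : ℝ) : ℂ) * I)
        (by rw [hsre]; exact hu0) (by rw [hsre]; linarith)
        (by rw [hsim, show 2 * π * Skeleton.t0 D + v - 2 * π * Skeleton.t0 D = v by ring, habs])
      rw [hsre] at h
      refine h.trans (mul_le_mul_of_nonneg_left ?_ (Real.exp_pos 3).le)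
      calc ((x.p : ℝ) * Skeleton.t0 D) ^ (u - 1 / 2) ≤ ((x.p : ℝ) * Skeleton.t0 D) ^ (1 : ℝ) :=
            Real.rpow_le_rpow_of_exponent_le hpt1 (by linarith)
        _ = (x.p : ℝ) * Skeleton.t0 D := Real.rpow_one _
        _ ≤ 2 * Skeleton.bigP D * Skeleton.t0 D :=
            mul_le_mul_of_nonneg_right hp2P (zero_le_one.trans ht01)
    have hH : ‖kconvHead c' x a₁ ((u : ℂ) + ((2 * π * Skeleton.t0 D + v : ℝ) : ℂ) * I)‖ ≤
        B * (Skeleton.bigP D ^ 2 + 1) ^ 5 :=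
      norm_kconvHead_le_crude c' x ha₁.1 (by rw [hsre]; linarith)
    have hA : ‖Skeleton.ApolyBar x a₂ (1 - ((u : ℂ) + ((2 * π * Skeleton.t0 D + v : ℝ) : ℂ) * I))‖ ≤
        B * (Skeleton.bigP D + 1) ^ 2 := by
      refine (norm_ApolyBar_le_crude x ha₂.1 (by rw [Complex.sub_re, hsre, Complex.one_re]; linarith)).trans ?_
      exact mul_le_mul_of_nonneg_left (pow_le_pow_left₀ (Nat.cast_nonneg _) hN 2) hB
    have hω : ‖Skeleton.omegaW D ((u : ℂ) + ((2 * π * Skeleton.t0 D + v : ℝ) : ℂ) * I)‖ ≤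
        2 * Real.exp (1 / 4) * Real.exp (-(Skeleton.ell D ^ 10 / 4)) :=
      norm_omegaW_side_le hD3 hu0 (by linarith) hv
    have hK0 : 0 ≤ Real.exp 3 * (2 * Skeleton.bigP D * Skeleton.t0 D) :=
      mul_nonneg (Real.exp_pos 3).le
        (mul_nonneg (mul_nonneg zero_le_two hP0.le) (zero_le_one.trans ht01))
    have hK1 : 0 ≤ B * (Skeleton.bigP D ^ 2 + 1) ^ 5 := mul_nonneg hB (by positivity)
    have hK2 : 0 ≤ B * (Skeleton.bigP D + 1) ^ 2 := mul_nonneg hB (by positivity)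
    have e1 := mul_le_mul hZ hH (norm_nonneg _) hK0
    have e2 := mul_le_mul e1 hA (norm_nonneg _) (mul_nonneg hK0 hK1)
    have e3 := mul_le_mul e2 hω (norm_nonneg _) (mul_nonneg (mul_nonneg hK0 hK1) hK2)
    show ‖F _‖ ≤ M
    simp only [hF, norm_mul, hMdef]
    exact e3
  -- Step 3: Cauchy's theorem between `𝔍(0)` and `𝔍(1)`
  have hshift : ‖intJ D 1 F - intJ D 0 F‖ ≤ (1 - 0) * (M + M) := by
    refine norm_intJ_sub_intJ_le D (by norm_num) hdiff (fun u hu => hM u hu _ rfl) fun u hu => ?_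
    have e : (2 * π * Skeleton.t0 D - Skeleton.ell1 D : ℝ) =
        2 * π * Skeleton.t0 D + -Skeleton.ell1 D := by ring
    rw [e]
    exact hM u hu _ (by ring)
  have hbud := side_budget hℓbig
  have h2M : (1 - 0) * (M + M) ≤
      8 * Real.exp 3 * Real.exp (1 / 4) * B ^ 2 * Real.exp (-(1 / 8) * Skeleton.ell D ^ 10) := by
    have e : (1 - 0) * (M + M) = 8 * Real.exp 3 * Real.exp (1 / 4) * B ^ 2 *
        ((Skeleton.bigP D * Skeleton.t0 D * (Skeleton.bigP D ^ 2 + 1) ^ 5 *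
          (Skeleton.bigP D + 1) ^ 2) * Real.exp (-(Skeleton.ell D ^ 10 / 4))) := by
      rw [hMdef]; ring
    have e2 : Real.exp (-(1 / 8) * Skeleton.ell D ^ 10) =
        Real.exp (Skeleton.ell D ^ 10 / 8) * Real.exp (-(Skeleton.ell D ^ 10 / 4)) := by
      rw [← Real.exp_add]; ring_nf
    rw [e, e2]
    gcongr
  calc ‖intJ D 1 F‖ = ‖intJ D 0 F + (intJ D 1 F - intJ D 0 F)‖ := by rw [add_sub_cancel]
    _ ≤ ‖intJ D 0 F‖ + ‖intJ D 1 F - intJ D 0 F‖ := norm_add_le _ _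
    _ ≤ absIntJ D 0 (fun s => kconvHead c' x a₁ s *
          (Skeleton.ApolyBar x a₂ (1 - s) * Skeleton.omegaW D s)) +
        8 * Real.exp 3 * Real.exp (1 / 4) * B ^ 2 * Real.exp (-(1 / 8) * Skeleton.ell D ^ 10) :=
        add_le_add h0 (hshift.trans h2M)

variable (c' : ℝ) in
/-- `Step7u018b` — `_holds` alias of `step7u018b_holds` above under the fact's exact name, stated under the
prover's own binders as section variables (appended 2026-08-28, D-0026 bookkeeping: the proof term is the
existing theorem of this file; no statement, definition or attribute is edited; no new named fact; the
ledger's debt table listed the fact unproved). [cite: Zhang2022LandauSiegel, §7 p.35, tex L1893–1899] -/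
theorem _root_.Literature.NumberTheory.LFunctions.Zhang2022.Section7aStatements.Step7u018b_holds :
    _root_.Literature.NumberTheory.LFunctions.Zhang2022.Section7aStatements.Step7u018b c' :=
  _root_.Literature.NumberTheory.LFunctions.Zhang2022.Section7aStatements.step7u018b_holds (c' := c')

end MoveToCriticalLine

/-! ## `Z22:§7.u017`: the tail `m ≥ P²` on `𝔍(1)` is negligible (move the segment to `𝔍(𝓛⁹)`) -/

section MoveToFarLine

open Set MeasureTheory intervalIntegral Filter Topology

/-- The tail `Σ_{m≥P²} (κ∗a)(m)ψ(m)m^{−s}` is holomorphic on `σ > 5/4` (locally uniform absolute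
convergence: `|(κ∗a)(m)ψ(m)m^{−s}| ≤ Bτ₅(m)m^{−5/4}`, `Σ τ₅(m)m^{−5/4} = ζ(5/4)⁵ < ∞`).
[cite: Zhang2022LandauSiegel, §7 p.34, tex L1878] -/
theorem differentiableOn_kconvTail (c' : ℝ) {D : ℕ} (x : Skeleton.Chr D) {B : ℝ} {a : ℕ → ℂ}
    (ha : ∀ n, ‖a n‖ ≤ B) : DifferentiableOn ℂ (kconvTail c' x a) {s : ℂ | 5 / 4 < s.re} := by
  have hB : 0 ≤ B := (norm_nonneg _).trans (ha 0)
  obtain ⟨hsum, -⟩ := tsum_tau_five_rpow_le (σ₀ := 5 / 4) (by norm_num)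
  have hU : IsOpen {s : ℂ | 5 / 4 < s.re} := isOpen_lt continuous_const Complex.continuous_re
  unfold kconvTail
  refine differentiableOn_tsum_of_summable_norm (hsum.mul_left B) (fun m => ?_) hU
    (fun m s hs => ?_)
  · by_cases hm : Skeleton.bigP D ^ 2 ≤ (m : ℝ)
    · simp only [hm, if_true]
      have hm0 : (0 : ℝ) < m := lt_of_lt_of_le (pow_pos (Skeleton.bigP_pos D) 2) hm
      have hm1 : (m : ℂ) ≠ 0 := Nat.cast_ne_zero.mpr (by exact_mod_cast hm0.ne')
      exact ((differentiable_const _).div (differentiable_id.const_cpow (Or.inl hm1))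
        fun s h0 => hm1 ((Complex.cpow_eq_zero_iff _ _).mp h0).1).differentiableOn
    · simp only [hm, if_false]
      exact differentiableOn_const 0
  · have hs' : 5 / 4 < s.re := hs
    by_cases hm : Skeleton.bigP D ^ 2 ≤ (m : ℝ)
    · simp only [hm, if_true]
      have hm0 : (0 : ℝ) < m := lt_of_lt_of_le (pow_pos (Skeleton.bigP_pos D) 2) hm
      have hm0' : 0 < m := by exact_mod_cast hm0
      rw [norm_div, norm_mul, Complex.norm_natCast_cpow_of_pos hm0', div_eq_mul_inv,
        ← Real.rpow_neg hm0.le]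
      have h1 : ‖kconv c' D a m‖ * ‖x.ψ (m : ZMod x.p)‖ ≤ B * MeanSquareMajorant.tau 5 m := by
        calc ‖kconv c' D a m‖ * ‖x.ψ (m : ZMod x.p)‖ ≤ B * MeanSquareMajorant.tau 5 m * 1 :=
              mul_le_mul (norm_kconv_le_tau_five c' ha m) (x.ψ.norm_le_one _) (norm_nonneg _)
                (mul_nonneg hB (MeanSquareMajorant.tau_nonneg 5 m))
          _ = B * MeanSquareMajorant.tau 5 m := mul_one _
      have h2 : (m : ℝ) ^ (-s.re) ≤ (m : ℝ) ^ (-(5 / 4 : ℝ)) :=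
        Real.rpow_le_rpow_of_exponent_le (by exact_mod_cast hm0') (by linarith)
      calc ‖kconv c' D a m‖ * ‖x.ψ (m : ZMod x.p)‖ * (m : ℝ) ^ (-s.re)
          ≤ B * MeanSquareMajorant.tau 5 m * (m : ℝ) ^ (-(5 / 4 : ℝ)) :=
            mul_le_mul h1 h2 (Real.rpow_nonneg hm0.le _)
              (mul_nonneg hB (MeanSquareMajorant.tau_nonneg 5 m))
        _ = B * (MeanSquareMajorant.tau 5 m * (m : ℝ) ^ (-(5 / 4 : ℝ))) := by ring
    · simp only [hm, if_false, norm_zero]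
      exact mul_nonneg hB (mul_nonneg (MeanSquareMajorant.tau_nonneg 5 m)
        (Real.rpow_nonneg (Nat.cast_nonneg m) _))

/-- `|ω(σ+it)| ≤ 2e^{1/4}` for `½ ≤ σ ≤ 𝓛⁹ + ½` and every real `t` (`D ≥ 3`):
`|ω| = (√π/𝓛₂)exp{((σ−½)² − (t−2πt₀)²)/(4𝓛₂²)}`, `(σ−½)² ≤ 𝓛¹⁸ ≤ 𝓛₂²`.
[cite: Zhang2022LandauSiegel, §7 (7.4) p.34; §2 (2.15)] -/
theorem norm_omegaW_le_two_exp {D : ℕ} (hD : 3 ≤ D) {u : ℝ} (hu0 : 1 / 2 ≤ u)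
    (hu1 : u ≤ Skeleton.ell D ^ 9 + 1 / 2) (t : ℝ) :
    ‖Skeleton.omegaW D ((u : ℂ) + (t : ℂ) * I)‖ ≤ 2 * Real.exp (1 / 4) := by
  have hℓ : 1 ≤ Skeleton.ell D := one_le_ell hD
  have hL2 : 0 < Skeleton.ell2 D := by rw [Skeleton.ell2]; positivity
  have hL2' : Skeleton.ell2 D = Skeleton.ell D ^ 400 := rfl
  have hpt : (u : ℂ) + (t : ℂ) * I = ((u - 1 / 2 : ℝ) : ℂ) + SmoothWeight.s0 (Skeleton.t0 D) +
      ((t - 2 * π * Skeleton.t0 D : ℝ) : ℂ) * I := by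
    rw [SmoothWeight.s0_def]; push_cast; ring
  rw [Skeleton.omegaW, hpt, SmoothWeight.norm_omega_segment_eq hL2]
  have h1 : Real.sqrt π / Skeleton.ell2 D ≤ 2 := by
    rw [div_le_iff₀ hL2]
    have hs : Real.sqrt π ≤ 2 := by
      rw [Real.sqrt_le_left (by norm_num)]; linarith [Real.pi_le_four]
    have h400 : 1 ≤ Skeleton.ell2 D := by rw [hL2']; exact one_le_pow₀ hℓ
    nlinarith
  have h2 : ((u - 1 / 2) ^ 2 - (t - 2 * π * Skeleton.t0 D) ^ 2) / (4 * Skeleton.ell2 D ^ 2) ≤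
      1 / 4 := by
    rw [hL2', div_le_iff₀ (by positivity)]
    have hsq : (u - 1 / 2) ^ 2 ≤ (Skeleton.ell D ^ 9) ^ 2 :=
      pow_le_pow_left₀ (by linarith) (by linarith) 2
    have h18 : (Skeleton.ell D ^ 9) ^ 2 ≤ Skeleton.ell D ^ 800 := by
      rw [← pow_mul]; exact pow_le_pow_right₀ hℓ (by norm_num)
    have e2 : (Skeleton.ell D ^ 400) ^ 2 = Skeleton.ell D ^ 800 := by ring
    rw [e2]
    nlinarith [sq_nonneg (t - 2 * π * Skeleton.t0 D)]
  calc Real.sqrt π / Skeleton.ell2 D *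
        Real.exp (((u - 1 / 2) ^ 2 - (t - 2 * π * Skeleton.t0 D) ^ 2) / (4 * Skeleton.ell2 D ^ 2))
      ≤ 2 * Real.exp (1 / 4) :=
        mul_le_mul h1 (Real.exp_le_exp.mpr h2) (Real.exp_pos _).le (by norm_num)

/-- `log 2 + 519 log 𝓛 ≤ 𝓛` once `𝓛 ≥ 5000` (`log 𝓛 ≤ 𝓛/e⁸ + 7`). [folklore] -/
private theorem log_two_add_log_ell_le {D : ℕ} (hℓ : 5000 ≤ Skeleton.ell D) :
    Real.log 2 + 519 * Real.log (Skeleton.ell D) ≤ Skeleton.ell D := by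
  have hℓ0 : 0 < Skeleton.ell D := by linarith
  have h := Real.log_le_sub_one_of_pos (x := Skeleton.ell D / Real.exp 8) (by positivity)
  rw [Real.log_div hℓ0.ne' (Real.exp_pos 8).ne', Real.log_exp] at h
  have he8 : (2900 : ℝ) ≤ Real.exp 8 := by
    have h8 : (2.7182818283 : ℝ) ^ 8 ≤ Real.exp 1 ^ 8 :=
      pow_le_pow_left₀ (by norm_num) Real.exp_one_gt_d9.le 8
    rw [← Real.exp_nat_mul] at h8
    norm_num at h8
    linarith
  have hdiv : Skeleton.ell D / Real.exp 8 ≤ Skeleton.ell D / 2900 :=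
    div_le_div_of_nonneg_left hℓ0.le (by norm_num) he8
  have h2 := Real.log_two_lt_d9
  linarith

/-- `2t₀ ≤ e^{𝓛}` once `𝓛 ≥ 5000` (`t₀ = 𝓛⁵¹⁹`). [folklore] -/
private theorem two_t0_le_exp_ell {D : ℕ} (hℓ : 5000 ≤ Skeleton.ell D) :
    2 * Skeleton.t0 D ≤ Real.exp (Skeleton.ell D) := by
  have hℓ0 : 0 < Skeleton.ell D := by linarith
  have ht0 : 0 < 2 * Skeleton.t0 D := by rw [Skeleton.t0]; positivity
  rw [← Real.exp_log ht0, Real.exp_le_exp, Real.log_mul two_ne_zero (by rw [Skeleton.t0]; positivity),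
    Skeleton.t0, Real.log_pow]
  push_cast
  exact log_two_add_log_ell_le hℓ

/-- **The trivial bounds combined along the contour** (`σ ≥ 3/2`, `𝓛 ≥ 5000`): the powers in
`|Z(s,ψ)⁻¹|·|Σ_{m≥P²}…|·|A(𝐚₂;1−s,ψ̄)| ≪ (pt₀)^{σ−½}·P^{2(1−σ)}·(PT⁻²)^σ` satisfy
`(pt₀)^{σ−½}P^{2(1−σ)}(PT⁻²)^σ ≤ exp(3𝓛⁹/2 − (σ−½)𝓛)` (`p ≤ 2P`, `2t₀ ≤ e^{𝓛}`, `T ≥ e^{𝓛}`):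
this is what makes the far segment `𝔍(𝓛⁹)` negligible. [cite: Zhang2022LandauSiegel, §7 p.34–35, tex L1878–1890] -/
theorem boundary_powers_le {D : ℕ} (hℓ : 5000 ≤ Skeleton.ell D) (x : Skeleton.Chr D) {σ : ℝ}
    (hσ : 3 / 2 ≤ σ) :
    ((x.p : ℝ) * Skeleton.t0 D) ^ (σ - 1 / 2) *
        (Skeleton.bigP D ^ (2 * (1 - σ)) * (Skeleton.bigP D / Skeleton.bigT D ^ 2) ^ σ) ≤
      Real.exp (3 / 2 * Skeleton.ell D ^ 9 - (σ - 1 / 2) * Skeleton.ell D) := by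
  have hℓ1 : 1 ≤ Skeleton.ell D := by linarith
  have hP0 : 0 < Skeleton.bigP D := Skeleton.bigP_pos D
  have hT0 : 0 < Skeleton.bigT D := by rw [Skeleton.bigT]; exact Real.exp_pos _
  have hp0 : (0 : ℝ) < x.p := by exact_mod_cast x.prime.pos
  have ht00 : 0 < Skeleton.t0 D := by rw [Skeleton.t0]; positivity
  have hX0 : 0 < (x.p : ℝ) * Skeleton.t0 D := mul_pos hp0 ht00
  have hPT0 : 0 < Skeleton.bigP D / Skeleton.bigT D ^ 2 := by positivity
  have hlogP : Real.log (Skeleton.bigP D) = Skeleton.ell D ^ 9 := by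
    rw [Skeleton.bigP, Real.log_exp]
  have hlogT : Real.log (Skeleton.bigT D) = Skeleton.ell D ^ (1.1 : ℝ) := by
    rw [Skeleton.bigT, Real.log_exp]
  have hlogPT : Real.log (Skeleton.bigP D / Skeleton.bigT D ^ 2) =
      Skeleton.ell D ^ 9 - 2 * Skeleton.ell D ^ (1.1 : ℝ) := by
    rw [Real.log_div hP0.ne' (pow_pos hT0 2).ne', Real.log_pow, hlogP, hlogT]; push_cast; ring
  -- `log(pt₀) ≤ 𝓛⁹ + 𝓛`
  have hp2P : (x.p : ℝ) ≤ 2 * Skeleton.bigP D := Skeleton.le_two_mul_bigP_of_mem_primeWindow hℓ1 x.mem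
  have hlogX : Real.log ((x.p : ℝ) * Skeleton.t0 D) ≤ Skeleton.ell D ^ 9 + Skeleton.ell D := by
    have h1 : (x.p : ℝ) * Skeleton.t0 D ≤ Skeleton.bigP D * Real.exp (Skeleton.ell D) := by
      calc (x.p : ℝ) * Skeleton.t0 D ≤ 2 * Skeleton.bigP D * Skeleton.t0 D :=
            mul_le_mul_of_nonneg_right hp2P ht00.le
        _ = Skeleton.bigP D * (2 * Skeleton.t0 D) := by ring
        _ ≤ Skeleton.bigP D * Real.exp (Skeleton.ell D) :=
            mul_le_mul_of_nonneg_left (two_t0_le_exp_ell hℓ) hP0.le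
    calc Real.log ((x.p : ℝ) * Skeleton.t0 D)
        ≤ Real.log (Skeleton.bigP D * Real.exp (Skeleton.ell D)) := Real.log_le_log hX0 h1
      _ = Skeleton.ell D ^ 9 + Skeleton.ell D := by
          rw [Real.log_mul hP0.ne' (Real.exp_pos _).ne', hlogP, Real.log_exp]
  -- `𝓛 ≤ 𝓛^{1.1}`
  have hℓ11 : Skeleton.ell D ≤ Skeleton.ell D ^ (1.1 : ℝ) := by
    have h := Real.rpow_le_rpow_of_exponent_le hℓ1 (show (1 : ℝ) ≤ 1.1 by norm_num)
    rwa [Real.rpow_one] at h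
  -- take logarithms
  have hpos : 0 < ((x.p : ℝ) * Skeleton.t0 D) ^ (σ - 1 / 2) *
      (Skeleton.bigP D ^ (2 * (1 - σ)) * (Skeleton.bigP D / Skeleton.bigT D ^ 2) ^ σ) := by
    positivity
  rw [← Real.log_le_iff_le_exp hpos, Real.log_mul (Real.rpow_pos_of_pos hX0 _).ne'
    (mul_pos (Real.rpow_pos_of_pos hP0 _) (Real.rpow_pos_of_pos hPT0 _)).ne',
    Real.log_mul (Real.rpow_pos_of_pos hP0 _).ne' (Real.rpow_pos_of_pos hPT0 _).ne',
    Real.log_rpow hX0, Real.log_rpow hP0, Real.log_rpow hPT0, hlogP, hlogPT]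
  have hσ0 : 0 ≤ σ - 1 / 2 := by linarith
  have hA1 := mul_le_mul_of_nonneg_left hlogX hσ0
  have hA2 := mul_le_mul_of_nonneg_left hℓ11 (by linarith : (0 : ℝ) ≤ σ)
  nlinarith

/-- The size budget along the contour of `Z22:§7.u017`: for `c ≥ 0` and `𝓛 ≥ 8(c + 407)`
(`𝓛 ≥ 1`), `𝓛ᶜ·𝓛⁴⁰⁵·e^{3𝓛⁹/2} ≤ e^{𝓛¹⁰/8}`. [cite: Zhang2022LandauSiegel, §2 p.4–5] -/
private theorem far_budget {D : ℕ} {c : ℝ} (hc : 0 ≤ c) (hℓ1 : 1 ≤ Skeleton.ell D)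
    (hℓ : 8 * (c + 407) ≤ Skeleton.ell D) :
    Skeleton.ell D ^ c * Skeleton.ell D ^ 405 * Real.exp (3 / 2 * Skeleton.ell D ^ 9) ≤
      Real.exp (Skeleton.ell D ^ 10 / 8) := by
  have hℓ0 : 0 ≤ Skeleton.ell D := by linarith
  have hℓexp : Skeleton.ell D ≤ Real.exp (Skeleton.ell D) := by
    linarith [Real.add_one_le_exp (Skeleton.ell D)]
  have hℓ9 : Skeleton.ell D ≤ Skeleton.ell D ^ 9 := le_self_pow₀ hℓ1 (by norm_num)
  have h1 : Skeleton.ell D ^ c ≤ Real.exp (c * Skeleton.ell D ^ 9) := by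
    calc Skeleton.ell D ^ c ≤ Real.exp (Skeleton.ell D) ^ c := Real.rpow_le_rpow hℓ0 hℓexp hc
      _ = Real.exp (Skeleton.ell D * c) := (Real.exp_mul _ _).symm
      _ ≤ Real.exp (c * Skeleton.ell D ^ 9) := Real.exp_le_exp.mpr (by nlinarith)
  have h2 : Skeleton.ell D ^ 405 ≤ Real.exp (405 * Skeleton.ell D ^ 9) := by
    calc Skeleton.ell D ^ 405 ≤ Real.exp (Skeleton.ell D) ^ 405 := pow_le_pow_left₀ hℓ0 hℓexp 405
      _ = Real.exp (405 * Skeleton.ell D) := by rw [← Real.exp_nat_mul]; norm_num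
      _ ≤ Real.exp (405 * Skeleton.ell D ^ 9) := Real.exp_le_exp.mpr (by linarith)
  have h10 : 8 * (c + 407) * Skeleton.ell D ^ 9 ≤ Skeleton.ell D ^ 10 := by
    have := mul_le_mul_of_nonneg_right hℓ (by positivity : (0 : ℝ) ≤ Skeleton.ell D ^ 9)
    calc 8 * (c + 407) * Skeleton.ell D ^ 9 ≤ Skeleton.ell D * Skeleton.ell D ^ 9 := this
      _ = Skeleton.ell D ^ 10 := by ring
  calc Skeleton.ell D ^ c * Skeleton.ell D ^ 405 * Real.exp (3 / 2 * Skeleton.ell D ^ 9)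
      ≤ Real.exp (c * Skeleton.ell D ^ 9) * Real.exp (405 * Skeleton.ell D ^ 9) *
          Real.exp (3 / 2 * Skeleton.ell D ^ 9) := by gcongr
    _ = Real.exp ((c + 405 + 3 / 2) * Skeleton.ell D ^ 9) := by
        rw [← Real.exp_add, ← Real.exp_add]; ring_nf
    _ ≤ Real.exp (Skeleton.ell D ^ 10 / 8) := Real.exp_le_exp.mpr (by nlinarith)

end MoveToFarLine

section MoveToFarLineMain

open Set MeasureTheory intervalIntegral Filter Topology

/-- **`Z22:§7.u017` HOLDS** (p. 35, "Thus, moving the segment to `𝔍(𝓛⁹)` and applying … (7.4) we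
obtain"): for every `B`, with `c = 1/8` and some `C = C(B, c′)`, for all large `D`, every `ψ ∈ Ψ`
and all `𝐚₁, 𝐚₂` obeying (7.2),
`|∫_{𝔍(1)} Z(s,ψ)⁻¹ (Σ_{m≥P²} (κ∗a₁)(m)ψ(m)m^{−s}) A(𝐚₂;1−s,ψ̄)ω(s) ds| ≤ C·exp(−c𝓛¹⁰)`.
Proof, following the text: Cauchy's theorem on the rectangle `3/2 ≤ σ ≤ 𝓛⁹ + ½`,
`|t − 2πt₀| ≤ 𝓛₁` (the tail is holomorphic on `σ > 5/4`, `Z(s,ψ) ≠ 0` for `t > 0`); on its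
boundary the trivial bounds `Z22:§7.u015` (`step7u015_holds`) and `Z22:§7.u016`
(`norm_Zfac_inv_le`) give `|Z⁻¹·tail·A| ≤ e³C₁₅²𝓛^{c₁₅}·(pt₀)^{σ−½}P^{2(1−σ)}(PT⁻²)^σ
≤ K·exp(3𝓛⁹/2 − (σ−½)𝓛)` (`boundary_powers_le`: `p ≤ 2P`, `2t₀ ≤ e^{𝓛} ≤ T`), which is
`≤ K e^{3𝓛⁹/2 − 𝓛¹⁰}` on `𝔍(𝓛⁹)` (where `|ω| ≤ 2e^{1/4}`, length `2𝓛₁`) and `≤ K e^{3𝓛⁹/2}` on the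
horizontal sides (where `|ω| ≤ 2e^{1/4}e^{−𝓛¹⁰/4}`, (7.4)); finally
`𝓛^{c}𝓛⁴⁰⁵e^{3𝓛⁹/2} ≤ e^{𝓛¹⁰/8}` for `𝓛 ≥ 8(c + 407)`. Kernel-checked; 0 new facts.
[cite: Zhang2022LandauSiegel, §7 p.35, tex L1886–1891] -/
theorem step7u017_holds (c' : ℝ) : Step7u017 c' := by
  intro B
  obtain ⟨c₁₅, C₁₅, D₁₅, h15⟩ := step7u015_holds c' B
  obtain ⟨D₁, hD₁⟩ := Skeleton.exists_nat_forall_le_ell (max 5000 (8 * (max c₁₅ 0 + 407)))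
  refine ⟨1 / 8, by norm_num, 8 * Real.exp 3 * Real.exp (1 / 4) * C₁₅ ^ 2, max (max 3 D₁₅) D₁,
    fun D _ χ hD hq hprim x a₁ a₂ ha₁ ha₂ => ?_⟩
  have hD3 : 3 ≤ D := le_trans (le_trans (le_max_left _ _) (le_max_left _ _)) hD
  have hD15 : D₁₅ ≤ D := le_trans (le_trans (le_max_right _ _) (le_max_left _ _)) hD
  have hℓD₁ := hD₁ D (le_trans (le_max_right _ _) hD)
  have hℓ5000 : 5000 ≤ Skeleton.ell D := le_trans (le_max_left _ _) hℓD₁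
  have hℓc : 8 * (max c₁₅ 0 + 407) ≤ Skeleton.ell D := le_trans (le_max_right _ _) hℓD₁
  have hcp : 0 ≤ max c₁₅ 0 := le_max_right _ _
  have hℓ : 1 ≤ Skeleton.ell D := one_le_ell hD3
  have hℓ0 : 0 ≤ Skeleton.ell D := zero_le_one.trans hℓ
  have hℓ9 : 1 ≤ Skeleton.ell D ^ 9 := one_le_pow₀ hℓ
  have hL0 : 0 ≤ Skeleton.ell1 D := by rw [Skeleton.ell1]; positivity
  have hL1 : Skeleton.ell1 D = Skeleton.ell D ^ 405 := rfl
  have hside : 0 < 2 * π * Skeleton.t0 D - Skeleton.ell1 D := twoPiT0_sub_ell1_pos hD3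
  have hP0 : 0 < Skeleton.bigP D := Skeleton.bigP_pos D
  have hT0 : 0 < Skeleton.bigT D := by rw [Skeleton.bigT]; exact Real.exp_pos _
  have hPT0 : 0 < Skeleton.bigP D / Skeleton.bigT D ^ 2 := div_pos hP0 (pow_pos hT0 2)
  have hp0 : (0 : ℝ) < x.p := by exact_mod_cast x.prime.pos
  have ht00 : 0 < Skeleton.t0 D := by rw [Skeleton.t0]; positivity
  have hX0 : 0 < (x.p : ℝ) * Skeleton.t0 D := mul_pos hp0 ht00
  have h15D := h15 D χ hD15 hq hprim x a₁ a₂ ha₁ ha₂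
  -- the integrand
  set G : ℂ → ℂ := fun s => (GammaFactor.Zfac x.ψ s)⁻¹ * kconvTail c' x a₁ s *
    Skeleton.ApolyBar x a₂ (1 - s) * Skeleton.omegaW D s with hG
  -- the constant in front of the boundary bound
  set K : ℝ := Real.exp 3 * C₁₅ ^ 2 * Skeleton.ell D ^ (max c₁₅ 0) with hKdef
  have hK0 : 0 ≤ K :=
    mul_nonneg (mul_nonneg (Real.exp_pos 3).le (sq_nonneg _)) (Real.rpow_nonneg hℓ0 _)
  -- the core bound along the contour: `|Z⁻¹·tail·A| ≤ K·exp(3𝓛⁹/2 − (σ−½)𝓛)`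
  have hcore : ∀ s : ℂ, 3 / 2 ≤ s.re → s.re ≤ Skeleton.ell D ^ 9 + 1 / 2 →
      |s.im - 2 * π * Skeleton.t0 D| ≤ Skeleton.ell1 D →
      ‖(GammaFactor.Zfac x.ψ s)⁻¹ * kconvTail c' x a₁ s * Skeleton.ApolyBar x a₂ (1 - s)‖ ≤
        K * Real.exp (3 / 2 * Skeleton.ell D ^ 9 - (s.re - 1 / 2) * Skeleton.ell D) := by
    intro s hσ1 hσ2 ht
    obtain ⟨hT, hA⟩ := h15D s hσ1
    have hZ := norm_Zfac_inv_le hD3 x (by linarith) hσ2 ht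
    have hXpos : 0 < Skeleton.bigP D ^ (2 * (1 - s.re)) * Skeleton.ell D ^ c₁₅ :=
      mul_pos (Real.rpow_pos_of_pos hP0 _) (Real.rpow_pos_of_pos (by linarith) _)
    have hC : 0 ≤ C₁₅ := by
      have h := (norm_nonneg _).trans hT
      rw [mul_assoc] at h
      exact (mul_nonneg_iff_of_pos_right hXpos).mp h
    have hℓc' : Skeleton.ell D ^ c₁₅ ≤ Skeleton.ell D ^ (max c₁₅ 0) :=
      Real.rpow_le_rpow_of_exponent_le hℓ (le_max_left _ _)
    have hT' : ‖kconvTail c' x a₁ s‖ ≤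
        C₁₅ * Skeleton.ell D ^ (max c₁₅ 0) * Skeleton.bigP D ^ (2 * (1 - s.re)) := by
      calc ‖kconvTail c' x a₁ s‖
          ≤ C₁₅ * Skeleton.bigP D ^ (2 * (1 - s.re)) * Skeleton.ell D ^ c₁₅ := hT
        _ ≤ C₁₅ * Skeleton.bigP D ^ (2 * (1 - s.re)) * Skeleton.ell D ^ (max c₁₅ 0) :=
            mul_le_mul_of_nonneg_left hℓc' (mul_nonneg hC (Real.rpow_nonneg hP0.le _))
        _ = C₁₅ * Skeleton.ell D ^ (max c₁₅ 0) * Skeleton.bigP D ^ (2 * (1 - s.re)) := by ring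
    have hpow := boundary_powers_le hℓ5000 x hσ1
    have hn1 : 0 ≤ Real.exp 3 * ((x.p : ℝ) * Skeleton.t0 D) ^ (s.re - 1 / 2) :=
      mul_nonneg (Real.exp_pos 3).le (Real.rpow_nonneg hX0.le _)
    have hn2 : 0 ≤ C₁₅ * Skeleton.ell D ^ (max c₁₅ 0) * Skeleton.bigP D ^ (2 * (1 - s.re)) :=
      mul_nonneg (mul_nonneg hC (Real.rpow_nonneg hℓ0 _)) (Real.rpow_nonneg hP0.le _)
    have e1 := mul_le_mul hZ hT' (norm_nonneg _) hn1
    have e2 := mul_le_mul e1 hA (norm_nonneg _) (mul_nonneg hn1 hn2)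
    rw [norm_mul, norm_mul]
    calc ‖(GammaFactor.Zfac x.ψ s)⁻¹‖ * ‖kconvTail c' x a₁ s‖ * ‖Skeleton.ApolyBar x a₂ (1 - s)‖
        ≤ Real.exp 3 * ((x.p : ℝ) * Skeleton.t0 D) ^ (s.re - 1 / 2) *
            (C₁₅ * Skeleton.ell D ^ (max c₁₅ 0) * Skeleton.bigP D ^ (2 * (1 - s.re))) *
            (C₁₅ * (Skeleton.bigP D / Skeleton.bigT D ^ 2) ^ s.re) := e2
      _ = K * (((x.p : ℝ) * Skeleton.t0 D) ^ (s.re - 1 / 2) *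
            (Skeleton.bigP D ^ (2 * (1 - s.re)) * (Skeleton.bigP D / Skeleton.bigT D ^ 2) ^ s.re)) := by
          rw [hKdef]; ring
      _ ≤ K * Real.exp (3 / 2 * Skeleton.ell D ^ 9 - (s.re - 1 / 2) * Skeleton.ell D) :=
          mul_le_mul_of_nonneg_left hpow hK0
  -- holomorphy on the closed rectangle `3/2 ≤ σ ≤ 𝓛⁹ + ½`, `|t − 2πt₀| ≤ 𝓛₁`
  have hU : IsOpen {s : ℂ | 5 / 4 < s.re} := isOpen_lt continuous_const Complex.continuous_re
  have htailOn := differentiableOn_kconvTail c' x ha₁.1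
  have hdiff : DifferentiableOn ℂ G (Set.uIcc (1 / 2 + (1 : ℝ)) (1 / 2 + Skeleton.ell D ^ 9) ×ℂ
      Set.uIcc (2 * π * Skeleton.t0 D - Skeleton.ell1 D)
        (2 * π * Skeleton.t0 D + Skeleton.ell1 D)) := by
    intro s hs
    have hre : 3 / 2 ≤ s.re := by
      have h := (Complex.mem_reProdIm.mp hs).1
      rw [Set.uIcc_of_le (by linarith)] at h
      linarith [h.1]
    have him : 0 < s.im := by
      have h := (Complex.mem_reProdIm.mp hs).2
      rw [Set.uIcc_of_le (by linarith)] at h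
      linarith [h.1]
    have hsU : s ∈ {s : ℂ | 5 / 4 < s.re} := by
      show 5 / 4 < s.re
      linarith
    have htail : DifferentiableAt ℂ (kconvTail c' x a₁) s :=
      htailOn.differentiableAt (hU.mem_nhds hsU)
    exact ((((differentiableAt_Zfac_inv x him).mul htail).mul
      ((differentiable_ApolyBar_one_sub x a₂) s)).mul
        ((differentiable_omegaW D) s)).differentiableWithinAt
  -- the far segment `𝔍(𝓛⁹)`
  have hfar : ‖intJ D (Skeleton.ell D ^ 9) G‖ ≤
      K * Real.exp (3 / 2 * Skeleton.ell D ^ 9 - Skeleton.ell D ^ 9 * Skeleton.ell D) *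
        (2 * Real.exp (1 / 4)) * (2 * Skeleton.ell1 D) := by
    rw [intJ_eq_I_mul, norm_mul, Complex.norm_I, one_mul]
    have h := intervalIntegral.norm_integral_le_of_norm_le_const
      (a := 2 * π * Skeleton.t0 D - Skeleton.ell1 D) (b := 2 * π * Skeleton.t0 D + Skeleton.ell1 D)
      (f := fun y : ℝ => G (((1 / 2 + Skeleton.ell D ^ 9 : ℝ) : ℂ) + y * I))
      (C := K * Real.exp (3 / 2 * Skeleton.ell D ^ 9 - Skeleton.ell D ^ 9 * Skeleton.ell D) *
        (2 * Real.exp (1 / 4))) (fun y hy => ?_)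
    · have e : |2 * π * Skeleton.t0 D + Skeleton.ell1 D - (2 * π * Skeleton.t0 D - Skeleton.ell1 D)| =
          2 * Skeleton.ell1 D := by
        rw [abs_of_nonneg (by linarith)]; ring
      rw [e] at h
      exact h
    · rw [Set.uIoc_of_le (by linarith)] at hy
      have hsre : ((((1 / 2 + Skeleton.ell D ^ 9 : ℝ) : ℂ) + y * I)).re =
          1 / 2 + Skeleton.ell D ^ 9 := by
        simp only [Complex.add_re, Complex.ofReal_re, Complex.mul_re, Complex.I_re, Complex.I_im,
          Complex.ofReal_im, mul_zero, zero_mul, sub_zero, add_zero]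
      have hsim : ((((1 / 2 + Skeleton.ell D ^ 9 : ℝ) : ℂ) + y * I)).im = y := by
        simp only [Complex.add_im, Complex.ofReal_im, Complex.mul_im, Complex.I_re, Complex.I_im,
          Complex.ofReal_re, mul_zero, mul_one, add_zero, zero_add]
      have h1 := hcore (((1 / 2 + Skeleton.ell D ^ 9 : ℝ) : ℂ) + y * I) (by rw [hsre]; linarith)
        (by rw [hsre]; linarith)
        (by rw [hsim]; exact abs_le.mpr ⟨by linarith [hy.1], by linarith [hy.2]⟩)
      rw [hsre, show 1 / 2 + Skeleton.ell D ^ 9 - 1 / 2 = Skeleton.ell D ^ 9 by ring] at h1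
      have h2 : ‖Skeleton.omegaW D (((1 / 2 + Skeleton.ell D ^ 9 : ℝ) : ℂ) + y * I)‖ ≤
          2 * Real.exp (1 / 4) :=
        norm_omegaW_le_two_exp hD3 (by linarith) (by linarith) y
      show ‖(GammaFactor.Zfac x.ψ _)⁻¹ * kconvTail c' x a₁ _ * Skeleton.ApolyBar x a₂ (1 - _) *
        Skeleton.omegaW D _‖ ≤ _
      rw [norm_mul]
      exact mul_le_mul h1 h2 (norm_nonneg _) (mul_nonneg hK0 (Real.exp_pos _).le)
  -- the horizontal sides
  set Mside : ℝ := K * Real.exp (3 / 2 * Skeleton.ell D ^ 9) *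
    (2 * Real.exp (1 / 4) * Real.exp (-(Skeleton.ell D ^ 10 / 4))) with hMside
  have hMside0 : 0 ≤ Mside := by rw [hMside]; positivity
  have hM : ∀ u ∈ Set.Icc (1 / 2 + (1 : ℝ)) (1 / 2 + Skeleton.ell D ^ 9), ∀ v : ℝ,
      v ^ 2 = Skeleton.ell1 D ^ 2 →
      ‖G ((u : ℂ) + ((2 * π * Skeleton.t0 D + v : ℝ) : ℂ) * I)‖ ≤ Mside := by
    intro u hu v hv
    have hu0 : 3 / 2 ≤ u := by linarith [hu.1]
    have hu1 : u ≤ Skeleton.ell D ^ 9 + 1 / 2 := by linarith [hu.2]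
    have habs : |v| = Skeleton.ell1 D := by
      have h := (sq_eq_sq_iff_abs_eq_abs v (Skeleton.ell1 D)).mp hv
      rwa [abs_of_nonneg hL0] at h
    have hsre : ((u : ℂ) + ((2 * π * Skeleton.t0 D + v : ℝ) : ℂ) * I).re = u := by simp
    have hsim : ((u : ℂ) + ((2 * π * Skeleton.t0 D + v : ℝ) : ℂ) * I).im =
        2 * π * Skeleton.t0 D + v := by simp
    have h1 := hcore ((u : ℂ) + ((2 * π * Skeleton.t0 D + v : ℝ) : ℂ) * I)
      (by rw [hsre]; exact hu0) (by rw [hsre]; exact hu1)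
      (by rw [hsim, show 2 * π * Skeleton.t0 D + v - 2 * π * Skeleton.t0 D = v by ring, habs])
    rw [hsre] at h1
    have h1' : ‖(GammaFactor.Zfac x.ψ ((u : ℂ) + ((2 * π * Skeleton.t0 D + v : ℝ) : ℂ) * I))⁻¹ *
        kconvTail c' x a₁ ((u : ℂ) + ((2 * π * Skeleton.t0 D + v : ℝ) : ℂ) * I) *
        Skeleton.ApolyBar x a₂ (1 - ((u : ℂ) + ((2 * π * Skeleton.t0 D + v : ℝ) : ℂ) * I))‖ ≤
        K * Real.exp (3 / 2 * Skeleton.ell D ^ 9) := by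
      refine h1.trans (mul_le_mul_of_nonneg_left (Real.exp_le_exp.mpr ?_) hK0)
      nlinarith [mul_nonneg (by linarith : (0 : ℝ) ≤ u - 1 / 2) hℓ0]
    have h2 := norm_omegaW_side_le hD3 (by linarith) hu1 hv
    show ‖(GammaFactor.Zfac x.ψ _)⁻¹ * kconvTail c' x a₁ _ * Skeleton.ApolyBar x a₂ (1 - _) *
      Skeleton.omegaW D _‖ ≤ _
    rw [norm_mul, hMside]
    exact mul_le_mul h1' h2 (norm_nonneg _) (mul_nonneg hK0 (Real.exp_pos _).le)
  -- Cauchy's theorem between `𝔍(1)` and `𝔍(𝓛⁹)`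
  have hshift : ‖intJ D (Skeleton.ell D ^ 9) G - intJ D 1 G‖ ≤
      (Skeleton.ell D ^ 9 - 1) * (Mside + Mside) := by
    refine norm_intJ_sub_intJ_le D hℓ9 hdiff (fun u hu => hM u hu _ rfl) fun u hu => ?_
    have e : (2 * π * Skeleton.t0 D - Skeleton.ell1 D : ℝ) =
        2 * π * Skeleton.t0 D + -Skeleton.ell1 D := by ring
    rw [e]
    exact hM u hu _ (by ring)
  -- bookkeeping
  have hexp1 : Real.exp (3 / 2 * Skeleton.ell D ^ 9 - Skeleton.ell D ^ 9 * Skeleton.ell D) ≤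
      Real.exp (3 / 2 * Skeleton.ell D ^ 9) * Real.exp (-(Skeleton.ell D ^ 10 / 4)) := by
    rw [← Real.exp_add]
    refine Real.exp_le_exp.mpr ?_
    have h10 : Skeleton.ell D ^ 9 * Skeleton.ell D = Skeleton.ell D ^ 10 := by ring
    rw [h10]
    nlinarith [pow_nonneg hℓ0 10]
  have hℓ9le : Skeleton.ell D ^ 9 - 1 ≤ Skeleton.ell D ^ 405 := by
    have := pow_le_pow_right₀ hℓ (show 9 ≤ 405 by norm_num); linarith
  have hW0 : 0 ≤ 2 * Real.exp (1 / 4) := by positivity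
  have hfar' : ‖intJ D (Skeleton.ell D ^ 9) G‖ ≤
      K * (Real.exp (3 / 2 * Skeleton.ell D ^ 9) * Real.exp (-(Skeleton.ell D ^ 10 / 4))) *
        (2 * Real.exp (1 / 4)) * (2 * Skeleton.ell1 D) :=
    hfar.trans (mul_le_mul_of_nonneg_right (mul_le_mul_of_nonneg_right
      (mul_le_mul_of_nonneg_left hexp1 hK0) hW0) (by linarith))
  have hshift' : ‖intJ D (Skeleton.ell D ^ 9) G - intJ D 1 G‖ ≤
      Skeleton.ell D ^ 405 * (Mside + Mside) :=
    hshift.trans (mul_le_mul_of_nonneg_right hℓ9le (by linarith))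
  have hbud := far_budget hcp hℓ hℓc
  calc ‖intJ D 1 G‖
      = ‖intJ D (Skeleton.ell D ^ 9) G - (intJ D (Skeleton.ell D ^ 9) G - intJ D 1 G)‖ := by
        rw [sub_sub_cancel]
    _ ≤ ‖intJ D (Skeleton.ell D ^ 9) G‖ + ‖intJ D (Skeleton.ell D ^ 9) G - intJ D 1 G‖ :=
        norm_sub_le _ _
    _ ≤ K * (Real.exp (3 / 2 * Skeleton.ell D ^ 9) * Real.exp (-(Skeleton.ell D ^ 10 / 4))) *
          (2 * Real.exp (1 / 4)) * (2 * Skeleton.ell1 D) +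
        Skeleton.ell D ^ 405 * (Mside + Mside) := add_le_add hfar' hshift'
    _ = 8 * Real.exp 3 * Real.exp (1 / 4) * C₁₅ ^ 2 *
          (Skeleton.ell D ^ (max c₁₅ 0) * Skeleton.ell D ^ 405 *
            Real.exp (3 / 2 * Skeleton.ell D ^ 9)) * Real.exp (-(Skeleton.ell D ^ 10 / 4)) := by
        rw [hMside, hKdef, hL1]; ring
    _ ≤ 8 * Real.exp 3 * Real.exp (1 / 4) * C₁₅ ^ 2 * Real.exp (Skeleton.ell D ^ 10 / 8) *
          Real.exp (-(Skeleton.ell D ^ 10 / 4)) := by gcongr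
    _ = 8 * Real.exp 3 * Real.exp (1 / 4) * C₁₅ ^ 2 * Real.exp (-(1 / 8) * Skeleton.ell D ^ 10) := by
        rw [mul_assoc, ← Real.exp_add]; ring_nf

variable (c' : ℝ) in
/-- `Step7u017` — `_holds` alias of `step7u017_holds` above under the fact's exact name, stated under the
prover's own binders as section variables (appended 2026-08-28, D-0026 bookkeeping: the proof term is the
existing theorem of this file; no statement, definition or attribute is edited; no new named fact; the
ledger's debt table listed the fact unproved). [cite: Zhang2022LandauSiegel, §7 p.35, tex L1886–1891] -/
theorem _root_.Literature.NumberTheory.LFunctions.Zhang2022.Section7aStatements.Step7u017_holds :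
    _root_.Literature.NumberTheory.LFunctions.Zhang2022.Section7aStatements.Step7u017 c' :=
  _root_.Literature.NumberTheory.LFunctions.Zhang2022.Section7aStatements.step7u017_holds (c' := c')

end MoveToFarLineMain

/-! ## `Z22:§7.u018` (principal reading): `frakcW·A = −i(pt₀)^{β₃}Z⁻¹(head + tail)` on `𝔍(1)`, then u017 + u018b -/

section MoveAssembled

open Set MeasureTheory intervalIntegral Filter Topology

/-- The split "according to `m < P²` and `m ≥ P²`" (p. 34, tex L1877): for `σ > 1`,
`Σ_m (κ∗a)(m)ψ(m)m^{−s} = Σ_{m<P²} … + Σ_{m≥P²} …` (both pieces converge absolutely,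
`|(κ∗a)(m)| ≤ Bτ₅(m)`). [cite: Zhang2022LandauSiegel, §7 p.34, tex L1877] -/
theorem kconvSeries_eq_head_add_tail (c' : ℝ) {D : ℕ} (x : Skeleton.Chr D) {B : ℝ} {a : ℕ → ℂ}
    (ha : ∀ n, ‖a n‖ ≤ B) {s : ℂ} (hs : 1 < s.re) :
    kconvSeries c' x a s = kconvHead c' x a s + kconvTail c' x a s := by
  have hB : 0 ≤ B := (norm_nonneg _).trans (ha 0)
  have hP2 : 0 < Skeleton.bigP D ^ 2 := pow_pos (Skeleton.bigP_pos D) 2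
  -- pointwise split of the terms
  have hterm : ∀ m : ℕ, LSeries.term (fun m => kconv c' D a m * x.ψ m) s m =
      (if m ∈ Finset.Ico 1 ⌈Skeleton.bigP D ^ 2⌉₊ then kconv c' D a m * x.ψ m / (m : ℂ) ^ s else 0) +
      (if Skeleton.bigP D ^ 2 ≤ (m : ℝ) then kconv c' D a m * x.ψ m / (m : ℂ) ^ s else 0) := by
    intro m
    rcases Nat.eq_zero_or_pos m with rfl | hm
    · have h1 : (0 : ℕ) ∉ Finset.Ico 1 ⌈Skeleton.bigP D ^ 2⌉₊ := by simp
      have h2 : ¬ (Skeleton.bigP D ^ 2 ≤ ((0 : ℕ) : ℝ)) := by push_cast; linarith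
      rw [LSeries.term_zero, if_neg h1, if_neg h2, add_zero]
    · rw [LSeries.term_of_ne_zero hm.ne']
      by_cases hlt : (m : ℝ) < Skeleton.bigP D ^ 2
      · have h1 : m ∈ Finset.Ico 1 ⌈Skeleton.bigP D ^ 2⌉₊ :=
          Finset.mem_Ico.mpr ⟨hm, Nat.lt_ceil.mpr hlt⟩
        rw [if_pos h1, if_neg (not_le.mpr hlt), add_zero]
      · have h1 : m ∉ Finset.Ico 1 ⌈Skeleton.bigP D ^ 2⌉₊ :=
          fun h => hlt (Nat.lt_ceil.mp (Finset.mem_Ico.mp h).2)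
        rw [if_neg h1, if_pos (not_lt.mp hlt), zero_add]
  -- summability of the two pieces
  have hsum1 : Summable fun m : ℕ =>
      (if m ∈ Finset.Ico 1 ⌈Skeleton.bigP D ^ 2⌉₊ then kconv c' D a m * x.ψ m / (m : ℂ) ^ s else 0) :=
    summable_of_ne_finset_zero (s := Finset.Ico 1 ⌈Skeleton.bigP D ^ 2⌉₊) fun m hm => if_neg hm
  obtain ⟨hsumT, -⟩ := tsum_tau_five_rpow_le hs
  have hf : ∀ m : ℕ,
      ‖(if Skeleton.bigP D ^ 2 ≤ (m : ℝ) then kconv c' D a m * x.ψ m / (m : ℂ) ^ s else 0)‖ ≤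
        B * (MeanSquareMajorant.tau 5 m * (m : ℝ) ^ (-s.re)) := by
    intro m
    split_ifs with hm
    · have hm0 : (0 : ℝ) < m := lt_of_lt_of_le hP2 hm
      have hm0' : 0 < m := by exact_mod_cast hm0
      rw [norm_div, norm_mul, Complex.norm_natCast_cpow_of_pos hm0', div_eq_mul_inv,
        ← Real.rpow_neg hm0.le]
      calc ‖kconv c' D a m‖ * ‖x.ψ (m : ZMod x.p)‖ * (m : ℝ) ^ (-s.re)
          ≤ B * MeanSquareMajorant.tau 5 m * 1 * (m : ℝ) ^ (-s.re) :=
            mul_le_mul_of_nonneg_right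
              (mul_le_mul (norm_kconv_le_tau_five c' ha m) (x.ψ.norm_le_one _) (norm_nonneg _)
                (mul_nonneg hB (MeanSquareMajorant.tau_nonneg 5 m)))
              (Real.rpow_nonneg hm0.le _)
        _ = B * (MeanSquareMajorant.tau 5 m * (m : ℝ) ^ (-s.re)) := by ring
    · rw [norm_zero]
      exact mul_nonneg hB (mul_nonneg (MeanSquareMajorant.tau_nonneg 5 m)
        (Real.rpow_nonneg (Nat.cast_nonneg m) _))
  have hsum2 : Summable fun m : ℕ =>
      (if Skeleton.bigP D ^ 2 ≤ (m : ℝ) then kconv c' D a m * x.ψ m / (m : ℂ) ^ s else 0) :=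
    (Summable.of_nonneg_of_le (fun _ => norm_nonneg _) hf (hsumT.mul_left B)).of_norm
  unfold kconvSeries LSeries kconvHead kconvTail
  rw [show (fun m => LSeries.term (fun m => kconv c' D a m * x.ψ m) s m) = fun m =>
      (if m ∈ Finset.Ico 1 ⌈Skeleton.bigP D ^ 2⌉₊ then kconv c' D a m * x.ψ m / (m : ℂ) ^ s else 0) +
      (if Skeleton.bigP D ^ 2 ≤ (m : ℝ) then kconv c' D a m * x.ψ m / (m : ℂ) ^ s else 0)
      from funext hterm, hsum1.tsum_add hsum2]
  congr 1
  rw [tsum_eq_sum (s := Finset.Ico 1 ⌈Skeleton.bigP D ^ 2⌉₊) fun m hm => if_neg hm]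
  exact Finset.sum_congr rfl fun m hm => if_pos hm

/-- `|(pt₀)^{β₃}| = 1` (`β₃ = ib₃` is purely imaginary, (2.13)). [cite: Zhang2022LandauSiegel, §2 (2.13)] -/
theorem norm_pt0_cpow_beta3_eq_one (c' : ℝ) {D : ℕ} (x : Skeleton.Chr D) (hD : 3 ≤ D) :
    ‖(((x.p : ℝ) * Skeleton.t0 D : ℝ) : ℂ) ^ Skeleton.beta3 c' D‖ = 1 := by
  have hp0 : (0 : ℝ) < x.p := by exact_mod_cast x.prime.pos
  have ht0 : 0 < Skeleton.t0 D := by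
    rw [Skeleton.t0]; exact pow_pos (lt_of_lt_of_le zero_lt_one (one_le_ell hD)) _
  rw [Complex.norm_cpow_eq_rpow_re_of_pos (mul_pos hp0 ht0), Skeleton.beta3_eq_mul_I]
  simp

/-- **`Z22:§7.u018` HOLDS in the principal reading `Step7u018`** (p. 35): for every `B`, some
`c > 0`, `C`, all large `D`, every `ψ ∈ Ψ` and all `𝐚₁, 𝐚₂` obeying (7.2),
`|∫_{𝔍(1)} 𝒞(s,ψ)A(𝐚₁;s,ψ)A(𝐚₂;1−s,ψ̄)ω(s) ds|
  ≤ ∫_{𝔍(0)} |Σ_{m<P²}(κ∗a₁)(m)ψ(m)m^{−s}||A(𝐚₂;1−s,ψ̄)ω(s) ds| + C·exp(−c𝓛¹⁰)`.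
Proof = the text's chain: on `𝔍(1)`, `𝒞(s,ψ)A(𝐚₁;s,ψ) = −i(pt₀)^{β₃}Z(s,ψ)⁻¹Σ_m(κ∗a₁)(m)ψ(m)m^{−s}`
(`Z22:§7.u014`, `step7u014_holds`), the series splits at `P²` (`kconvSeries_eq_head_add_tail`),
`|−i(pt₀)^{β₃}| = 1`; the tail integral is `≪ ε` (`Z22:§7.u017`, `step7u017_holds`) and the head
integral is moved to `𝔍(0)` (`step7u018b_holds`). Kernel-checked; 0 new facts.
[cite: Zhang2022LandauSiegel, §7 p.35, tex L1886–1899] -/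
theorem step7u018_holds (c' : ℝ) : Step7u018 c' := by
  intro B
  obtain ⟨c₁, hc₁, C₁, D₁, h18b⟩ := step7u018b_holds c' B
  obtain ⟨c₂, hc₂, C₂, D₂, h17⟩ := step7u017_holds c' B
  refine ⟨min c₁ c₂, lt_min hc₁ hc₂, max C₁ 0 + max C₂ 0, max (max D₁ D₂) 3,
    fun D _ χ hD hq hprim x a₁ a₂ ha₁ ha₂ => ?_⟩
  have hD3 : 3 ≤ D := le_trans (le_max_right _ _) hD
  have hD1 : D₁ ≤ D := le_trans (le_trans (le_max_left _ _) (le_max_left _ _)) hD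
  have hD2 : D₂ ≤ D := le_trans (le_trans (le_max_right _ _) (le_max_left _ _)) hD
  have hb := h18b D χ hD1 hq hprim x a₁ a₂ ha₁ ha₂
  have ht := h17 D χ hD2 hq hprim x a₁ a₂ ha₁ ha₂
  have hℓ : 1 ≤ Skeleton.ell D := one_le_ell hD3
  have hℓ9 : 1 ≤ Skeleton.ell D ^ 9 := one_le_pow₀ hℓ
  have hL0 : 0 ≤ Skeleton.ell1 D := by rw [Skeleton.ell1]; positivity
  have hside : 0 < 2 * π * Skeleton.t0 D - Skeleton.ell1 D := twoPiT0_sub_ell1_pos hD3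
  set Fh : ℂ → ℂ := fun s => (GammaFactor.Zfac x.ψ s)⁻¹ * kconvHead c' x a₁ s *
    Skeleton.ApolyBar x a₂ (1 - s) * Skeleton.omegaW D s with hFh
  set Ft : ℂ → ℂ := fun s => (GammaFactor.Zfac x.ψ s)⁻¹ * kconvTail c' x a₁ s *
    Skeleton.ApolyBar x a₂ (1 - s) * Skeleton.omegaW D s with hFt
  set u : ℂ := -I * (((x.p : ℝ) * Skeleton.t0 D : ℝ) : ℂ) ^ Skeleton.beta3 c' D with hu
  have hu1 : ‖u‖ = 1 := by
    rw [hu, norm_mul, norm_neg, Complex.norm_I, one_mul, norm_pt0_cpow_beta3_eq_one c' x hD3]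
  -- the path `s = 1 + s₀ + iv` of `𝔍(1)`
  have hre : ∀ v : ℝ, (((1 : ℝ) : ℂ) + SmoothWeight.s0 (Skeleton.t0 D) + v * I).re = 3 / 2 := by
    intro v; rw [SmoothWeight.s0_def]; simp; norm_num
  have him : ∀ v : ℝ, (((1 : ℝ) : ℂ) + SmoothWeight.s0 (Skeleton.t0 D) + v * I).im =
      2 * π * Skeleton.t0 D + v := by
    intro v; rw [SmoothWeight.s0_def]; simp
  have hpath : Continuous fun v : ℝ => ((1 : ℝ) : ℂ) + SmoothWeight.s0 (Skeleton.t0 D) + v * I := by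
    fun_prop
  have hU : IsOpen {s : ℂ | 5 / 4 < s.re} := isOpen_lt continuous_const Complex.continuous_re
  have htailOn := differentiableOn_kconvTail c' x ha₁.1
  -- the pointwise identity on `𝔍(1)`
  have hsplit : ∀ v ∈ Set.uIcc (-Skeleton.ell1 D) (Skeleton.ell1 D),
      mvIntegrand c' x a₁ a₂ (((1 : ℝ) : ℂ) + SmoothWeight.s0 (Skeleton.t0 D) + v * I) =
        u * (Fh (((1 : ℝ) : ℂ) + SmoothWeight.s0 (Skeleton.t0 D) + v * I) +
          Ft (((1 : ℝ) : ℂ) + SmoothWeight.s0 (Skeleton.t0 D) + v * I)) := by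
    intro v hv
    rw [Set.uIcc_of_le (by linarith)] at hv
    have hmem : ((1 : ℝ) : ℂ) + SmoothWeight.s0 (Skeleton.t0 D) + v * I ∈ segJ D 1 := by
      refine ⟨by rw [hre]; norm_num, ?_⟩
      rw [him, show 2 * π * Skeleton.t0 D + v - 2 * π * Skeleton.t0 D = v by ring]
      exact abs_le.mpr ⟨hv.1, hv.2⟩
    have h14 := step7u014_holds c' D x B a₁ ha₁ _ hmem
    have hser := kconvSeries_eq_head_add_tail c' x ha₁.1
      (s := ((1 : ℝ) : ℂ) + SmoothWeight.s0 (Skeleton.t0 D) + v * I) (by rw [hre]; norm_num)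
    show Skeleton.frakcW c' x _ * Skeleton.Apoly x a₁ _ * Skeleton.ApolyBar x a₂ (1 - _) *
        Skeleton.omegaW D _ = _
    rw [h14, hser, hFh, hFt, hu]
    ring
  -- integrability of the two pieces along `𝔍(1)` (continuity)
  have hIh : IntervalIntegrable (fun v : ℝ => Fh (((1 : ℝ) : ℂ) + SmoothWeight.s0 (Skeleton.t0 D) +
      v * I)) MeasureTheory.volume (-Skeleton.ell1 D) (Skeleton.ell1 D) := by
    refine ContinuousOn.intervalIntegrable ?_
    rw [Set.uIcc_of_le (by linarith)]
    intro v hv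
    have himv : 0 < (((1 : ℝ) : ℂ) + SmoothWeight.s0 (Skeleton.t0 D) + v * I).im := by
      rw [him]; linarith [hv.1]
    have hdAt : DifferentiableAt ℂ Fh (((1 : ℝ) : ℂ) + SmoothWeight.s0 (Skeleton.t0 D) + v * I) :=
      (((differentiableAt_Zfac_inv x himv).mul ((differentiable_kconvHead c' x a₁) _)).mul
        ((differentiable_ApolyBar_one_sub x a₂) _)).mul ((differentiable_omegaW D) _)
    exact (hdAt.continuousAt.comp (f := fun v : ℝ => ((1 : ℝ) : ℂ) +
      SmoothWeight.s0 (Skeleton.t0 D) + v * I) hpath.continuousAt).continuousWithinAt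
  have hIt : IntervalIntegrable (fun v : ℝ => Ft (((1 : ℝ) : ℂ) + SmoothWeight.s0 (Skeleton.t0 D) +
      v * I)) MeasureTheory.volume (-Skeleton.ell1 D) (Skeleton.ell1 D) := by
    refine ContinuousOn.intervalIntegrable ?_
    rw [Set.uIcc_of_le (by linarith)]
    intro v hv
    have himv : 0 < (((1 : ℝ) : ℂ) + SmoothWeight.s0 (Skeleton.t0 D) + v * I).im := by
      rw [him]; linarith [hv.1]
    have hsU : ((1 : ℝ) : ℂ) + SmoothWeight.s0 (Skeleton.t0 D) + v * I ∈ {s : ℂ | 5 / 4 < s.re} := by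
      show (5 : ℝ) / 4 < (((1 : ℝ) : ℂ) + SmoothWeight.s0 (Skeleton.t0 D) + v * I).re
      rw [hre]; norm_num
    have hdAt : DifferentiableAt ℂ Ft (((1 : ℝ) : ℂ) + SmoothWeight.s0 (Skeleton.t0 D) + v * I) :=
      (((differentiableAt_Zfac_inv x himv).mul (htailOn.differentiableAt (hU.mem_nhds hsU))).mul
        ((differentiable_ApolyBar_one_sub x a₂) _)).mul ((differentiable_omegaW D) _)
    exact (hdAt.continuousAt.comp (f := fun v : ℝ => ((1 : ℝ) : ℂ) +
      SmoothWeight.s0 (Skeleton.t0 D) + v * I) hpath.continuousAt).continuousWithinAt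
  -- linearity of the segment integral
  have hintJ : intJ D 1 (mvIntegrand c' x a₁ a₂) = u * (intJ D 1 Fh + intJ D 1 Ft) := by
    rw [intJ, intJ, intJ, Lemma81.segInt_def, Lemma81.segInt_def, Lemma81.segInt_def,
      intervalIntegral.integral_congr fun v hv => hsplit v hv, intervalIntegral.integral_const_mul,
      intervalIntegral.integral_add hIh hIt]
    ring
  -- the two exponential error terms under one exponent
  have hexp : ∀ (c C : ℝ), min c₁ c₂ ≤ c →
      C * Real.exp (-c * Skeleton.ell D ^ 10) ≤ max C 0 * Real.exp (-min c₁ c₂ * Skeleton.ell D ^ 10) := by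
    intro c C hc
    have h10 : 0 ≤ Skeleton.ell D ^ 10 := by positivity
    calc C * Real.exp (-c * Skeleton.ell D ^ 10) ≤ max C 0 * Real.exp (-c * Skeleton.ell D ^ 10) :=
          mul_le_mul_of_nonneg_right (le_max_left _ _) (Real.exp_pos _).le
      _ ≤ max C 0 * Real.exp (-min c₁ c₂ * Skeleton.ell D ^ 10) :=
          mul_le_mul_of_nonneg_left (Real.exp_le_exp.mpr (by nlinarith)) (le_max_right _ _)
  calc ‖intJ D 1 (mvIntegrand c' x a₁ a₂)‖ = ‖intJ D 1 Fh + intJ D 1 Ft‖ := by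
        rw [hintJ, norm_mul, hu1, one_mul]
    _ ≤ ‖intJ D 1 Fh‖ + ‖intJ D 1 Ft‖ := norm_add_le _ _
    _ ≤ (absIntJ D 0 (fun s => kconvHead c' x a₁ s *
            (Skeleton.ApolyBar x a₂ (1 - s) * Skeleton.omegaW D s)) +
          C₁ * Real.exp (-c₁ * Skeleton.ell D ^ 10)) + C₂ * Real.exp (-c₂ * Skeleton.ell D ^ 10) :=
        add_le_add hb ht
    _ ≤ (absIntJ D 0 (fun s => kconvHead c' x a₁ s *
            (Skeleton.ApolyBar x a₂ (1 - s) * Skeleton.omegaW D s)) +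
          max C₁ 0 * Real.exp (-min c₁ c₂ * Skeleton.ell D ^ 10)) +
          max C₂ 0 * Real.exp (-min c₁ c₂ * Skeleton.ell D ^ 10) :=
        add_le_add (add_le_add le_rfl (hexp c₁ C₁ (min_le_left _ _))) (hexp c₂ C₂ (min_le_right _ _))
    _ = absIntJ D 0 (fun s => kconvHead c' x a₁ s *
            (Skeleton.ApolyBar x a₂ (1 - s) * Skeleton.omegaW D s)) +
          (max C₁ 0 + max C₂ 0) * Real.exp (-min c₁ c₂ * Skeleton.ell D ^ 10) := by ring

variable (c' : ℝ) in
/-- `Step7u018` — `_holds` alias of `step7u018_holds` above under the fact's exact name, stated under the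
prover's own binders as section variables (appended 2026-08-28, D-0026 bookkeeping: the proof term is the
existing theorem of this file; no statement, definition or attribute is edited; no new named fact; the
ledger's debt table listed the fact unproved). [cite: Zhang2022LandauSiegel, §7 p.35, tex L1886–1899] -/
theorem _root_.Literature.NumberTheory.LFunctions.Zhang2022.Section7aStatements.Step7u018_holds :
    _root_.Literature.NumberTheory.LFunctions.Zhang2022.Section7aStatements.Step7u018 c' :=
  _root_.Literature.NumberTheory.LFunctions.Zhang2022.Section7aStatements.step7u018_holds (c' := c')

end MoveAssembled

end Literature.NumberTheory.LFunctions.Zhang2022.Section7aStatements
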